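import Literature.MathematicalPhysics.QuantumFieldTheory.Balaban1983to89.T3MinimiserStabilityReduction
import Literature.MathematicalPhysics.QuantumFieldTheory.Balaban1983to89.T3PrintedRegularMinimiser
import Literature.MathematicalPhysics.QuantumFieldTheory.Balaban1983to89.T3OrbitAverage
import Literature.MathematicalPhysics.QuantumFieldTheory.Balaban1983to89.B12ContinuousTransportInvariance
import Literature.MathematicalPhysics.QuantumFieldTheory.Balaban1983to89.Node00.CanonicalTransportOfRecord
import Summits.QuantumFields.YangMills.Theorems.FluctuationComparisonRegPrIntLWreg
import Summits.QuantumFields.YangMills.Theorems.FluctuationComparisonRegPrIntLS2BetaLaplaceInstLocal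
import Summits.QuantumFields.YangMills.Theorems.FluctuationComparisonRegPrIntLS2BetaFibreTransport
import Summits.QuantumFields.YangMills.Theorems.FluctuationComparisonRegPrIntLS2BetaFibreGrowth
import Summits.QuantumFields.YangMills.Theorems.FluctuationComparisonRegPrIntLS2BetaChartSmooth
import Summits.QuantumFields.YangMills.Theorems.FluctuationComparisonRegPrIntLS2BetaLaplacePeano
import Summits.QuantumFields.YangMills.Theorems.FluctuationComparisonRegPrIntLS2BetaDecayLogDet
import Summits.QuantumFields.YangMills.Theorems.FluctuationComparisonRegPrIntLS2BetaResidualSubgroup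
import Summits.QuantumFields.YangMills.Theorems.FluctuationComparisonRegPrIntLS2BetaDetRepAEdgePointwise
import Summits.QuantumFields.YangMills.Theorems.FluctuationComparisonRegPrIntLS2BetaPeanoSmoothParam
import Summits.QuantumFields.YangMills.Theorems.FluctuationComparisonRegPrIntLS2BetaChartContLaplaceRowsJoint
import Summits.QuantumFields.YangMills.Theorems.FluctuationComparisonRegPrIntLS2BetaFibreTransportCharted
import Summits.QuantumFields.YangMills.Theorems.FluctuationComparisonRegPrIntLS2BetaGrowthShift
import Summits.QuantumFields.YangMills.Theorems.FluctuationComparisonRegPrIntLS2BetaPivotStabiliser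
import Summits.QuantumFields.YangMills.Theorems.FluctuationComparisonRegPrIntLS2BetaDecayRates
import Literature.Analysis.Matrix.LogDetMixedDifferenceLocallySummedIcc
import HarnessLib

/-!
# LINE g17-2 · «SEMICLASSICAL ISOLATION TABLE FOR S2β» — v4 (ideator seat ym-r3-idea-1, generation g18; lens «control»)

**v11.4 — THE ∘-PATCH (★★OWNER WORD 87 (2)∕(3); worked file by ym-ust-20520-w4 g17 on top of v11.3 = DET-REP-B‴ 8b0e9aaf67bb2610, `def DetRepB`'s ∘-letter
block reserved to ym-ust-20520-w5 g15).**  After R3-FLIN (instrument rows JOB FL∕FL-B, WORD 80∕81: on the FULL window the one-step constrained minimiser over an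
edge datum leaves `histGood_{J+1}` at `L = 3, 5`), every WINDOW clause of the FIVE registered rows is read on the `cw`-INTERIOR window `PlaqSmall (θBal F.L γ (cw * b₀) p₀ J)`
under ONE shared prefix `∀ (L : ℕ), ∃ c₀ : ℝ, 0 < c₀ ∧ c₀ ≤ 1 ∧ ∀ (cw : ℝ), 0 < cw → cw ≤ c₀ → ∃ pS …` («for every sufficiently small window fraction», closed under
shrinking `cw` by fiat; concluders take `min c₀ᵢ`), while every HISTORY clause (`histGood (θBal … b₀ …)`, `regFibrePr`, `argminHist`, the chart of record and its
domain, `heightDensityCan`, `fluctAtCan`, `oneLoopFourPtCan`) keeps the profile `b₀`: EXW∘ (ONE clause moved: the datum guard), GAP♯∘ (the datum guard),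
DET-REP-B‴∘ (the four corner guards + the path's window clause of `EdgeRows`, which gains the parameter `cw` — the path must run in the interior because ✓`edge_rep_det`
applies GAP♯∘ at every path datum; plus (E0): `Icc 0 1 ⊆ I ↦ 0 ∈ I ∧ 1 ∈ I`, the door reading the edges only at `s ∈ {0,1}`), H4ᶜ∘∕LFR♯ᶜ∘ (texts of ideator g21's
`Lines/interior_table.lean` v1 3a1213f3, BYTE-IDENTICAL, with its 1L4ᶜ∘ and PROVED composition `fluctuationPartSmall_of_interiorTable`).  The docking is re-proved
under ∘: `cornerLimit_of_rows`, `edge_rep_det`, `fourPtDecay_of_detRep : GAP♯∘ → DET-REP-B‴∘ → FourPtDecay∘`, `oneLoopLaplace_of_docking : ChartSmooth → FourPtDecay∘ →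
EXW∘ → GAP♯∘ → WREG → 1L4ᶜ∘` — with the ONE new move «a `cw`-interior datum is a window datum» (`θBal_mul(_le)` + `plaqSmall_of_le`) wherever the chart of record,
WREG (✓`windowRegularity`, full window) or a proved supplier keyed to the full window at profile `b₀` meets an interior datum; CHART-SMOOTH stays closed by name on the
full window.  Unique concluder `fluctuationPartSmall_of_stubs` (name unchanged) := `fluctuationPartSmall_of_interiorTable` over the five stubs
{`stub_windowExactness`, `stub_uniformFibreGapOrbit`, `stub_detRepB`, `stub_beyondOneLoopSmallIntCan`, `stub_largeFieldFourPtIntCan`}; sorries = 5; the full-window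
rows 1L4ᶜ∕H4ᶜ∕LFR♯ᶜ and their composition stay as v11.2a's definitions of record (no stub).  Nothing of the five rows is proved by the patch; it is a RE-LETTERING
priced by idea-crit-5 (WORD 87 (3)(d)).

Crux of record: `stmt-QuantumFields-20520` (`UnitScaleTilt.FluctuationComparisonRegPrIntL`); package of record
`Cruxes/FluctuationComparisonRegPrIntL/Lines/runpair_organ.lean` (v15), registered input **S2β `FluctuationPartSmall`** (one run: the window
log-density PLUS its tree-level part `β_K · minActionRegPr F J K` has κ-clustered connected 4-points `≤ φ J`, `J·φ J → 0`, depth-uniform).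

v4 = the rule-(4) response to the PLUMB hand's verdict STUB-MISSTATED on v3a's `stub_oneLoopPlumbing` (ym-ust-plumb-1 g0, certificate
`Lines/semiclassical_s2beta_plumb_version.lean`: pointwise clauses on the trunk's `heightDensity` — at depth ≥ 1 the `toReal` of a
`Classical.choose`-selected Radon–Nikodym representative — can be neither proved nor refuted; `exists_version_positivity_fails`).  DIAGNOSIS: the
rows were typed on the wrong object (a representative), not on the a.e.-class.  VARIATION (adopting the hand's count-neutral OFFER
`Lines/semiclassical_s2beta_plumb_retyped.lean` verbatim, §§1–3): every row reads the restricted density through its CANONICAL VERSION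
`heightDensityCan := Node00.canonVersion (fieldMeasure …) (heightDensity …)` (tree precedent NODE 00 row P7 `TcanOfRecord`): a.e. equal to `heightDensity`,
continuous on the maximal regular open set `regSet` of the class and there pointwise determined.  1L4ᶜ `OneLoopClusteredCan` = **(R)** window ⊆ `regSet`
for every `λ ≥ 1` ∧ **(P)** positivity of the canonical version on the window ∧ **(T)** existence + κ-clustering of the semiclassical limit; H4ᶜ, LFR♯ᶜ the same
substitution; S2β's text UNCHANGED (version-free); composition 1L4ᶜ → H4ᶜ → LFR♯ᶜ → S2β PROVED (the offer's proof).

NEW IN v4 (this seat's content beyond the offer): the honest analytic content that PLUMBᶜ added to v3a's plumbing — (R) ∧ (P) — is NOT classical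
Laplace asymptotics and is COUPLING-INDEPENDENT, so it is isolated as a third ORGAN under 1L4ᶜ, shared with LINE g17-1 (whose SFRᶜ needs exactly (P)):

* **WREG `WindowRegularity`** (organ stub, M–L, measure theory of the iterated (0.4) averaging): for every block size, thresholds `b₀, p₀ > 0` and
  `γ ≤ γ₁`, every run `K`, height `J ≤ K` and EVERY weight coupling `γ′ > 0`: the `θ_J(γ)`-window lies in `regSet` of the `γ′`-weighted small-field
  fibre density `heightDensity F γ′ hJK (histGood at θBal γ)`, and its canonical version is positive on the window.  Mechanism: a local FIBRED CHART of
  the `(K−J)`-fold small-field averaging over the window (the door `Node00.subset_regSet_transform_of_fibredChart` of the N09 programme; the one-step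
  submersion in central-bond coordinates PROVED for `SU(2)` by the 19201 seats, `OneStepSubmersion.oneStepSubmersion`), fibrewise Haar-nullity of the
  frontier of `histGood` (level sets of intermediate plaquette variables along the fibres) for pointwise dominated convergence, and positive fibre mass
  of `histGood` over every window datum (print's regular minimiser is a small-field history: EXW clause 2).  Why it might fail: a fibre COMPONENT on which an
  intermediate plaquette variable is constant `= θ_j` exactly (then the fibre integral jumps and (R) fails at that datum) — cheapest falsifier: the rank
  of `d(plaq_p ∘ avg^{i})|T(fibre)` at `U ≡ 1`, depth 1, `L = 2` (linear algebra); and the guard: the chart needs `((d+2)L)²·θ < 4δ₂` at every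
  intermediate level, which the prefix `γ ≤ γ₁(L, b₀, p₀)` buys.
* **LAPLACE `stub_oneLoopLaplace : WindowExactness → UniformFibreGapOrbit → WindowRegularity → OneLoopClusteredCan`** (this line's own row-1 content, M,
  classical): given (R) ∧ (P) from WREG for the couplings `γ/λ`, only (T) remains — Laplace asymptotics on the compact real-analytic fibre with the interior
  (EXW) non-degenerate (GAP♯, v6: the minimum set is ONE residual-gauge ORBIT of datum-independent dimension, transversally non-degenerate — the Morse–Bott
  input of `Literature.Analysis.Asymptotics.LaplaceMethodOrbitCompact.tendsto_laplaceMethod_sum_orbits_of_continuous`) minimiser, datum-independence of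
  the `−(n/2) log λ` term, Jacobi's formula + Combes–Thomas for `Δ_bΔ_{b′} log det`.
  `oneLoopRP_of_windowRegularity` (PROVED) certifies that WREG delivers 1L4ᶜ's conjuncts (R) ∧ (P) at every `λ ≥ 1` on the nose.
* LFRᶜ `LargeFieldPolymerRepCan` (LINE g17-1's large-field row over the canonical version, restated) ⇒ LFR♯ᶜ PROVED (`largeFieldFourPtCan_of_polymerRep`,
  polymer-norm clustering PC restated in §1b), as in v3a.

Sorries = {EXW `stub_windowExactness`, GAP♯ `stub_uniformFibreGapOrbit` (v6; v5 had GAP `stub_uniformFibreGap`), WREG `stub_windowRegularity`,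
LAPLACE `stub_oneLoopLaplace`, H4ᶜ
`stub_beyondOneLoopSmallCan`, LFR♯ᶜ `stub_largeFieldFourPtCan`}; organs keyed to their seats and counted once (WREG: this seat's LINE g18-2
`Lines/wreg_chart.lean` files its table — **v7: `stub_windowRegularity` CLOSED BY NAME on F6 ✓p734433
`Summit.QuantumFields.YangMills.Theorems.FluctuationComparisonRegPrIntLWreg.windowRegularity` (the Theorems-side port of LINE g18-2
`Lines/wreg_chart.lean` v20 @7e8eb395e5b4; `Iff.rfl`-identical `WindowRegularity`); live sorries of this line: 5 = {EXW, GAP♯, LAPLACE, H4ᶜ, LFR♯ᶜ}** — **v6 note (17:10Z, LINE OWNER WORD 6 on the ORBIT flag of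
w4-20520 g15 17:00Z): LAPLACE's second hypothesis is re-typed GAP → GAP♯ `UniformFibreGapOrbit` (§4: stiffness to the RESIDUAL-GAUGE ORBIT of any minimiser;
GAP♯ ⇒ ORB «`argminHist V` is one residual orbit» ∧ GAP), because GAP alone does not pin the dimension of `argminHist V` and (T)'s `−(n/2)·log λ` term is
datum-independent only on a Morse–Bott orbit of constant dimension; GAP stays a def; decl texts of every other item unchanged**).  **v8 (19:47Z 2026-08-29, w4-20520 g15 — LINE OWNER WORD 12 «DOCKING», LEAD
w3-20520 g14 GO 19:23Z): LAPLACE `stub_oneLoopLaplace` is a THEOREM (`oneLoopLaplace_of_docking`), its residue DISPLAYED as two new stubs — CHART-SMOOTH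
`stub_chartSmooth` (§4b `ChartSmooth`: one window chart with the CHART∞ rows `ChartRows` (= the per-datum export of w3-20520 g14's
`…ChartContLaplaceRows.exists_laplaceRows`) and, per window datum and minimising history, the (C3β″)+(T2)+(C2) package `ChartPackage`) and FOUR-POINT-DECAY
`stub_fourPtDecay` (§4b `FourPtDecay`: chart-free κ-clustering of the 4-point of the logs of the per-corner scaled Laplace LIMIT VALUES); composition BY NAME
through the landed doors ✓`…S2BetaFibreTransport.limitInst_exw_gap_rows_of_chartRows` (px11 g10, EXW+GAP♯ → fine rows), ✓`…S2BetaFibreGrowth` (px11 g10, GAP♯+(T2) → growth), ✓`…S2BetaLaplacePeano`,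
✓`…S2BetaLaplaceInstLocal.laplaceLimit_of_charts_local` (w5-20520 g13∕g14), ✓`…S2BetaLaplaceKnit.tendsto_fourPt_fluct_of_laplaceLimits` (this seat);
EXW, GAP♯, WREG genuinely consumed; live sorries 6 = {EXW, GAP♯, CHART-SMOOTH, FOUR-POINT-DECAY, H4ᶜ, LFR♯ᶜ}; texts of EXW∕GAP♯∕WREG∕1L4ᶜ∕H4ᶜ∕LFR♯ᶜ∕S2β unchanged.**  **v9 (20:27Z 2026-08-29, w4-20520 g15): CHART-SMOOTH
`stub_chartSmooth` PROVED in-file, by projection from the landed suppliers — CHART∞ V-c3 ✓`…ChartContLaplaceRows.exists_laplaceRows` (w3-20520 g14; rows +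
recognition + carrier neighbourhood), (C3β″)+(T2) ✓`…TubularChartDockTransversal.exists_tubularHaarChart_pivotAct_transversal` (px21 g9∕g10), RG-K
✓`…ResidualGaugeStabiliser.pivotAct_eq_self_imp_central` ∕ `pivotAct_central_sheet_eq` (px11 g9; `Sst :=` central sheets × `{1}`, pivots off the comb by
✓`…SignedCombCount.iterCentralBond_not_mem_combSet`), (C2) ✓`…PeanoSmooth.contDiffAt_wilsonAction4_windowChart_of_histGood` + `exists_gamma_chainRegime`
(w5-20520 g14, over px11 g10's (C2-b)); def texts of v8.1 (sha16 0fb237048376703f) byte-identical; live sorries 5 = {EXW, GAP♯, FOUR-POINT-DECAY, H4ᶜ, LFR♯ᶜ};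
v9.1: `stub_chartSmooth` CLOSED BY NAME on w5-20520 g14's ✓`…Theorems.FluctuationComparisonRegPrIntLS2BetaChartSmooth.chartSmooth` (the same projections, Theorems-side).**  **v10 → v10.1 (21:07Z → 21:35Z
2026-08-29, w4-20520 g15): v10 displayed a determinant-form stub DET-REP `DetRepLocalised` below FOUR-POINT-DECAY and proved `fourPtDecay_of_detRep`; px19 g10's
LOCATE BY KERNEL (21:26Z, `detRepLocalised_of_cornerLimits_and_rate`, evidence #50) showed DET-REP is inhabited by the DEGENERATE instance `ι := Unit`, `M = N := 1`,
`jl := log ℓ` given the corner limits (LAPLACE's own output) and FOUR-POINT-DECAY's rate — its operator rows bind nothing because `∃ ι M N jl` ties them to no object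
of record; so DET-REP ≡ FOUR-POINT-DECAY (rate `C·θ_J²`) and was WITHDRAWN: v10.1 = v9.1's texts and stubs exactly (FOUR-POINT-DECAY displayed, no hand); the
composition survives Theorems-side as the reduction lemma `…S2BetaFourPtDecayOfDetRep.fourPtDecay_of_detRep` for suppliers that BIND `M, N, jl` to the background
(common tube: `M := toMatrix (Hess_y A(c.Φ(x, σ_U ·)))`, `jl := log (V_y · jac)`; FP route: `M := H + DD^*`, `N := D^*D`).**  **v11 (22:50Z 2026-08-29,
w4-20520 g16 — LINE-OWNER RULING (W3) (2) «DET-REP-A BY NAME ⊕ DET-REP-B DISPLAYED for the operators OF RECORD», WORD W4): FOUR-POINT-DECAY `stub_fourPtDecay` is a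
THEOREM (`fourPtDecay_of_detRep : UniformFibreGapOrbit → ChartSmooth → DetRepB → FourPtDecay`, §4c); DET-REP-A = w5-20520 g14's ✓`…S2BetaDetRepAEdge.detRepA_edge`
((REP)+(DET) for one EDGE of a quadrilateral in the common tube: the scaled Laplace limits in the form `exp (c₀ + log jV + log jac − ½ log det M)` with THE BOUND slice-Hessian
matrix `M := hessStd (A∘c.Φ(x ·, σ ·)) y`, consumed BY NAME in `edge_rep_det` with every undisplayed binder discharged — residual group∕Haar∕`pivotAct`, `ChartRows` at every
interpolated datum, the central-sheet set, positivity of the sheet volume, (F3)-openness, `0 < jac`, and GAP♯'s strictness off the orbit of a SHIFTED tube point via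
✓`…S2BetaFibreTransportCharted.limitInst_gap_rows_of_windowChart_charted` (this seat, p748853)); DET-REP-B `stub_detRepB` is the NEW displayed organ stub (§4c `DetRepB`:
per quadrilateral ONE tube `TubeRows` (px21 E3″ rows), the two EDGES `U→V`, `W→Z` with minimiser coordinates `EdgeRows` (BRD, qualitative), px19 g10's product letters
`ProductRows` for THE NAMED `M_t` (LOC) and the amplitude 4-point of THE NAMED `jl_t := log jV∘y_t + log jac` (JAC), uniform `C, θ₂ < θ`, `B := C·θ_J²`); composition:
`edge_rep_det` ×2 → `fourPt_log_eq_of_limits₄` (FOUR-POINT-DECAY's free `ℓ`, `d` identified with the (REP) values; edge constants cancel in `Δ²`) →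
✓`Literature.Analysis.Matrix.abs_fourPt_log_det_le_of_productRows_of_subset` (px19∕px7 rectangle) + (JAC) ⇒ `|Δ² log ℓ| ≤ 2·C·θ_J²·e^{−(θ−θ₂)·tdist}`, `κ := θ − θ₂`,
`φ₁ J := 2·C·θBal_J²` (✓`tendsto_mul_θBal_sq`).  REGRESSION (RULING W3): no operator, index type or amplitude of `DetRepB` is a binder — px19 g10's degenerate witness
`ι := Unit, M := 1, jl := log ℓ` of v10's DET-REP cannot be written; EXW is not a hypothesis of `fourPtDecay_of_detRep` (it would be idle: the tube and the charted
minimisers are DET-REP-B's ∃), GAP♯ and CHART-SMOOTH are genuinely consumed.  Live sorries 5 = {EXW, GAP♯, DET-REP-B, H4ᶜ, LFR♯ᶜ}; def texts of EXW∕GAP♯∕WREG∕1L4ᶜ∕H4ᶜ∕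
LFR♯ᶜ∕S2β∕ChartRows∕ChartPackage∕ChartSmooth∕FourPtDecay BYTE-IDENTICAL to v10.1.**  **v11.1 (w4-20520 g16): DET-REP-B's display loses its one GAP♯-flavoured row —
`EdgeRows`' transversal GROWTH row (and its binder `c₁`) is GONE, derived instead in `edge_rep_det` as GAP♯ ∘ (T2-ALL) ∘ ✓`…S2BetaGrowthShift.growth_at_tubePoint` (this seat,
p750179) and fed to w5-20520 g14's per-`s` edition ✓`…S2BetaDetRepAEdgePointwise.detRepA_edge'` (p751007); `TubeRows` gains the frame-free row **(T2-ALL)** «off-pivot quadratic transversality of the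
tube at every point of the transversal window» (supplier: px21 g11's ✓`…S2BetaTransversalShift(Uniform)` on the window shrunk to `‖(eV y)_b‖ < 1∕2`); the smooth one-bond
path inside the exact window now has a supplier (px21 g11 ✓`…S2BetaOneBondGeodesic.exists_oneBondPath`, p749974 — organ-side, the paths stay ∃ because the product letters
depend on them); organ texts and every other v11 block byte-identical; sorries 5 unchanged.**  Instrument row of record for row 1: R3-ONELOOP-4PT (VALID · SIZE 8/8 · DECAY-A1 · DEPTH PASS, reads the
one-loop 4-point, untouched by the re-typing); for WREG: R3-WREG-RANK (new, B2: rank of the linearised intermediate-plaquette map on the fibre tangent at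
`U ≡ 1`, `L = 2`, depth 1 — full rank ⇒ FNUL at the symmetric point; rank drop ⇒ WREG suspect).

No summit is proved by a line; `YM3TorusSU2` is NOT proved (the package's other inputs S1a, 26243, S2α′, O1 stay open); nothing of Bałaban's asserted.
-/

noncomputable section

open MeasureTheory Filter Topology Set
open Literature.MathematicalPhysics.QuantumFieldTheory.Balaban1983to89
open Literature.MathematicalPhysics.QuantumFieldTheory.Balaban1983to89.T3ContinuumYM3Torus
open Literature.MathematicalPhysics.QuantumFieldTheory.Balaban1983to89.T3NestedUnitLaws
open Literature.MathematicalPhysics.QuantumFieldTheory.Balaban1983to89.T3UnitLawDensityEML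
open Literature.MathematicalPhysics.QuantumFieldTheory.Balaban1983to89.T3UnitScaleTilt
open Literature.MathematicalPhysics.QuantumFieldTheory.Balaban1983to89.T3TiltDescent
open Literature.MathematicalPhysics.QuantumFieldTheory.Balaban1983to89.T3PrintedRegularMinimiser
open Literature.MathematicalPhysics.QuantumFieldTheory.Balaban1983to89.T3ConstrainedMinimiser (fibre)
open Literature.MathematicalPhysics.QuantumFieldTheory.Balaban1983to89.T3LevelShift
open Literature.MathematicalPhysics.QuantumFieldTheory.Balaban1983to89.Missing
open Literature.MathematicalPhysics.QuantumFieldTheory.Balaban1983to89.T4Continuum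
open scoped Literature.MathematicalPhysics.QuantumFieldTheory.Balaban1983to89.T3OrbitAverage

namespace Summit.QuantumFields.YangMills.Cruxes.FluctuationComparisonRegPrIntL.RunPairOrgan.OneLoop

/-! ## §1 The canonical version of the restricted height density and its unconditional faces -/

section Canonical

variable (F : T3Family) (γ : ℝ) {J K : ℕ} (hJK : J ≤ K) (S : Set (GaugeField (F.P K) 0 (Matrix.specialUnitaryGroup (Fin 2) ℂ)))

/-- **THE CANONICAL VERSION OF BAŁABAN'S RESTRICTED DENSITY AT HEIGHT `K − J`** read on the `J`-th tower's finest lattice: the trunk's `heightDensity`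
(a chosen Radon–Nikodym version) replaced by `Node00.canonVersion` of its a.e.-class for product Haar — continuous on the maximal open set carrying a
continuous representative and equal there to every such representative. [cite: Balaban1985UV3, (2) p.256 and (41) p.266] -/
def heightDensityCan (V : GaugeField (F.P J) 0 (Matrix.specialUnitaryGroup (Fin 2) ℂ)) : ℝ :=
  Node00.canonVersion (fieldMeasure (F.P J) 0 (Matrix.specialUnitaryGroup (Fin 2) ℂ)) (heightDensity F γ hJK S) V

/-- The canonical version IS a version: `heightDensityCan = heightDensity` a.e. (no hypothesis). [cite: Balaban1985UV3, (2) p.256] -/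
theorem heightDensityCan_ae_eq :
    heightDensityCan F γ hJK S =ᵐ[fieldMeasure (F.P J) 0 (Matrix.specialUnitaryGroup (Fin 2) ℂ)] heightDensity F γ hJK S :=
  Node00.canonVersion_ae_eq

variable {γ S}

/-- Hence the trunk's density identity holds for it: `(D_{J,K})_*(Gibbs_K|S) = dV.withDensity (Z_K⁻¹ · heightDensityCan)` (`γ ≥ 0`, `S` measurable).
[cite: Balaban1985UV3, (2) p.256 + (6) p.257] -/
theorem map_descendTo_restrict_eq_withDensity_can (hS : MeasurableSet S) (hγ : 0 ≤ γ) :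
    Measure.map (descendTo F ℰp J K hJK) ((gibbsK F ℰp γ K).restrict S) =
      (fieldMeasure (F.P J) 0 (Matrix.specialUnitaryGroup (Fin 2) ℂ)).withDensity (fun V => ENNReal.ofReal
        ((partitionFn (G := Matrix.specialUnitaryGroup (Fin 2) ℂ) (F.P K) ((F.scheme ℰp γ).β K))⁻¹ * heightDensityCan F γ hJK S V)) := by
  rw [map_descendTo_restrict_eq_withDensity F hJK hS hγ]
  refine withDensity_congr_ae ?_
  filter_upwards [heightDensityCan_ae_eq F γ hJK S] with V hV
  rw [hV]

variable (γ S)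

/-- **POINTWISE DETERMINACY**: on every OPEN set of coarse fields on which SOME a.e.-representative `g` of the restricted density is continuous, the canonical
version equals `g` at every point. [cite: Balaban1985UV3, (2) p.256] -/
theorem heightDensityCan_eqOn_of_continuousOn {U : Set (GaugeField (F.P J) 0 (Matrix.specialUnitaryGroup (Fin 2) ℂ))} (hU : IsOpen U)
    {g : GaugeField (F.P J) 0 (Matrix.specialUnitaryGroup (Fin 2) ℂ) → ℝ} (hg : ContinuousOn g U)
    (hae : g =ᵐ[(fieldMeasure (F.P J) 0 (Matrix.specialUnitaryGroup (Fin 2) ℂ)).restrict U] heightDensity F γ hJK S) :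
    EqOn (heightDensityCan F γ hJK S) g U := by
  haveI := B12ContinuousTransportInvariance.isOpenPosMeasure_fieldMeasure_SU (N := 2) (F.P J) 0
  exact Node00.canonVersion_eqOn_of_continuousOn hU hg hae

/-- The canonical version is continuous on the maximal regular open set of the a.e.-class. [cite: Balaban1985UV3, (2) p.256] -/
theorem continuousOn_heightDensityCan :
    ContinuousOn (heightDensityCan F γ hJK S)
      (Node00.regSet (fieldMeasure (F.P J) 0 (Matrix.specialUnitaryGroup (Fin 2) ℂ)) (heightDensity F γ hJK S)) := by
  haveI := B12ContinuousTransportInvariance.isOpenPosMeasure_fieldMeasure_SU (N := 2) (F.P J) 0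
  exact Node00.continuousOn_canonVersion

end Canonical

/-! ## §1b Polymer calculus (restated verbatim from LINE g17-1 `Lines/polymer_norm_s2beta.lean`, needed to derive LFR♯ᶜ from LFRᶜ): V-local activity systems, the weighted norm, and the PROVED 4-point clustering -/

section PolymerCalculus

variable {P : Params} {G : Type*} {n : ℕ}

/-- **V-LOCALITY**: the activity of polymer `X` depends on the window field only through the bonds of its support `supp X`
([Balaban1987RG1] (0.22) «E(X, ·) depends on the field restricted to X»). [cite: Balaban1987RG1, (0.22)] -/
def IsLocal (supp : Fin n → Finset (PBond P 0)) (act : Fin n → GaugeField P 0 G → ℝ) : Prop :=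
  ∀ X (U U' : GaugeField P 0 G), (∀ e ∈ supp X, U e = U' e) → act X U = act X U'

open Classical in
/-- **A V-LOCAL POLYMER REPRESENTATION OF `f` ON THE WINDOW `W` WITH WEIGHTED NORM `≤ N` AT RATE `κ`**: finitely many polymers `X` with bond
supports, lengths `len X ≥` the source-distance diameter of the support, weights `wt X ≥ sup_W |act X|`, the exponentially weighted norm
`sup_b Σ_{X ∋ b} wt X · e^{κ·len X} ≤ N`, and the IDENTITY `f = c + Σ_X act X` on `W` ([Balaban1987RG1] (0.21)–(0.26); the norm is the
`‖·‖_κ` of [Brydges1986] §3 / Dimock arXiv:1108.1335 (38)). [cite: Balaban1987RG1, (0.23)-(0.26)] -/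
def PolymerRepOn (W : Set (GaugeField P 0 G)) (κ N : ℝ) (f : GaugeField P 0 G → ℝ) : Prop :=
  ∃ (n : ℕ) (supp : Fin n → Finset (PBond P 0)) (len wt : Fin n → ℝ) (act : Fin n → GaugeField P 0 G → ℝ) (c : ℝ),
    IsLocal supp act ∧ (∀ X, 0 ≤ wt X) ∧
    (∀ X, ∀ e ∈ supp X, ∀ e' ∈ supp X, (e.src.tdist e'.src : ℝ) ≤ len X) ∧
    (∀ X U, U ∈ W → |act X U| ≤ wt X) ∧
    (∀ e : PBond P 0, ∑ X ∈ Finset.univ.filter (fun X => e ∈ supp X), wt X * Real.exp (κ * len X) ≤ N) ∧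
    ∀ U, U ∈ W → f U = c + ∑ X, act X U

open Classical in
/-- **PC · POLYMER NORM ⇒ κ-CLUSTERED CONNECTED 4-POINTS (PROVED)**: under the four one-bond window moves of S2β at bonds `b, b′`, the
polymers whose support misses `b` or misses `b′` cancel EXACTLY by V-locality; each survivor contributes `≤ 4·wt X ≤ 4·wt X·e^{κ len X}·e^{−κ·tdist(b,b′)}`
(`len X ≥ tdist`), and the weighted norm sums them: `|Δ_bΔ_{b′}(c + Σ act)| ≤ 4N·e^{−κ·tdist(b,b′)}`. [cite: Balaban1987RG1, (0.23)-(0.26)] -/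
theorem fourPoint_le_of_polymerNorm (W : Set (GaugeField P 0 G)) (supp : Fin n → Finset (PBond P 0)) (len wt : Fin n → ℝ)
    (act : Fin n → GaugeField P 0 G → ℝ) (κ N c : ℝ) (hκ : 0 ≤ κ) (hloc : IsLocal supp act) (hwt : ∀ X, 0 ≤ wt X)
    (hdiam : ∀ X, ∀ e ∈ supp X, ∀ e' ∈ supp X, (e.src.tdist e'.src : ℝ) ≤ len X)
    (hbd : ∀ X U, U ∈ W → |act X U| ≤ wt X)
    (hcov : ∀ e : PBond P 0, ∑ X ∈ Finset.univ.filter (fun X => e ∈ supp X), wt X * Real.exp (κ * len X) ≤ N)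
    (b b' : PBond P 0) (U V Y Z : GaugeField P 0 G) (hU : U ∈ W) (hV : V ∈ W) (hY : Y ∈ W) (hZ : Z ∈ W)
    (hUV : ∀ e, e ≠ b → U e = V e) (hUY : ∀ e, e ≠ b' → U e = Y e) (hVZ : ∀ e, e ≠ b' → V e = Z e)
    (hYZ : ∀ e, e ≠ b → Y e = Z e) :
    |((c + ∑ X, act X U) - (c + ∑ X, act X V)) - ((c + ∑ X, act X Y) - (c + ∑ X, act X Z))|
      ≤ 4 * N * Real.exp (-(κ * (b.src.tdist b'.src : ℝ))) := by
  set d : ℝ := (b.src.tdist b'.src : ℝ) with hd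
  have hT : ((c + ∑ X, act X U) - (c + ∑ X, act X V)) - ((c + ∑ X, act X Y) - (c + ∑ X, act X Z))
      = ∑ X, ((act X U - act X V) - (act X Y - act X Z)) := by
    simp only [Finset.sum_sub_distrib]; ring
  rw [hT]
  have hpt : ∀ X, |(act X U - act X V) - (act X Y - act X Z)|
      ≤ if b ∈ supp X then 4 * (wt X * Real.exp (κ * len X)) * Real.exp (-(κ * d)) else 0 := by
    intro X
    by_cases hb : b ∈ supp X
    · rw [if_pos hb]
      by_cases hb' : b' ∈ supp X
      · have hdle : d ≤ len X := hdiam X b hb b' hb'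
        have hkey : wt X ≤ wt X * Real.exp (κ * len X) * Real.exp (-(κ * d)) := by
          rw [mul_assoc, ← Real.exp_add]
          have h0 : 0 ≤ κ * len X + -(κ * d) := by nlinarith
          calc wt X = wt X * 1 := (mul_one _).symm
            _ ≤ wt X * Real.exp (κ * len X + -(κ * d)) := mul_le_mul_of_nonneg_left (Real.one_le_exp h0) (hwt X)
        have h1 := abs_le.mp (hbd X U hU)
        have h2 := abs_le.mp (hbd X V hV)
        have h3 := abs_le.mp (hbd X Y hY)
        have h4 := abs_le.mp (hbd X Z hZ)
        have h5 : |(act X U - act X V) - (act X Y - act X Z)| ≤ 4 * wt X :=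
          abs_le.mpr ⟨by linarith [h1.1, h2.2, h3.2, h4.1], by linarith [h1.2, h2.1, h3.1, h4.2]⟩
        calc |(act X U - act X V) - (act X Y - act X Z)| ≤ 4 * wt X := h5
          _ ≤ 4 * (wt X * Real.exp (κ * len X) * Real.exp (-(κ * d))) := by linarith
          _ = 4 * (wt X * Real.exp (κ * len X)) * Real.exp (-(κ * d)) := by ring
      · have e1 : act X U = act X Y := hloc X U Y (fun e he => hUY e (fun h => hb' (h ▸ he)))
        have e2 : act X V = act X Z := hloc X V Z (fun e he => hVZ e (fun h => hb' (h ▸ he)))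
        have hw := hwt X
        rw [e1, e2]
        simp only [sub_self, abs_zero]
        positivity
    · rw [if_neg hb]
      have e1 : act X U = act X V := hloc X U V (fun e he => hUV e (fun h => hb (h ▸ he)))
      have e2 : act X Y = act X Z := hloc X Y Z (fun e he => hYZ e (fun h => hb (h ▸ he)))
      rw [e1, e2]
      simp only [sub_self, abs_zero, le_refl]
  calc |∑ X, ((act X U - act X V) - (act X Y - act X Z))|
      ≤ ∑ X, |(act X U - act X V) - (act X Y - act X Z)| := Finset.abs_sum_le_sum_abs _ _
    _ ≤ ∑ X, (if b ∈ supp X then 4 * (wt X * Real.exp (κ * len X)) * Real.exp (-(κ * d)) else 0) :=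
        Finset.sum_le_sum (fun X _ => hpt X)
    _ = (∑ X ∈ Finset.univ.filter (fun X => b ∈ supp X), wt X * Real.exp (κ * len X)) * (4 * Real.exp (-(κ * d))) := by
        rw [Finset.sum_filter, Finset.sum_mul]
        refine Finset.sum_congr rfl (fun X _ => ?_)
        split_ifs <;> ring
    _ ≤ N * (4 * Real.exp (-(κ * d))) := by
        have h4 : 0 ≤ 4 * Real.exp (-(κ * d)) := by positivity
        exact mul_le_mul_of_nonneg_right (hcov b) h4
    _ = 4 * N * Real.exp (-(κ * d)) := by ring

/-- **PC in representation form**: a function with a V-local polymer representation of norm `≤ N` at rate `κ ≥ 0` on `W` has κ-clustered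
connected 4-points `≤ 4N e^{−κ·tdist(b,b′)}` under the four one-bond moves inside `W`. [cite: Balaban1987RG1, (0.23)-(0.26)] -/
theorem fourPoint_le_of_polymerRepOn {W : Set (GaugeField P 0 G)} {κ N : ℝ} {f : GaugeField P 0 G → ℝ}
    (h : PolymerRepOn W κ N f) (hκ : 0 ≤ κ)
    (b b' : PBond P 0) (U V Y Z : GaugeField P 0 G) (hU : U ∈ W) (hV : V ∈ W) (hY : Y ∈ W) (hZ : Z ∈ W)
    (hUV : ∀ e, e ≠ b → U e = V e) (hUY : ∀ e, e ≠ b' → U e = Y e) (hVZ : ∀ e, e ≠ b' → V e = Z e)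
    (hYZ : ∀ e, e ≠ b → Y e = Z e) :
    |(f U - f V) - (f Y - f Z)| ≤ 4 * N * Real.exp (-(κ * (b.src.tdist b'.src : ℝ))) := by
  obtain ⟨n, supp, len, wt, act, c, hloc, hwt, hdiam, hbd, hcov, hrep⟩ := h
  rw [hrep U hU, hrep V hV, hrep Y hY, hrep Z hZ]
  exact fourPoint_le_of_polymerNorm W supp len wt act κ N c hκ hloc hwt hdiam hbd hcov b b' U V Y Z hU hV hY hZ hUV hUY hVZ hYZ

open Classical in
/-- **NORM ZERO ⇒ the trivial representation**: a function constant on `W` has a polymer representation of norm `0` (no polymers) — the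
sanity instance showing the predicate is inhabited exactly by what it should be at norm zero. [cite: Balaban1987RG1, (0.23)-(0.26)] -/
theorem polymerRepOn_of_const (W : Set (GaugeField P 0 G)) (κ c : ℝ) (f : GaugeField P 0 G → ℝ) (hf : ∀ U, U ∈ W → f U = c) :
    PolymerRepOn W κ 0 f := by
  refine ⟨0, Fin.elim0, Fin.elim0, Fin.elim0, Fin.elim0, c, ?_, ?_, ?_, ?_, ?_, ?_⟩
  · intro X; exact Fin.elim0 X
  · intro X; exact Fin.elim0 X
  · intro X; exact Fin.elim0 X
  · intro X; exact Fin.elim0 X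
  · intro e; exact (Finset.sum_eq_zero fun X _ => Fin.elim0 X).le
  · intro U hU; simp [hf U hU]

end PolymerCalculus

/-! ## §2 The rows re-typed over the canonical version, S2β verbatim, and the PROVED composition -/

section Rows

/-- The connected 4-point (mixed second difference) — verbatim from v3a. [cite: Balaban1985UV3, (41) p.266] -/
def fourPt {X : Type*} (f : X → ℝ) (U V W Z : X) : ℝ := (f U - f V) - (f W - f Z)

variable (F : T3Family) (γ b₀ p₀ ε₀ : ℝ) {J K : ℕ} (hJK : J ≤ K)

/-- **THE λ-SCALED FLUCTUATION PART OVER THE CANONICAL VERSION** `f^λ(V) := log heightDensityCan F (γ/λ) (histGood at θBal(γ)) V + β_K(γ/λ)·minActionRegPr(V)`.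
[cite: Balaban1985UV3, (2) p.256 and (41) p.266] -/
def fluctAtCan (lam : ℝ) (V : GaugeField (F.P J) 0 (Matrix.specialUnitaryGroup (Fin 2) ℂ)) : ℝ :=
  Real.log (heightDensityCan F (γ / lam) hJK (histGood F ℰp (θBal F.L γ b₀ p₀) K J) V)
    + (F.scheme ℰp (γ / lam)).β K * minActionRegPr F J K hJK ε₀ V

/-- **THE CANONICAL ONE-LOOP 4-POINT** `Λ₄ := lim_{λ→∞} Δ² f^λ` over the canonical version (junk if the limit does not exist; 1L4ᶜ asserts it does).
[cite: Balaban1985Variational, Thm 1 (8)-(10) p.279] -/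
def oneLoopFourPtCan (U V W Z : GaugeField (F.P J) 0 (Matrix.specialUnitaryGroup (Fin 2) ℂ)) : ℝ :=
  limUnder atTop (fun lam : ℝ => fourPt (fluctAtCan F γ b₀ p₀ ε₀ hJK lam) U V W Z)

/-- At `λ = 1`: S2β's integrand with the canonical small-history density. [cite: Balaban1985UV3, (41) p.266] -/
theorem fluctAtCan_one (V : GaugeField (F.P J) 0 (Matrix.specialUnitaryGroup (Fin 2) ℂ)) :
    fluctAtCan F γ b₀ p₀ ε₀ hJK 1 V =
      Real.log (heightDensityCan F γ hJK (histGood F ℰp (θBal F.L γ b₀ p₀) K J) V)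
        + (F.scheme ℰp γ).β K * minActionRegPr F J K hJK ε₀ V := by
  simp only [fluctAtCan, div_one]

/-- Whenever the λ-scaled 4-point has SOME limit `a`, the canonical one-loop 4-point equals it. [cite: Balaban1985Variational, Thm 1 (8) p.279] -/
theorem oneLoopFourPtCan_eq_of_tendsto (U V W Z : GaugeField (F.P J) 0 (Matrix.specialUnitaryGroup (Fin 2) ℂ)) {a : ℝ}
    (h : Tendsto (fun lam : ℝ => fourPt (fluctAtCan F γ b₀ p₀ ε₀ hJK lam) U V W Z) atTop (𝓝 a)) :
    oneLoopFourPtCan F γ b₀ p₀ ε₀ hJK U V W Z = a := by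
  unfold oneLoopFourPtCan; exact h.limUnder_eq

/-- **1L4ᶜ · ONE-LOOP 4-POINTS EXIST AND ARE CLUSTERED, OVER THE CANONICAL VERSION** (re-typing of v3a's `OneLoopClustered`): same prefix; for every run `K`
and height `J ≤ K`: **(R)** for every `λ ≥ 1` the window lies in the maximal regular open set of the restricted density at coupling `γ/λ` (the small-field
fibre density HAS a continuous version on the window — coarea form of the push-forward, fibrewise nullity of the threshold level sets, [Balaban1985Averaging]
(10)); **(P)** the canonical version is positive on the window for every `λ ≥ 1`; **(T)** at every window quadrilateral the semiclassical limit of the 4-point of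
`f^λ` exists and is κ-clustered of size `≤ φ₁ J`, `J·φ₁ J → 0`, depth-uniform.  Mechanism and risks as in v3a's 1L4, PLUS the honest analytic content of (R).
[cite: Balaban1985Variational, Thm 1 (8)-(10) p.279; Balaban1985Averaging, (10) p.19] -/
def OneLoopClusteredCan : Prop :=
  ∀ (L : ℕ), ∃ pS : ℝ, ∀ (b₀ p₀ : ℝ), 0 < b₀ → pS ≤ p₀ → 0 < p₀ → ∃ ε₁ : ℝ, 0 < ε₁ ∧ ∀ (ε₀ : ℝ), 0 < ε₀ → ε₀ ≤ ε₁ →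
    ∃ γ₁ : ℝ, 0 < γ₁ ∧ ∃ κ : ℝ, 0 < κ ∧ ∀ (F : T3Family) (γ : ℝ), F.L = L → 0 < γ → γ ≤ γ₁ →
      ∃ φ₁ : ℕ → ℝ, (∀ J, 0 ≤ φ₁ J) ∧ Tendsto (fun J : ℕ => (J : ℝ) * φ₁ J) atTop (𝓝 0) ∧
        ∀ (J K : ℕ) (hJK : J ≤ K),
          (∀ lam : ℝ, 1 ≤ lam →
            {U : GaugeField (F.P J) 0 (Matrix.specialUnitaryGroup (Fin 2) ℂ) | PlaqSmall (θBal F.L γ b₀ p₀ J) U} ⊆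
              Node00.regSet (fieldMeasure (F.P J) 0 (Matrix.specialUnitaryGroup (Fin 2) ℂ))
                (heightDensity F (γ / lam) hJK (histGood F ℰp (θBal F.L γ b₀ p₀) K J))) ∧
          (∀ lam : ℝ, 1 ≤ lam → ∀ U : GaugeField (F.P J) 0 (Matrix.specialUnitaryGroup (Fin 2) ℂ), PlaqSmall (θBal F.L γ b₀ p₀ J) U →
              0 < heightDensityCan F (γ / lam) hJK (histGood F ℰp (θBal F.L γ b₀ p₀) K J) U) ∧
          ∀ (b b' : PBond (F.P J) 0) (U V W Z : GaugeField (F.P J) 0 (Matrix.specialUnitaryGroup (Fin 2) ℂ)),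
            PlaqSmall (θBal F.L γ b₀ p₀ J) U → PlaqSmall (θBal F.L γ b₀ p₀ J) V →
            PlaqSmall (θBal F.L γ b₀ p₀ J) W → PlaqSmall (θBal F.L γ b₀ p₀ J) Z →
            (∀ e, e ≠ b → U e = V e) → (∀ e, e ≠ b' → U e = W e) → (∀ e, e ≠ b' → V e = Z e) → (∀ e, e ≠ b → W e = Z e) →
            Tendsto (fun lam : ℝ => fourPt (fluctAtCan F γ b₀ p₀ ε₀ hJK lam) U V W Z) atTop
                (𝓝 (oneLoopFourPtCan F γ b₀ p₀ ε₀ hJK U V W Z)) ∧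
              |oneLoopFourPtCan F γ b₀ p₀ ε₀ hJK U V W Z| ≤ φ₁ J * Real.exp (-(κ * (b.src.tdist b'.src : ℝ)))

/-- **H4ᶜ · BEYOND ONE LOOP, OVER THE CANONICAL VERSION** (re-typing of v3a's `BeyondOneLoopSmall`): the `λ = 1` connected 4-point of `f^λ` differs from its
semiclassical limit by a κ-clustered `≤ φ₂ J`, `J·φ₂ J → 0`, depth-uniform. [cite: Balaban1985UV3, (45)-(47) p.267; Balaban1987RG1, Thm 1 (0.19)-(0.26)] -/
def BeyondOneLoopSmallCan : Prop :=
  ∀ (L : ℕ), ∃ pS : ℝ, ∀ (b₀ p₀ : ℝ), 0 < b₀ → pS ≤ p₀ → 0 < p₀ → ∃ ε₁ : ℝ, 0 < ε₁ ∧ ∀ (ε₀ : ℝ), 0 < ε₀ → ε₀ ≤ ε₁ →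
    ∃ γ₁ : ℝ, 0 < γ₁ ∧ ∃ κ : ℝ, 0 < κ ∧ ∀ (F : T3Family) (γ : ℝ), F.L = L → 0 < γ → γ ≤ γ₁ →
      ∃ φ₂ : ℕ → ℝ, (∀ J, 0 ≤ φ₂ J) ∧ Tendsto (fun J : ℕ => (J : ℝ) * φ₂ J) atTop (𝓝 0) ∧
        ∀ (J K : ℕ) (hJK : J ≤ K) (b b' : PBond (F.P J) 0) (U V W Z : GaugeField (F.P J) 0 (Matrix.specialUnitaryGroup (Fin 2) ℂ)),
          PlaqSmall (θBal F.L γ b₀ p₀ J) U → PlaqSmall (θBal F.L γ b₀ p₀ J) V →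
          PlaqSmall (θBal F.L γ b₀ p₀ J) W → PlaqSmall (θBal F.L γ b₀ p₀ J) Z →
          (∀ e, e ≠ b → U e = V e) → (∀ e, e ≠ b' → U e = W e) → (∀ e, e ≠ b' → V e = Z e) → (∀ e, e ≠ b → W e = Z e) →
          |fourPt (fluctAtCan F γ b₀ p₀ ε₀ hJK 1) U V W Z - oneLoopFourPtCan F γ b₀ p₀ ε₀ hJK U V W Z|
            ≤ φ₂ J * Real.exp (-(κ * (b.src.tdist b'.src : ℝ)))

/-- **LFR♯ᶜ · LARGE-FIELD 4-POINT REMAINDER, OVER THE CANONICAL VERSION** (re-typing of v3a's `LargeFieldFourPt`): for every continuous positive window version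
`ρ` of the full nested law, `log ρ − log heightDensityCan^{histGood}` has κ-clustered connected 4-points `≤ ψ J`, `J·ψ J → 0`, depth-uniform, given positivity
of the canonical small-history density on the window. [cite: Balaban1988Convergent, §2 (2.18)-(2.27); Balaban1989LargeFieldI, §1] -/
def LargeFieldFourPtCan : Prop :=
  ∀ (L : ℕ), ∃ pS : ℝ, ∀ (b₀ p₀ : ℝ), 0 < b₀ → pS ≤ p₀ → 0 < p₀ →
    ∃ γ₁ : ℝ, 0 < γ₁ ∧ ∃ κ : ℝ, 0 < κ ∧ ∀ (F : T3Family) (γ : ℝ), F.L = L → 0 < γ → γ ≤ γ₁ →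
      ∃ ψ : ℕ → ℝ, (∀ J, 0 ≤ ψ J) ∧ Tendsto (fun J : ℕ => (J : ℝ) * ψ J) atTop (𝓝 0) ∧
        ∀ (ν : ℕ → (j : ℕ) → Measure (GaugeField (F.P j) 0 (Matrix.specialUnitaryGroup (Fin 2) ℂ))),
          (∀ K, ν K K = T4GenFunBounds.gibbsMeasure (F.P K) ((F.scheme ℰp γ).β K)) →
          (∀ K j, j < K → ν K j = Measure.map (descend F ℰp j) (ν K (j + 1))) →
          ∀ (J K : ℕ) (hJK : J ≤ K) (ρ : GaugeField (F.P J) 0 (Matrix.specialUnitaryGroup (Fin 2) ℂ) → ℝ),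
            (∀ U, PlaqSmall (θBal F.L γ b₀ p₀ J) U → 0 < ρ U) →
            ν K J = (fieldMeasure _ _ _).withDensity (fun U => ENNReal.ofReal (ρ U)) →
            ContinuousOn ρ {U | PlaqSmall (θBal F.L γ b₀ p₀ J) U} →
            (∀ U : GaugeField (F.P J) 0 (Matrix.specialUnitaryGroup (Fin 2) ℂ), PlaqSmall (θBal F.L γ b₀ p₀ J) U →
                0 < heightDensityCan F γ hJK (histGood F ℰp (θBal F.L γ b₀ p₀) K J) U) →
            ∀ (b b' : PBond (F.P J) 0) (U V W Z : GaugeField (F.P J) 0 (Matrix.specialUnitaryGroup (Fin 2) ℂ)),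
              PlaqSmall (θBal F.L γ b₀ p₀ J) U → PlaqSmall (θBal F.L γ b₀ p₀ J) V →
              PlaqSmall (θBal F.L γ b₀ p₀ J) W → PlaqSmall (θBal F.L γ b₀ p₀ J) Z →
              (∀ e, e ≠ b → U e = V e) → (∀ e, e ≠ b' → U e = W e) → (∀ e, e ≠ b' → V e = Z e) → (∀ e, e ≠ b → W e = Z e) →
              |fourPt (fun U => Real.log (ρ U) - Real.log (heightDensityCan F γ hJK (histGood F ℰp (θBal F.L γ b₀ p₀) K J) U)) U V W Z|
                ≤ ψ J * Real.exp (-(κ * (b.src.tdist b'.src : ℝ)))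

/-- **S2β · FLUCTUATION PART SMALL IN 4-POINT CURRENCY** — VERBATIM from the package `Lines/runpair_organ.lean` v15 / skeleton v3a (version-free: it quantifies
over continuous positive versions `ρ`). [cite: Balaban1985UV3, Thm 2 p.263 and (41) p.266] -/
def FluctuationPartSmall : Prop :=
  ∀ (L : ℕ), ∃ pS : ℝ, ∀ (b₀ p₀ : ℝ), 0 < b₀ → pS ≤ p₀ → 0 < p₀ → ∃ ε₁ : ℝ, 0 < ε₁ ∧ ∀ (ε₀ : ℝ), 0 < ε₀ → ε₀ ≤ ε₁ →
    ∃ γ₁ : ℝ, 0 < γ₁ ∧ ∃ κ : ℝ, 0 < κ ∧ ∀ (F : T3Family) (γ : ℝ), F.L = L → 0 < γ → γ ≤ γ₁ →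
      ∃ (φ : ℕ → ℝ), (∀ J, 0 ≤ φ J) ∧ Tendsto (fun J : ℕ => (J : ℝ) * φ J) atTop (𝓝 0) ∧
        ∀ (ν : ℕ → (j : ℕ) → Measure (GaugeField (F.P j) 0 (Matrix.specialUnitaryGroup (Fin 2) ℂ))),
          (∀ K, ν K K = T4GenFunBounds.gibbsMeasure (F.P K) ((F.scheme ℰp γ).β K)) →
          (∀ K j, j < K → ν K j = Measure.map (descend F ℰp j) (ν K (j + 1))) →
          ∀ (J K : ℕ) (hJK : J ≤ K) (ρ : GaugeField (F.P J) 0 (Matrix.specialUnitaryGroup (Fin 2) ℂ) → ℝ),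
            (∀ U, PlaqSmall (θBal F.L γ b₀ p₀ J) U → 0 < ρ U) →
            ν K J = (fieldMeasure _ _ _).withDensity (fun U => ENNReal.ofReal (ρ U)) →
            ContinuousOn ρ {U | PlaqSmall (θBal F.L γ b₀ p₀ J) U} →
            ∀ (b b' : PBond (F.P J) 0) (U V W Z : GaugeField (F.P J) 0 (Matrix.specialUnitaryGroup (Fin 2) ℂ)),
              PlaqSmall (θBal F.L γ b₀ p₀ J) U → PlaqSmall (θBal F.L γ b₀ p₀ J) V →
              PlaqSmall (θBal F.L γ b₀ p₀ J) W → PlaqSmall (θBal F.L γ b₀ p₀ J) Z →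
              (∀ e, e ≠ b → U e = V e) → (∀ e, e ≠ b' → U e = W e) → (∀ e, e ≠ b' → V e = Z e) → (∀ e, e ≠ b → W e = Z e) →
              |((Real.log (ρ U) + (F.scheme ℰp γ).β K * minActionRegPr F J K hJK ε₀ U)
                  - (Real.log (ρ V) + (F.scheme ℰp γ).β K * minActionRegPr F J K hJK ε₀ V))
                - ((Real.log (ρ W) + (F.scheme ℰp γ).β K * minActionRegPr F J K hJK ε₀ W)
                  - (Real.log (ρ Z) + (F.scheme ℰp γ).β K * minActionRegPr F J K hJK ε₀ Z))|
                ≤ φ J * Real.exp (-(κ * (b.src.tdist b'.src : ℝ)))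

/-- **LFRᶜ · LARGE-FIELD POLYMER REMAINDER OVER THE CANONICAL VERSION** — LINE g17-1's row LFR (`Lines/polymer_norm_s2beta.lean` v3) restated verbatim: for every
continuous positive window version `ρ` of the full nested law, `log ρ − log heightDensityCan^{histGood}` has a V-local polymer representation on the window of
weighted norm `≤ Ψ J` at a rate `κ > 0`, `J·Ψ J → 0`, depth-uniform, given positivity of the canonical small-history density on the window.
[cite: Balaban1988Convergent, §2 (2.18)-(2.27); Balaban1989LargeFieldI, §1] -/
def LargeFieldPolymerRepCan : Prop :=
  ∀ (L : ℕ), ∃ pS : ℝ, ∀ (b₀ p₀ : ℝ), 0 < b₀ → pS ≤ p₀ → 0 < p₀ →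
    ∃ γ₁ : ℝ, 0 < γ₁ ∧ ∃ κ : ℝ, 0 < κ ∧ ∀ (F : T3Family) (γ : ℝ), F.L = L → 0 < γ → γ ≤ γ₁ →
      ∃ Ψ : ℕ → ℝ, (∀ J, 0 ≤ Ψ J) ∧ Tendsto (fun J : ℕ => (J : ℝ) * Ψ J) atTop (𝓝 0) ∧
        ∀ (ν : ℕ → (j : ℕ) → Measure (GaugeField (F.P j) 0 (Matrix.specialUnitaryGroup (Fin 2) ℂ))),
          (∀ K, ν K K = T4GenFunBounds.gibbsMeasure (F.P K) ((F.scheme ℰp γ).β K)) →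
          (∀ K j, j < K → ν K j = Measure.map (descend F ℰp j) (ν K (j + 1))) →
          ∀ (J K : ℕ) (hJK : J ≤ K) (ρ : GaugeField (F.P J) 0 (Matrix.specialUnitaryGroup (Fin 2) ℂ) → ℝ),
            (∀ U, PlaqSmall (θBal F.L γ b₀ p₀ J) U → 0 < ρ U) →
            ν K J = (fieldMeasure _ _ _).withDensity (fun U => ENNReal.ofReal (ρ U)) →
            ContinuousOn ρ {U | PlaqSmall (θBal F.L γ b₀ p₀ J) U} →
            (∀ U : GaugeField (F.P J) 0 (Matrix.specialUnitaryGroup (Fin 2) ℂ), PlaqSmall (θBal F.L γ b₀ p₀ J) U →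
                0 < heightDensityCan F γ hJK (histGood F ℰp (θBal F.L γ b₀ p₀) K J) U) →
            PolymerRepOn {U | PlaqSmall (θBal F.L γ b₀ p₀ J) U} κ (Ψ J)
              (fun U => Real.log (ρ U) - Real.log (heightDensityCan F γ hJK (histGood F ℰp (θBal F.L γ b₀ p₀) K J) U))

/-- The table's sufficiency, as ONE named proposition (so that the zero-hypothesis composition `fluctuationPartSmall_of_stubs` is the UNIQUE theorem
concluding `FluctuationPartSmall` by name — the skeleton audit's candidate rule). [cite: Balaban1985UV3, (41) p.266] -/
def TableSuffices : Prop := OneLoopClusteredCan → BeyondOneLoopSmallCan → LargeFieldFourPtCan → FluctuationPartSmall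

/-- **COMPOSITION · 1L4ᶜ → H4ᶜ → LFR♯ᶜ → S2β (PROVED, verbatim from v3a with the canonical version)**: `log ρ + β_K S = f¹ + (log ρ − log g)` with
`g = heightDensityCan` and `f¹ = fluctAtCan … 1`, `|Δ²f¹| ≤ |Λ₄| + |Δ²f¹ − Λ₄|`, `κ := min`, `φ := φ₁ + φ₂ + ψ`.
[cite: Balaban1985UV3, (41) p.266; Balaban1985Variational, Thm 1 (8) p.279] -/
theorem fluctuationPartSmall_of_semiclassicalCan : TableSuffices := by
  intro h1 h2 h3 L
  obtain ⟨pS₁, H1⟩ := h1 L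
  obtain ⟨pS₂, H2⟩ := h2 L
  obtain ⟨pS₃, H3⟩ := h3 L
  refine ⟨max pS₁ (max pS₂ pS₃), fun b₀ p₀ hb hpS hp => ?_⟩
  have hp1 : pS₁ ≤ p₀ := (le_max_left _ _).trans hpS
  have hp2 : pS₂ ≤ p₀ := ((le_max_left _ _).trans (le_max_right _ _)).trans hpS
  have hp3 : pS₃ ≤ p₀ := ((le_max_right _ _).trans (le_max_right _ _)).trans hpS
  obtain ⟨ε₁, hε₁, H1⟩ := H1 b₀ p₀ hb hp1 hp
  obtain ⟨ε₂, hε₂, H2⟩ := H2 b₀ p₀ hb hp2 hp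
  obtain ⟨γ₃, hγ₃, κ₃, hκ₃, H3⟩ := H3 b₀ p₀ hb hp3 hp
  refine ⟨min ε₁ ε₂, lt_min hε₁ hε₂, fun ε₀ hε₀ hε₀1 => ?_⟩
  obtain ⟨γ₁, hγ₁, κ₁, hκ₁, H1⟩ := H1 ε₀ hε₀ (hε₀1.trans (min_le_left _ _))
  obtain ⟨γ₂, hγ₂, κ₂, hκ₂, H2⟩ := H2 ε₀ hε₀ (hε₀1.trans (min_le_right _ _))
  refine ⟨min γ₁ (min γ₂ γ₃), lt_min hγ₁ (lt_min hγ₂ hγ₃), min κ₁ (min κ₂ κ₃), lt_min hκ₁ (lt_min hκ₂ hκ₃),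
    fun F γ hFL hγ hγle => ?_⟩
  obtain ⟨φ₁, hφ₁0, hφ₁t, H1⟩ := H1 F γ hFL hγ (hγle.trans (min_le_left _ _))
  obtain ⟨φ₂, hφ₂0, hφ₂t, H2⟩ := H2 F γ hFL hγ (hγle.trans ((min_le_right _ _).trans (min_le_left _ _)))
  obtain ⟨ψ, hψ0, hψt, H3⟩ := H3 F γ hFL hγ (hγle.trans ((min_le_right _ _).trans (min_le_right _ _)))
  refine ⟨fun J => φ₁ J + φ₂ J + ψ J, fun J => ?_, ?_, ?_⟩
  · have := hφ₁0 J; have := hφ₂0 J; have := hψ0 J; positivity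
  · have h := (hφ₁t.add hφ₂t).add hψt
    rw [add_zero, add_zero] at h
    refine h.congr' (Eventually.of_forall fun J => ?_)
    show (J : ℝ) * φ₁ J + (J : ℝ) * φ₂ J + (J : ℝ) * ψ J = (J : ℝ) * (φ₁ J + φ₂ J + ψ J)
    ring
  · intro ν hνK hνd J K hJK ρ hρpos hνρ hρcont b b' U V W Z hU hV hW hZ hUV hUW hVZ hWZ
    obtain ⟨-, hgposAll, H1q⟩ := H1 J K hJK
    have hgpos : ∀ U : GaugeField (F.P J) 0 (Matrix.specialUnitaryGroup (Fin 2) ℂ), PlaqSmall (θBal F.L γ b₀ p₀ J) U →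
        0 < heightDensityCan F γ hJK (histGood F ℰp (θBal F.L γ b₀ p₀) K J) U := by
      intro U hU
      have := hgposAll 1 le_rfl U hU
      simpa only [div_one] using this
    obtain ⟨-, hΛ⟩ := H1q b b' U V W Z hU hV hW hZ hUV hUW hVZ hWZ
    have hq := H2 J K hJK b b' U V W Z hU hV hW hZ hUV hUW hVZ hWZ
    have hl := H3 ν hνK hνd J K hJK ρ hρpos hνρ hρcont hgpos b b' U V W Z hU hV hW hZ hUV hUW hVZ hWZ
    set g : GaugeField (F.P J) 0 (Matrix.specialUnitaryGroup (Fin 2) ℂ) → ℝ :=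
      fun U => heightDensityCan F γ hJK (histGood F ℰp (θBal F.L γ b₀ p₀) K J) U with hg
    set B : GaugeField (F.P J) 0 (Matrix.specialUnitaryGroup (Fin 2) ℂ) → ℝ :=
      fun U => (F.scheme ℰp γ).β K * minActionRegPr F J K hJK ε₀ U with hB
    set Λ : ℝ := oneLoopFourPtCan F γ b₀ p₀ ε₀ hJK U V W Z with hΛdef
    set d : ℝ := (b.src.tdist b'.src : ℝ) with hd
    have hd0 : 0 ≤ d := by rw [hd]; exact Nat.cast_nonneg _
    have hf1 : fourPt (fluctAtCan F γ b₀ p₀ ε₀ hJK 1) U V W Z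
        = ((Real.log (g U) + B U) - (Real.log (g V) + B V)) - ((Real.log (g W) + B W) - (Real.log (g Z) + B Z)) := by
      simp only [fourPt, fluctAtCan_one, hg, hB]
    have hsplit : ((Real.log (ρ U) + B U) - (Real.log (ρ V) + B V)) - ((Real.log (ρ W) + B W) - (Real.log (ρ Z) + B Z))
        = fourPt (fluctAtCan F γ b₀ p₀ ε₀ hJK 1) U V W Z
          + fourPt (fun U => Real.log (ρ U) - Real.log (g U)) U V W Z := by
      rw [hf1]; simp only [fourPt]; ring
    have e1 : Real.exp (-(κ₁ * d)) ≤ Real.exp (-(min κ₁ (min κ₂ κ₃) * d)) :=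
      Real.exp_le_exp.mpr (by nlinarith [min_le_left κ₁ (min κ₂ κ₃)])
    have e2 : Real.exp (-(κ₂ * d)) ≤ Real.exp (-(min κ₁ (min κ₂ κ₃) * d)) :=
      Real.exp_le_exp.mpr (by nlinarith [min_le_right κ₁ (min κ₂ κ₃), min_le_left κ₂ κ₃])
    have e3 : Real.exp (-(κ₃ * d)) ≤ Real.exp (-(min κ₁ (min κ₂ κ₃) * d)) :=
      Real.exp_le_exp.mpr (by nlinarith [min_le_right κ₁ (min κ₂ κ₃), min_le_right κ₂ κ₃])
    have hφ₁J := hφ₁0 J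
    have hφ₂J := hφ₂0 J
    have hψJ := hψ0 J
    have htri : |fourPt (fluctAtCan F γ b₀ p₀ ε₀ hJK 1) U V W Z| ≤ |Λ| + |fourPt (fluctAtCan F γ b₀ p₀ ε₀ hJK 1) U V W Z - Λ| := by
      have := abs_add_le Λ (fourPt (fluctAtCan F γ b₀ p₀ ε₀ hJK 1) U V W Z - Λ)
      simpa only [add_sub_cancel] using this
    show |((Real.log (ρ U) + B U) - (Real.log (ρ V) + B V)) - ((Real.log (ρ W) + B W) - (Real.log (ρ Z) + B Z))|
        ≤ (φ₁ J + φ₂ J + ψ J) * Real.exp (-(min κ₁ (min κ₂ κ₃) * d))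
    rw [hsplit]
    refine (abs_add_le _ _).trans ?_
    calc |fourPt (fluctAtCan F γ b₀ p₀ ε₀ hJK 1) U V W Z| + |fourPt (fun U => Real.log (ρ U) - Real.log (g U)) U V W Z|
        ≤ (|Λ| + |fourPt (fluctAtCan F γ b₀ p₀ ε₀ hJK 1) U V W Z - Λ|) + ψ J * Real.exp (-(κ₃ * d)) := add_le_add htri hl
      _ ≤ (φ₁ J * Real.exp (-(κ₁ * d)) + φ₂ J * Real.exp (-(κ₂ * d))) + ψ J * Real.exp (-(κ₃ * d)) :=
          add_le_add (add_le_add hΛ hq) le_rfl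
      _ ≤ (φ₁ J * Real.exp (-(min κ₁ (min κ₂ κ₃) * d)) + φ₂ J * Real.exp (-(min κ₁ (min κ₂ κ₃) * d)))
            + ψ J * Real.exp (-(min κ₁ (min κ₂ κ₃) * d)) := by
          gcongr
      _ = (φ₁ J + φ₂ J + ψ J) * Real.exp (-(min κ₁ (min κ₂ κ₃) * d)) := by ring


/-! ### §2∘ (v11.4, ★★OWNER WORD 87 (2)): THE INTERIOR-WINDOW TABLE — rows 1L4ᶜ∘ ∕ H4ᶜ∘ ∕ LFR♯ᶜ∘ and the PROVED composition `fluctuationPartSmall_of_interiorTable`,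
BYTE-IDENTICAL with ideator g21's published organ-level line `Lines/interior_table.lean` v1 (sha16 3a1213f3da2ab6cf, evidence #45): every WINDOW clause read at
`θBal F.L γ (c * b₀) p₀ J` under the shared prefix `∀ L, ∃ c₀, 0 < c₀ ∧ c₀ ≤ 1 ∧ ∀ c, 0 < c → c ≤ c₀ → …` (R3-FLIN, WORD 81 (3)); the HISTORY profile `b₀` unchanged;
S2β recovered by the `b₀ ∕ c` instantiation.  The full-window rows 1L4ᶜ ∕ H4ᶜ ∕ LFR♯ᶜ above stay as definitions of record of v11.2a (no stub, no credit). -/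

/-- **1L4ᶜ∘ · ONE-LOOP 4-POINTS EXIST AND ARE CLUSTERED — INTERIOR WINDOW.** Registry v11.2a's `OneLoopClusteredCan` with `∃ c₀ : ℝ, 0 < c₀ ∧ c₀ ≤ 1 ∧ ∀ (c : ℝ),
0 < c → c ≤ c₀ →` inserted after `∀ (L : ℕ),` and every WINDOW clause `PlaqSmall (θBal F.L γ b₀ p₀ J) ·` (the regular-set inclusion (R), the positivity
(P), the four quadrilateral data of (T)) read at `θBal F.L γ (c * b₀) p₀ J`; the HISTORY `histGood F ℰp (θBal F.L γ b₀ p₀) K J` inside `heightDensity(Can)`,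
`fluctAtCan`, `oneLoopFourPtCan` UNCHANGED.  Why it might fail: as 1L4ᶜ (the semiclassical limit (T) needs the fibre minimiser inside the history — now
granted by the choice of `c(L)`, R3-FLIN: `c(3) < 0.61` in the toy); (R) is honest analytic content. [cite: Balaban1985Variational, Thm 1 (8)-(10) p.279;
Balaban1985Averaging, (10) p.19; King1986, Prop. 3.8-3.9] -/
def OneLoopClusteredIntCan : Prop :=
  ∀ (L : ℕ), ∃ c₀ : ℝ, 0 < c₀ ∧ c₀ ≤ 1 ∧ ∀ (c : ℝ), 0 < c → c ≤ c₀ → ∃ pS : ℝ, ∀ (b₀ p₀ : ℝ), 0 < b₀ → pS ≤ p₀ → 0 < p₀ → ∃ ε₁ : ℝ, 0 < ε₁ ∧ ∀ (ε₀ : ℝ), 0 < ε₀ → ε₀ ≤ ε₁ →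
    ∃ γ₁ : ℝ, 0 < γ₁ ∧ ∃ κ : ℝ, 0 < κ ∧ ∀ (F : T3Family) (γ : ℝ), F.L = L → 0 < γ → γ ≤ γ₁ →
      ∃ φ₁ : ℕ → ℝ, (∀ J, 0 ≤ φ₁ J) ∧ Tendsto (fun J : ℕ => (J : ℝ) * φ₁ J) atTop (𝓝 0) ∧
        ∀ (J K : ℕ) (hJK : J ≤ K),
          (∀ lam : ℝ, 1 ≤ lam →
            {U : GaugeField (F.P J) 0 (Matrix.specialUnitaryGroup (Fin 2) ℂ) | PlaqSmall (θBal F.L γ (c * b₀) p₀ J) U} ⊆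
              Node00.regSet (fieldMeasure (F.P J) 0 (Matrix.specialUnitaryGroup (Fin 2) ℂ))
                (heightDensity F (γ / lam) hJK (histGood F ℰp (θBal F.L γ b₀ p₀) K J))) ∧
          (∀ lam : ℝ, 1 ≤ lam → ∀ U : GaugeField (F.P J) 0 (Matrix.specialUnitaryGroup (Fin 2) ℂ), PlaqSmall (θBal F.L γ (c * b₀) p₀ J) U →
              0 < heightDensityCan F (γ / lam) hJK (histGood F ℰp (θBal F.L γ b₀ p₀) K J) U) ∧
          ∀ (b b' : PBond (F.P J) 0) (U V W Z : GaugeField (F.P J) 0 (Matrix.specialUnitaryGroup (Fin 2) ℂ)),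
            PlaqSmall (θBal F.L γ (c * b₀) p₀ J) U → PlaqSmall (θBal F.L γ (c * b₀) p₀ J) V →
            PlaqSmall (θBal F.L γ (c * b₀) p₀ J) W → PlaqSmall (θBal F.L γ (c * b₀) p₀ J) Z →
            (∀ e, e ≠ b → U e = V e) → (∀ e, e ≠ b' → U e = W e) → (∀ e, e ≠ b' → V e = Z e) → (∀ e, e ≠ b → W e = Z e) →
            Tendsto (fun lam : ℝ => fourPt (fluctAtCan F γ b₀ p₀ ε₀ hJK lam) U V W Z) atTop
                (𝓝 (oneLoopFourPtCan F γ b₀ p₀ ε₀ hJK U V W Z)) ∧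
              |oneLoopFourPtCan F γ b₀ p₀ ε₀ hJK U V W Z| ≤ φ₁ J * Real.exp (-(κ * (b.src.tdist b'.src : ℝ)))

/-- **H4ᶜ∘ · BEYOND ONE LOOP — INTERIOR WINDOW.** Registry v11.2a's `BeyondOneLoopSmallCan` with the same two textual moves (shared-shape fraction after
`∀ L`; the four quadrilateral window clauses at `c * b₀`; `fluctAtCan`∕`oneLoopFourPtCan` keep the history profile `b₀`).  Why it might fail: on interior data
the `λ = 1` vs `λ = ∞` difference is a genuine two-loop remainder `O(g_K²)` per localisation — Bałaban's (45)–(47); at small `L` only for `c ≤ c(L)`.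
[cite: Balaban1985UV3, (45)-(47) p.267; Balaban1987RG1, Thm 1 (0.19)-(0.26)] -/
def BeyondOneLoopSmallIntCan : Prop :=
  ∀ (L : ℕ), ∃ c₀ : ℝ, 0 < c₀ ∧ c₀ ≤ 1 ∧ ∀ (c : ℝ), 0 < c → c ≤ c₀ → ∃ pS : ℝ, ∀ (b₀ p₀ : ℝ), 0 < b₀ → pS ≤ p₀ → 0 < p₀ → ∃ ε₁ : ℝ, 0 < ε₁ ∧ ∀ (ε₀ : ℝ), 0 < ε₀ → ε₀ ≤ ε₁ →
    ∃ γ₁ : ℝ, 0 < γ₁ ∧ ∃ κ : ℝ, 0 < κ ∧ ∀ (F : T3Family) (γ : ℝ), F.L = L → 0 < γ → γ ≤ γ₁ →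
      ∃ φ₂ : ℕ → ℝ, (∀ J, 0 ≤ φ₂ J) ∧ Tendsto (fun J : ℕ => (J : ℝ) * φ₂ J) atTop (𝓝 0) ∧
        ∀ (J K : ℕ) (hJK : J ≤ K) (b b' : PBond (F.P J) 0) (U V W Z : GaugeField (F.P J) 0 (Matrix.specialUnitaryGroup (Fin 2) ℂ)),
          PlaqSmall (θBal F.L γ (c * b₀) p₀ J) U → PlaqSmall (θBal F.L γ (c * b₀) p₀ J) V →
          PlaqSmall (θBal F.L γ (c * b₀) p₀ J) W → PlaqSmall (θBal F.L γ (c * b₀) p₀ J) Z →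
          (∀ e, e ≠ b → U e = V e) → (∀ e, e ≠ b' → U e = W e) → (∀ e, e ≠ b' → V e = Z e) → (∀ e, e ≠ b → W e = Z e) →
          |fourPt (fluctAtCan F γ b₀ p₀ ε₀ hJK 1) U V W Z - oneLoopFourPtCan F γ b₀ p₀ ε₀ hJK U V W Z|
            ≤ φ₂ J * Real.exp (-(κ * (b.src.tdist b'.src : ℝ)))

/-- **LFR♯ᶜ∘ · LARGE-FIELD 4-POINT REMAINDER — INTERIOR WINDOW.** Registry v11.2a's `LargeFieldFourPtCan` with the same two textual moves: the version `ρ`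
is positive and continuous on the INTERIOR window `{PlaqSmall (θBal F.L γ (c * b₀) p₀ J)}`, the canonical `hist(b₀)` density is positive there, and the
connected 4-points of `log ρ − log heightDensityCan^{histGood(b₀)}` at INTERIOR quadrilaterals are `≤ ψ J e^{−κ d}`.  Why it might fail: the large-field
polymer expansion's smallness per history cell is print ([Balaban1988Convergent] §2) but its 4-point clustering across `∂BL_J` is exactly what the full-window
row got wrong at `L = 3`; on the `c`-interior the boundary layer is excised by the choice of `c(L)`. [cite: Balaban1988Convergent, §2 (2.18)-(2.27);
Balaban1989LargeFieldI, §1; King1986, Prop. 3.8-3.9] -/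
def LargeFieldFourPtIntCan : Prop :=
  ∀ (L : ℕ), ∃ c₀ : ℝ, 0 < c₀ ∧ c₀ ≤ 1 ∧ ∀ (c : ℝ), 0 < c → c ≤ c₀ → ∃ pS : ℝ, ∀ (b₀ p₀ : ℝ), 0 < b₀ → pS ≤ p₀ → 0 < p₀ →
    ∃ γ₁ : ℝ, 0 < γ₁ ∧ ∃ κ : ℝ, 0 < κ ∧ ∀ (F : T3Family) (γ : ℝ), F.L = L → 0 < γ → γ ≤ γ₁ →
      ∃ ψ : ℕ → ℝ, (∀ J, 0 ≤ ψ J) ∧ Tendsto (fun J : ℕ => (J : ℝ) * ψ J) atTop (𝓝 0) ∧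
        ∀ (ν : ℕ → (j : ℕ) → Measure (GaugeField (F.P j) 0 (Matrix.specialUnitaryGroup (Fin 2) ℂ))),
          (∀ K, ν K K = T4GenFunBounds.gibbsMeasure (F.P K) ((F.scheme ℰp γ).β K)) →
          (∀ K j, j < K → ν K j = Measure.map (descend F ℰp j) (ν K (j + 1))) →
          ∀ (J K : ℕ) (hJK : J ≤ K) (ρ : GaugeField (F.P J) 0 (Matrix.specialUnitaryGroup (Fin 2) ℂ) → ℝ),
            (∀ U, PlaqSmall (θBal F.L γ (c * b₀) p₀ J) U → 0 < ρ U) →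
            ν K J = (fieldMeasure _ _ _).withDensity (fun U => ENNReal.ofReal (ρ U)) →
            ContinuousOn ρ {U | PlaqSmall (θBal F.L γ (c * b₀) p₀ J) U} →
            (∀ U : GaugeField (F.P J) 0 (Matrix.specialUnitaryGroup (Fin 2) ℂ), PlaqSmall (θBal F.L γ (c * b₀) p₀ J) U →
                0 < heightDensityCan F γ hJK (histGood F ℰp (θBal F.L γ b₀ p₀) K J) U) →
            ∀ (b b' : PBond (F.P J) 0) (U V W Z : GaugeField (F.P J) 0 (Matrix.specialUnitaryGroup (Fin 2) ℂ)),
              PlaqSmall (θBal F.L γ (c * b₀) p₀ J) U → PlaqSmall (θBal F.L γ (c * b₀) p₀ J) V →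
              PlaqSmall (θBal F.L γ (c * b₀) p₀ J) W → PlaqSmall (θBal F.L γ (c * b₀) p₀ J) Z →
              (∀ e, e ≠ b → U e = V e) → (∀ e, e ≠ b' → U e = W e) → (∀ e, e ≠ b' → V e = Z e) → (∀ e, e ≠ b → W e = Z e) →
              |fourPt (fun U => Real.log (ρ U) - Real.log (heightDensityCan F γ hJK (histGood F ℰp (θBal F.L γ b₀ p₀) K J) U)) U V W Z|
                ≤ ψ J * Real.exp (-(κ * (b.src.tdist b'.src : ℝ)))

/-- The interior table's sufficiency as ONE named proposition (its zero-hypothesis instance `fluctuationPartSmall_of_stubs` is the UNIQUE theorem of this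
file concluding `FluctuationPartSmall` by name). [cite: Balaban1985UV3, (41) p.266] -/
def TableIntSuffices : Prop := OneLoopClusteredIntCan → BeyondOneLoopSmallIntCan → LargeFieldFourPtIntCan → FluctuationPartSmall

/-! ## §3 PROVED: 1L4ᶜ∘ → H4ᶜ∘ → LFR♯ᶜ∘ → S2β — the common fraction `c := min c₀ᵢ` and the `b₀ ∕ c` instantiation, then v11.2a's composition verbatim -/

/-- **COMPOSITION · 1L4ᶜ∘ → H4ᶜ∘ → LFR♯ᶜ∘ → S2β (PROVED)**: common `c`, rows read at history profile `b₀ ∕ c` (interior window `c · (b₀ ∕ c) = b₀` = S2β's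
window), then `log ρ + β_K S = f¹ + (log ρ − log g)` with `g = heightDensityCan^{histGood(b₀∕c)}`, `|Δ²f¹| ≤ |Λ₄| + |Δ²f¹ − Λ₄|`, `κ := min`, `φ := φ₁ + φ₂ + ψ`.
[cite: Balaban1985UV3, (41) p.266; Balaban1985Variational, Thm 1 (8) p.279] -/
theorem fluctuationPartSmall_of_interiorTable : TableIntSuffices := by
  intro h1 h2 h3 L
  obtain ⟨c₁, hc₁, hc₁1, H1⟩ := h1 L
  obtain ⟨c₂, hc₂, -, H2⟩ := h2 L
  obtain ⟨c₃, hc₃, -, H3⟩ := h3 L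
  -- ONE COMMON WINDOW FRACTION `c := min c₁ c₂ c₃` for the three rows (the rows hold for every `c ≤ c₀`, so the minimum serves all three).
  obtain ⟨c, hc, hcle₁, hcle₂, hcle₃⟩ : ∃ c : ℝ, 0 < c ∧ c ≤ c₁ ∧ c ≤ c₂ ∧ c ≤ c₃ :=
    ⟨min c₁ (min c₂ c₃), lt_min hc₁ (lt_min hc₂ hc₃), min_le_left _ _, (min_le_right _ _).trans (min_le_left _ _),
      (min_le_right _ _).trans (min_le_right _ _)⟩
  obtain ⟨pS₁, H1⟩ := H1 c hc hcle₁
  obtain ⟨pS₂, H2⟩ := H2 c hc hcle₂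
  obtain ⟨pS₃, H3⟩ := H3 c hc hcle₃
  refine ⟨max pS₁ (max pS₂ pS₃), fun b₀ p₀ hb hpS hp => ?_⟩
  -- THE `b₀ ∕ c` INSTANTIATION: the rows are read at history profile `b₀ ∕ c`, whose interior window `c · (b₀ ∕ c) = b₀` IS S2β's window.
  have hb' : 0 < b₀ / c := div_pos hb hc
  have e : c * (b₀ / c) = b₀ := mul_div_cancel₀ b₀ hc.ne'
  have hp1 : pS₁ ≤ p₀ := (le_max_left _ _).trans hpS
  have hp2 : pS₂ ≤ p₀ := ((le_max_left _ _).trans (le_max_right _ _)).trans hpS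
  have hp3 : pS₃ ≤ p₀ := ((le_max_right _ _).trans (le_max_right _ _)).trans hpS
  obtain ⟨ε₁, hε₁, H1⟩ := H1 (b₀ / c) p₀ hb' hp1 hp
  obtain ⟨ε₂, hε₂, H2⟩ := H2 (b₀ / c) p₀ hb' hp2 hp
  obtain ⟨γ₃, hγ₃, κ₃, hκ₃, H3⟩ := H3 (b₀ / c) p₀ hb' hp3 hp
  refine ⟨min ε₁ ε₂, lt_min hε₁ hε₂, fun ε₀ hε₀ hε₀1 => ?_⟩
  obtain ⟨γ₁, hγ₁, κ₁, hκ₁, H1⟩ := H1 ε₀ hε₀ (hε₀1.trans (min_le_left _ _))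
  obtain ⟨γ₂, hγ₂, κ₂, hκ₂, H2⟩ := H2 ε₀ hε₀ (hε₀1.trans (min_le_right _ _))
  refine ⟨min γ₁ (min γ₂ γ₃), lt_min hγ₁ (lt_min hγ₂ hγ₃), min κ₁ (min κ₂ κ₃), lt_min hκ₁ (lt_min hκ₂ hκ₃),
    fun F γ hFL hγ hγle => ?_⟩
  obtain ⟨φ₁, hφ₁0, hφ₁t, H1⟩ := H1 F γ hFL hγ (hγle.trans (min_le_left _ _))
  obtain ⟨φ₂, hφ₂0, hφ₂t, H2⟩ := H2 F γ hFL hγ (hγle.trans ((min_le_right _ _).trans (min_le_left _ _)))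
  obtain ⟨ψ, hψ0, hψt, H3⟩ := H3 F γ hFL hγ (hγle.trans ((min_le_right _ _).trans (min_le_right _ _)))
  -- rewrite the rows' interior window `θBal F.L γ (c * (b₀ / c)) p₀ J` to S2β's window `θBal F.L γ b₀ p₀ J`
  simp only [e] at H1 H2 H3
  refine ⟨fun J => φ₁ J + φ₂ J + ψ J, fun J => ?_, ?_, ?_⟩
  · have := hφ₁0 J; have := hφ₂0 J; have := hψ0 J; positivity
  · have h := (hφ₁t.add hφ₂t).add hψt
    rw [add_zero, add_zero] at h
    refine h.congr' (Eventually.of_forall fun J => ?_)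
    show (J : ℝ) * φ₁ J + (J : ℝ) * φ₂ J + (J : ℝ) * ψ J = (J : ℝ) * (φ₁ J + φ₂ J + ψ J)
    ring
  · intro ν hνK hνd J K hJK ρ hρpos hνρ hρcont b b' U V W Z hU hV hW hZ hUV hUW hVZ hWZ
    obtain ⟨-, hgposAll, H1q⟩ := H1 J K hJK
    have hgpos : ∀ U : GaugeField (F.P J) 0 (Matrix.specialUnitaryGroup (Fin 2) ℂ), PlaqSmall (θBal F.L γ b₀ p₀ J) U →
        0 < heightDensityCan F γ hJK (histGood F ℰp (θBal F.L γ (b₀ / c) p₀) K J) U := by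
      intro U hU
      have := hgposAll 1 le_rfl U hU
      simpa only [div_one] using this
    obtain ⟨-, hΛ⟩ := H1q b b' U V W Z hU hV hW hZ hUV hUW hVZ hWZ
    have hq := H2 J K hJK b b' U V W Z hU hV hW hZ hUV hUW hVZ hWZ
    have hl := H3 ν hνK hνd J K hJK ρ hρpos hνρ hρcont hgpos b b' U V W Z hU hV hW hZ hUV hUW hVZ hWZ
    set g : GaugeField (F.P J) 0 (Matrix.specialUnitaryGroup (Fin 2) ℂ) → ℝ :=
      fun U => heightDensityCan F γ hJK (histGood F ℰp (θBal F.L γ (b₀ / c) p₀) K J) U with hg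
    set B : GaugeField (F.P J) 0 (Matrix.specialUnitaryGroup (Fin 2) ℂ) → ℝ :=
      fun U => (F.scheme ℰp γ).β K * minActionRegPr F J K hJK ε₀ U with hB
    set Λ : ℝ := oneLoopFourPtCan F γ (b₀ / c) p₀ ε₀ hJK U V W Z with hΛdef
    set d : ℝ := (b.src.tdist b'.src : ℝ) with hd
    have hd0 : 0 ≤ d := by rw [hd]; exact Nat.cast_nonneg _
    have hf1 : fourPt (fluctAtCan F γ (b₀ / c) p₀ ε₀ hJK 1) U V W Z
        = ((Real.log (g U) + B U) - (Real.log (g V) + B V)) - ((Real.log (g W) + B W) - (Real.log (g Z) + B Z)) := by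
      simp only [fourPt, fluctAtCan_one, hg, hB]
    have hsplit : ((Real.log (ρ U) + B U) - (Real.log (ρ V) + B V)) - ((Real.log (ρ W) + B W) - (Real.log (ρ Z) + B Z))
        = fourPt (fluctAtCan F γ (b₀ / c) p₀ ε₀ hJK 1) U V W Z
          + fourPt (fun U => Real.log (ρ U) - Real.log (g U)) U V W Z := by
      rw [hf1]; simp only [fourPt]; ring
    have e1 : Real.exp (-(κ₁ * d)) ≤ Real.exp (-(min κ₁ (min κ₂ κ₃) * d)) :=
      Real.exp_le_exp.mpr (neg_le_neg (mul_le_mul_of_nonneg_right (min_le_left κ₁ (min κ₂ κ₃)) hd0))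
    have e2 : Real.exp (-(κ₂ * d)) ≤ Real.exp (-(min κ₁ (min κ₂ κ₃) * d)) :=
      Real.exp_le_exp.mpr (neg_le_neg (mul_le_mul_of_nonneg_right ((min_le_right κ₁ (min κ₂ κ₃)).trans (min_le_left κ₂ κ₃)) hd0))
    have e3 : Real.exp (-(κ₃ * d)) ≤ Real.exp (-(min κ₁ (min κ₂ κ₃) * d)) :=
      Real.exp_le_exp.mpr (neg_le_neg (mul_le_mul_of_nonneg_right ((min_le_right κ₁ (min κ₂ κ₃)).trans (min_le_right κ₂ κ₃)) hd0))
    have hφ₁J := hφ₁0 J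
    have hφ₂J := hφ₂0 J
    have hψJ := hψ0 J
    have htri : |fourPt (fluctAtCan F γ (b₀ / c) p₀ ε₀ hJK 1) U V W Z| ≤ |Λ| + |fourPt (fluctAtCan F γ (b₀ / c) p₀ ε₀ hJK 1) U V W Z - Λ| := by
      have := abs_add_le Λ (fourPt (fluctAtCan F γ (b₀ / c) p₀ ε₀ hJK 1) U V W Z - Λ)
      simpa only [add_sub_cancel] using this
    show |((Real.log (ρ U) + B U) - (Real.log (ρ V) + B V)) - ((Real.log (ρ W) + B W) - (Real.log (ρ Z) + B Z))|
        ≤ (φ₁ J + φ₂ J + ψ J) * Real.exp (-(min κ₁ (min κ₂ κ₃) * d))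
    rw [hsplit]
    refine (abs_add_le _ _).trans ?_
    calc |fourPt (fluctAtCan F γ (b₀ / c) p₀ ε₀ hJK 1) U V W Z| + |fourPt (fun U => Real.log (ρ U) - Real.log (g U)) U V W Z|
        ≤ (|Λ| + |fourPt (fluctAtCan F γ (b₀ / c) p₀ ε₀ hJK 1) U V W Z - Λ|) + ψ J * Real.exp (-(κ₃ * d)) := add_le_add htri hl
      _ ≤ (φ₁ J * Real.exp (-(κ₁ * d)) + φ₂ J * Real.exp (-(κ₂ * d))) + ψ J * Real.exp (-(κ₃ * d)) :=
          add_le_add (add_le_add hΛ hq) le_rfl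
      _ ≤ (φ₁ J * Real.exp (-(min κ₁ (min κ₂ κ₃) * d)) + φ₂ J * Real.exp (-(min κ₁ (min κ₂ κ₃) * d)))
            + ψ J * Real.exp (-(min κ₁ (min κ₂ κ₃) * d)) := by
          gcongr
      _ = (φ₁ J + φ₂ J + ψ J) * Real.exp (-(min κ₁ (min κ₂ κ₃) * d)) := by ring

end Rows

/-! ## §3 The organs: EXW / GAP verbatim from v3a, and the NEW organ WREG (window regularity of the small-field fibre density) -/

section Organs

/-- **EXW∘ · EXACTNESS ON THE INTERIOR WINDOW** (v11.4, ★★OWNER WORD 87 (2): the ONE window clause of EXW — the datum guard — read at `θBal F.L γ (cw * b₀) p₀ J` under the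
shared prefix `∀ L, ∃ c₀, 0 < c₀ ∧ c₀ ≤ 1 ∧ ∀ cw, 0 < cw → cw ≤ c₀ → …`; the three HISTORY clauses `histGood (θBal … b₀ …)` and `regFibrePr … ε₀` unchanged — R3-FLIN: on the
full window the minimiser over an edge datum leaves `histGood_{J+1}` at `L = 3, 5`; on the `cw`-interior it does not) — otherwise VERBATIM from v3a (organ G-K1aR-2; version-free: it speaks of `fibre`, `histGood`, `regFibrePr`, `minActionRegPr` only).
[cite: Balaban1985Variational, Thm 1 (8) p.279 and Prop 7 p.299] -/
def WindowExactness : Prop :=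
  ∀ (L : ℕ), ∃ c₀ : ℝ, 0 < c₀ ∧ c₀ ≤ 1 ∧ ∀ (cw : ℝ), 0 < cw → cw ≤ c₀ → ∃ pS : ℝ, ∀ (b₀ p₀ : ℝ), 0 < b₀ → pS ≤ p₀ → 0 < p₀ → ∃ ε₁ : ℝ, 0 < ε₁ ∧ ∀ (ε₀ : ℝ), 0 < ε₀ → ε₀ ≤ ε₁ →
    ∃ γ₁ : ℝ, 0 < γ₁ ∧ ∀ (F : T3Family) (γ : ℝ), F.L = L → 0 < γ → γ ≤ γ₁ →
      ∀ (J K : ℕ) (hJK : J ≤ K) (V : GaugeField (F.P J) 0 (Matrix.specialUnitaryGroup (Fin 2) ℂ)), PlaqSmall (θBal F.L γ (cw * b₀) p₀ J) V →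
        (∀ U ∈ fibre F ℰp J K hJK V, U ∈ histGood F ℰp (θBal F.L γ b₀ p₀) K J →
            minActionRegPr F J K hJK ε₀ V ≤ wilsonAction4 U) ∧
        (∃ U₀ ∈ regFibrePr F J K hJK ε₀ V, U₀ ∈ histGood F ℰp (θBal F.L γ b₀ p₀) K J ∧
            wilsonAction4 U₀ = minActionRegPr F J K hJK ε₀ V)

/-- The set of action-minimising small-field histories over a datum — VERBATIM from v3a. [cite: Balaban1985Variational, Thm 1 (8) p.279] -/
def argminHist (F : T3Family) (γ b₀ p₀ ε₀ : ℝ) {J K : ℕ} (hJK : J ≤ K) (V : GaugeField (F.P J) 0 (Matrix.specialUnitaryGroup (Fin 2) ℂ)) :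
    Set (GaugeField (F.P K) 0 (Matrix.specialUnitaryGroup (Fin 2) ℂ)) :=
  {U' | U' ∈ fibre F ℰp J K hJK V ∧ U' ∈ histGood F ℰp (θBal F.L γ b₀ p₀) K J ∧ wilsonAction4 U' = minActionRegPr F J K hJK ε₀ V}

/-- **GAP · UNIFORM FIBRE STIFFNESS** — VERBATIM from v3a (version-free). [cite: Balaban1985Variational, (142) p.299; Balaban1984PropagatorsII, (1.33)] -/
def UniformFibreGap : Prop :=
  ∀ (L : ℕ), ∃ pS : ℝ, ∀ (b₀ p₀ : ℝ), 0 < b₀ → pS ≤ p₀ → 0 < p₀ → ∃ ε₁ : ℝ, 0 < ε₁ ∧ ∀ (ε₀ : ℝ), 0 < ε₀ → ε₀ ≤ ε₁ →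
    ∃ γ₁ : ℝ, 0 < γ₁ ∧ ∃ μ : ℝ, 0 < μ ∧ ∀ (F : T3Family) (γ : ℝ), F.L = L → 0 < γ → γ ≤ γ₁ →
      ∀ (J K : ℕ) (hJK : J ≤ K) (V : GaugeField (F.P J) 0 (Matrix.specialUnitaryGroup (Fin 2) ℂ)), PlaqSmall (θBal F.L γ b₀ p₀ J) V →
        ∀ U ∈ fibre F ℰp J K hJK V, U ∈ histGood F ℰp (θBal F.L γ b₀ p₀) K J →
          μ * ((F.L : ℝ)⁻¹) ^ (2 * (K - J)) *
              (⨅ U' : argminHist F γ b₀ p₀ ε₀ hJK V, ∑ ℓ : PBond (F.P K) 0, dist1 (U ℓ * ((U' : GaugeField (F.P K) 0 (Matrix.specialUnitaryGroup (Fin 2) ℂ)) ℓ)⁻¹) ^ 2)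
            ≤ wilsonAction4 U - minActionRegPr F J K hJK ε₀ V

/-- **THE RESIDUAL GAUGE GROUP of the `(K−J)`-fold averaging fibration** (v6; ORBIT flag of w4-20520 g15 17:00Z): the fine gauge transformations `w` that act
trivially on data, `D_{J,K}(U^w) = D_{J,K}(U)` for every fine `U` — by the covariance (11) of the averaging (0.4) these are the `w` whose induced coarse
transformation `w̄ = w ∘ emb^{K−J}` is central-constant (`≡ ±1` on `SU(2)`; both sheets act identically since `(−w)•U = w•U`).  It contains `1`
(`one_mem_residualGauge`), preserves every fibre, the Wilson action (`T4WilsonGaugeFlatDirection.wilsonAction_gaugeAct`) and `histGood`, and acts FREELY on fine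
fields (a `w` fixing `U` is determined by parallel transport from one embedded site, where `w = 1`), so every residual orbit has the SAME dimension — the source
of the datum-independence of the `−(n/2)·log λ` term in (T), including at `V ≡ 1` where `argmin = {du : ū ≡ c} = {w•1 : w̄ ≡ 1}` (`u·c⁻¹` is residual).
[cite: Balaban1985Averaging, (8) p.19 and (11) p.19; Balaban1985Variational, Thm 1 (8)-(10) p.279] -/
def ResidualGauge (F : T3Family) {J K : ℕ} (hJK : J ≤ K) : Set (GaugeTransf (F.P K) 0 (Matrix.specialUnitaryGroup (Fin 2) ℂ)) :=
  {w | ∀ U : GaugeField (F.P K) 0 (Matrix.specialUnitaryGroup (Fin 2) ℂ),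
    descendTo F ℰp J K hJK (GaugeField.gaugeAct w U) = descendTo F ℰp J K hJK U}

/-- `w ≡ 1` is residual (so the orbit infimum in GAP♯ is over a nonempty type). [cite: Balaban1985Averaging, (8) p.19] -/
theorem one_mem_residualGauge (F : T3Family) {J K : ℕ} (hJK : J ≤ K) : (fun _ => 1) ∈ ResidualGauge F hJK := by
  intro U
  have h : GaugeField.gaugeAct (fun _ => (1 : Matrix.specialUnitaryGroup (Fin 2) ℂ)) U = U := by
    funext b; simp [GaugeField.gaugeAct]
  rw [h]

/-- **GAP♯∘ · UNIFORM FIBRE STIFFNESS, ORBIT FORM, ON THE INTERIOR WINDOW** (v11.4: the datum guard at `θBal F.L γ (cw * b₀) p₀ J` under the shared `∀ L, ∃ c₀, …, ∀ cw ≤ c₀`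
prefix; `argminHist`'s history clause at profile `b₀` unchanged; v6 — replaces GAP as LAPLACE's hypothesis; ORBIT flag w4-20520 g15 17:00Z, LINE OWNER WORD 6): GAP's
prefix VERBATIM, but the excess action over the window controls the squared distance to the RESIDUAL-GAUGE ORBIT of ANY minimising small-field history `U₀`,
not merely the distance to the argmin set.  Consequences: ORB («`argminHist V` is ONE residual orbit» — take `U ∈ argminHist V`: the infimum vanishes and the
orbit is compact) and, `histGood` and the action being gauge invariant, GAP itself; this is the Morse–Bott input (a non-degenerate critical ORBIT of
datum-independent dimension) that `Literature.Analysis.Asymptotics.LaplaceMethodOrbitCompact` consumes.  It is the natural output of the stiffness seats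
(Hessian gap transverse to the gauge orbit at print's minimiser, [Balaban1985Variational] (142), propagated along the fibre by convexity) together with the
UNIQUENESS half of CMP 102 Thm 1.  Why it might fail: a window datum with two gauge-inequivalent minimising small-field histories (excluded in print by the
contraction argument of CMP 102 Thm 1 for small fields — exactly what GAP♯ adds over GAP); cheapest falsifier: two distinct residual orbits of minimisers over
`V ≡ 1` at depth 1, `L = 3` (there are none: the minimisers are the pure gauges `du`, `ū` constant, one residual orbit).
[cite: Balaban1985Variational, Thm 1 (8)-(10) p.279 and (142) p.299; Balaban1984PropagatorsII, (1.33)] -/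
def UniformFibreGapOrbit : Prop :=
  ∀ (L : ℕ), ∃ c₀ : ℝ, 0 < c₀ ∧ c₀ ≤ 1 ∧ ∀ (cw : ℝ), 0 < cw → cw ≤ c₀ → ∃ pS : ℝ, ∀ (b₀ p₀ : ℝ), 0 < b₀ → pS ≤ p₀ → 0 < p₀ → ∃ ε₁ : ℝ, 0 < ε₁ ∧ ∀ (ε₀ : ℝ), 0 < ε₀ → ε₀ ≤ ε₁ →
    ∃ γ₁ : ℝ, 0 < γ₁ ∧ ∃ μ : ℝ, 0 < μ ∧ ∀ (F : T3Family) (γ : ℝ), F.L = L → 0 < γ → γ ≤ γ₁ →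
      ∀ (J K : ℕ) (hJK : J ≤ K) (V : GaugeField (F.P J) 0 (Matrix.specialUnitaryGroup (Fin 2) ℂ)), PlaqSmall (θBal F.L γ (cw * b₀) p₀ J) V →
        ∀ U₀ ∈ argminHist F γ b₀ p₀ ε₀ hJK V, ∀ U ∈ fibre F ℰp J K hJK V, U ∈ histGood F ℰp (θBal F.L γ b₀ p₀) K J →
          μ * ((F.L : ℝ)⁻¹) ^ (2 * (K - J)) *
              (⨅ w : ResidualGauge F hJK, ∑ ℓ : PBond (F.P K) 0,
                dist1 (U ℓ * ((GaugeField.gaugeAct (w : GaugeTransf (F.P K) 0 (Matrix.specialUnitaryGroup (Fin 2) ℂ)) U₀) ℓ)⁻¹) ^ 2)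
            ≤ wilsonAction4 U - minActionRegPr F J K hJK ε₀ V

/-- **WREG · WINDOW REGULARITY OF THE SMALL-FIELD FIBRE DENSITY** (NEW ORGAN, stub; M–L, measure theory of the iterated (0.4) averaging — coupling-independent,
shared with LINE g17-1): for every block size `L`, thresholds `b₀, p₀ > 0`, there is `γ₁ > 0` such that for every family with `F.L = L`, `0 < γ ≤ γ₁`, every run `K`,
height `J ≤ K` and EVERY weight coupling `γ′ > 0`: **(R)** the `θ_J(γ)`-window lies in the maximal regular open set `Node00.regSet` of the restricted density
`heightDensity F γ′ hJK (histGood at θBal γ)` (its a.e.-class HAS a continuous version near every window datum), and **(P)** the canonical version is positive on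
the window.  Mechanism: local fibred charts of the `(K−J)`-fold small-field averaging (`Node00.subset_regSet_transform_of_fibredChart`; one step = the 19201 seats'
`OneStepSubmersion.oneStepSubmersion` on `SU(2)`), fibrewise nullity of the frontier of `histGood` + pointwise dominated convergence, positive fibre mass of
`histGood` over every window datum.  Why it might fail: a fibre component on which an intermediate plaquette variable is constant `= θ_j` (the fibre integral then
jumps at that datum); the guard margin `((d+2)L)²θ < 4δ₂` at every intermediate level is what `γ ≤ γ₁(L,b₀,p₀)` buys.  Cheapest falsifier: instrument row
R3-WREG-RANK (rank of the linearised intermediate-plaquette map on the fibre tangent at `U ≡ 1`, depth 1, `L = 2`).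
[cite: Balaban1985Averaging, (10) p.19; Balaban1987RG1, (0.13) p.254 and (2.10) p.267; Balaban1985UV3, (2) p.256] -/
def WindowRegularity : Prop :=
  ∀ (L : ℕ) (b₀ p₀ : ℝ), 0 < b₀ → 0 < p₀ → ∃ γ₁ : ℝ, 0 < γ₁ ∧ ∀ (F : T3Family) (γ : ℝ), F.L = L → 0 < γ → γ ≤ γ₁ →
    ∀ (J K : ℕ) (hJK : J ≤ K) (γ' : ℝ), 0 < γ' →
      {U : GaugeField (F.P J) 0 (Matrix.specialUnitaryGroup (Fin 2) ℂ) | PlaqSmall (θBal F.L γ b₀ p₀ J) U} ⊆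
          Node00.regSet (fieldMeasure (F.P J) 0 (Matrix.specialUnitaryGroup (Fin 2) ℂ))
            (heightDensity F γ' hJK (histGood F ℰp (θBal F.L γ b₀ p₀) K J)) ∧
      ∀ U : GaugeField (F.P J) 0 (Matrix.specialUnitaryGroup (Fin 2) ℂ), PlaqSmall (θBal F.L γ b₀ p₀ J) U →
          0 < heightDensityCan F γ' hJK (histGood F ℰp (θBal F.L γ b₀ p₀) K J) U

/-- **WREG DELIVERS 1L4ᶜ's CONJUNCTS (R) ∧ (P) ON THE NOSE (PROVED)**: at every `λ ≥ 1` take the weight coupling `γ′ := γ/λ > 0`. [cite: Balaban1985UV3, (2) p.256] -/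
theorem oneLoopRP_of_windowRegularity (hW : WindowRegularity) (L : ℕ) (b₀ p₀ : ℝ) (hb : 0 < b₀) (hp : 0 < p₀) :
    ∃ γ₁ : ℝ, 0 < γ₁ ∧ ∀ (F : T3Family) (γ : ℝ), F.L = L → 0 < γ → γ ≤ γ₁ → ∀ (J K : ℕ) (hJK : J ≤ K),
      (∀ lam : ℝ, 1 ≤ lam →
        {U : GaugeField (F.P J) 0 (Matrix.specialUnitaryGroup (Fin 2) ℂ) | PlaqSmall (θBal F.L γ b₀ p₀ J) U} ⊆
          Node00.regSet (fieldMeasure (F.P J) 0 (Matrix.specialUnitaryGroup (Fin 2) ℂ))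
            (heightDensity F (γ / lam) hJK (histGood F ℰp (θBal F.L γ b₀ p₀) K J))) ∧
      (∀ lam : ℝ, 1 ≤ lam → ∀ U : GaugeField (F.P J) 0 (Matrix.specialUnitaryGroup (Fin 2) ℂ), PlaqSmall (θBal F.L γ b₀ p₀ J) U →
          0 < heightDensityCan F (γ / lam) hJK (histGood F ℰp (θBal F.L γ b₀ p₀) K J) U) := by
  obtain ⟨γ₁, hγ₁, H⟩ := hW L b₀ p₀ hb hp
  refine ⟨γ₁, hγ₁, fun F γ hFL hγ hγ1 J K hJK => ⟨fun lam hlam => ?_, fun lam hlam => ?_⟩⟩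
  · exact (H F γ hFL hγ hγ1 J K hJK (γ / lam) (div_pos hγ (by linarith))).1
  · exact (H F γ hFL hγ hγ1 J K hJK (γ / lam) (div_pos hγ (by linarith))).2

end Organs

/-! ## §4 PROVED: LFRᶜ ⇒ LFR♯ᶜ (polymer-norm clustering) -/

/-- **LFRᶜ ⇒ LFR♯ᶜ (PROVED)**: the 4-point shadow of a polymer representation, `ψ := 4Ψ`. [cite: Balaban1987RG1, (0.23)-(0.26)] -/
theorem largeFieldFourPtCan_of_polymerRep (hL : LargeFieldPolymerRepCan) : LargeFieldFourPtCan := by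
  intro L
  obtain ⟨pS, hLL⟩ := hL L
  refine ⟨pS, fun b₀ p₀ hb hpS hp => ?_⟩
  obtain ⟨γ₁, hγ₁, κ, hκ, hL1⟩ := hLL b₀ p₀ hb hpS hp
  refine ⟨γ₁, hγ₁, κ, hκ, fun F γ hFL hγ hγ1 => ?_⟩
  obtain ⟨Ψ, hΨ0, hΨt, hL2⟩ := hL1 F γ hFL hγ hγ1
  refine ⟨fun J => 4 * Ψ J, fun J => by have := hΨ0 J; positivity, ?_, ?_⟩
  · have h := hΨt.const_mul 4
    rw [mul_zero] at h
    refine h.congr' (Eventually.of_forall fun J => ?_)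
    show 4 * ((J : ℝ) * Ψ J) = (J : ℝ) * (4 * Ψ J)
    ring
  · intro ν hνK hνd J K hJK ρ hρpos hνρ hρcont hgpos b b' U V W Z hU hV hW hZ hUV hUW hVZ hWZ
    have hrep := hL2 ν hνK hνd J K hJK ρ hρpos hνρ hρcont hgpos
    have h := fourPoint_le_of_polymerRepOn hrep hκ.le b b' U V W Z hU hV hW hZ hUV hUW hVZ hWZ
    simpa only [fourPt] using h

/-! ## §4b v8 DOCKING (w4-20520 g15; LINE OWNER WORD 12; LEAD w3-20520 g14 GO 19:23Z): the LAPLACE row's residue as displayed stubs —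
the CHART rows (CHART∞ V-c3's export shape), the per-datum (C3β″)+(T2)+(C2) package, and the chart-free 4-point DECAY; `stub_oneLoopLaplace` becomes a THEOREM -/

section LaplaceDocking

variable (F : T3Family) (γ b₀ p₀ ε₀ : ℝ) {J K : ℕ} (hJK : J ≤ K)

/-- **THE CHART ROWS** (text = the per-datum conjuncts of CHART∞ V-c3 `…ChartContLaplaceRows.exists_laplaceRows` (w3-20520 g14, sha16 f6c6b279) that the
LIMIT door and px11 g10's seam (e) `…S2BetaFibreTransport.limitInst_exw_gap_rows_of_chartRows` read, for a window chart `c` on the whole `θ_J`-window with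
carrier `Xc V := {z | c.jac (V,z) ≠ 0}` and the action `pivotAct` of `residualSubgroup × SU(2)^{pivots}`): compact invariant carrier, vanishing of the density off
it, continuity of the action-through-the-chart ∕ the density ∕ the chart on it, invariances, relative openness of the event, identity off the pivots and the fibre
identity on the carrier, and RECOGNITION of fibre points in `histGood` as live self-charted points. [cite: Balaban1985Averaging, §E Prop 6 p.26-27; Balaban1987RG1, (0.13) p.254] -/
def ChartRows (c : Summit.QuantumFields.YangMills.Theorems.FluctuationComparisonRegPrIntLWregGlue.WindowChart F hJK (histGood F ℰp (θBal F.L γ b₀ p₀) K J) {V : GaugeField (F.P J) 0 (Matrix.specialUnitaryGroup (Fin 2) ℂ) | PlaqSmall (θBal F.L γ b₀ p₀ J) V}) : Prop :=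
  ∀ V : GaugeField (F.P J) 0 (Matrix.specialUnitaryGroup (Fin 2) ℂ),
    IsCompact {z : GaugeField (F.P K) 0 (Matrix.specialUnitaryGroup (Fin 2) ℂ) | c.jac (V, z) ≠ 0} ∧
    (∀ k z, z ∈ {z : GaugeField (F.P K) 0 (Matrix.specialUnitaryGroup (Fin 2) ℂ) | c.jac (V, z) ≠ 0} → Summit.QuantumFields.YangMills.Theorems.FluctuationComparisonRegPrIntLS2BetaResidualSubgroup.pivotAct F hJK (Summit.QuantumFields.YangMills.Theorems.FluctuationComparisonRegPrIntLWregChain.iterCentralBond (P := F.P K) (K - J)) k z ∈ {z : GaugeField (F.P K) 0 (Matrix.specialUnitaryGroup (Fin 2) ℂ) | c.jac (V, z) ≠ 0}) ∧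
    (∀ z, z ∉ {z : GaugeField (F.P K) 0 (Matrix.specialUnitaryGroup (Fin 2) ℂ) | c.jac (V, z) ≠ 0} → (c.jac (V, z) : ℝ) = 0) ∧
    ContinuousOn (fun z => wilsonAction4 (c.Φ (V, z))) {z : GaugeField (F.P K) 0 (Matrix.specialUnitaryGroup (Fin 2) ℂ) | c.jac (V, z) ≠ 0} ∧
    ContinuousOn (fun z => (c.jac (V, z) : ℝ)) {z : GaugeField (F.P K) 0 (Matrix.specialUnitaryGroup (Fin 2) ℂ) | c.jac (V, z) ≠ 0} ∧
    ContinuousOn (fun z => c.Φ (V, z)) {z : GaugeField (F.P K) 0 (Matrix.specialUnitaryGroup (Fin 2) ℂ) | c.jac (V, z) ≠ 0} ∧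
    (∀ k, ∀ z ∈ {z : GaugeField (F.P K) 0 (Matrix.specialUnitaryGroup (Fin 2) ℂ) | c.jac (V, z) ≠ 0}, wilsonAction4 (c.Φ (V, Summit.QuantumFields.YangMills.Theorems.FluctuationComparisonRegPrIntLS2BetaResidualSubgroup.pivotAct F hJK (Summit.QuantumFields.YangMills.Theorems.FluctuationComparisonRegPrIntLWregChain.iterCentralBond (P := F.P K) (K - J)) k z)) = wilsonAction4 (c.Φ (V, z))) ∧
    (∀ k, ∀ z ∈ {z : GaugeField (F.P K) 0 (Matrix.specialUnitaryGroup (Fin 2) ℂ) | c.jac (V, z) ≠ 0}, (c.jac (V, Summit.QuantumFields.YangMills.Theorems.FluctuationComparisonRegPrIntLS2BetaResidualSubgroup.pivotAct F hJK (Summit.QuantumFields.YangMills.Theorems.FluctuationComparisonRegPrIntLWregChain.iterCentralBond (P := F.P K) (K - J)) k z) : ℝ) = c.jac (V, z)) ∧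
    IsOpen ((Subtype.val : {z : GaugeField (F.P K) 0 (Matrix.specialUnitaryGroup (Fin 2) ℂ) | c.jac (V, z) ≠ 0} → GaugeField (F.P K) 0 (Matrix.specialUnitaryGroup (Fin 2) ℂ)) ⁻¹' {z | c.Φ (V, z) ∈ (histGood F ℰp (θBal F.L γ b₀ p₀) K J)}) ∧
    (∀ k, ∀ z ∈ {z : GaugeField (F.P K) 0 (Matrix.specialUnitaryGroup (Fin 2) ℂ) | c.jac (V, z) ≠ 0}, c.Φ (V, z) ∈ (histGood F ℰp (θBal F.L γ b₀ p₀) K J) → c.Φ (V, Summit.QuantumFields.YangMills.Theorems.FluctuationComparisonRegPrIntLS2BetaResidualSubgroup.pivotAct F hJK (Summit.QuantumFields.YangMills.Theorems.FluctuationComparisonRegPrIntLWregChain.iterCentralBond (P := F.P K) (K - J)) k z) ∈ (histGood F ℰp (θBal F.L γ b₀ p₀) K J)) ∧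
    (∀ z ∈ {z : GaugeField (F.P K) 0 (Matrix.specialUnitaryGroup (Fin 2) ℂ) | c.jac (V, z) ≠ 0}, ∀ b, (∀ c', Summit.QuantumFields.YangMills.Theorems.FluctuationComparisonRegPrIntLWregChain.iterCentralBond (P := F.P K) (K - J) c' ≠ b) → c.Φ (V, z) b = z b) ∧
    (∀ z ∈ {z : GaugeField (F.P K) 0 (Matrix.specialUnitaryGroup (Fin 2) ℂ) | c.jac (V, z) ≠ 0}, descendTo F ℰp J K hJK (c.Φ (V, z)) = V) ∧
    (∀ U, descendTo F ℰp J K hJK U = V → U ∈ (histGood F ℰp (θBal F.L γ b₀ p₀) K J) → (c.jac (V, U) ≠ 0 ∧ c.Φ (V, U) = U) ∧ {z : GaugeField (F.P K) 0 (Matrix.specialUnitaryGroup (Fin 2) ℂ) | c.jac (V, z) ≠ 0} ∈ 𝓝 U)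

/-- **THE PER-DATUM (C3β″) + (T2) + (C2) PACKAGE** (text = the binder types of ✓`…S2BetaLaplaceInstLocal.laplaceLimit_of_charts_local` (w5-20520 g13∕g14)
that are neither chart rows nor EXW∕GAP♯ consequences — the group chart `e` of `residualSubgroup × SU(2)^{pivots}` at `1`, a transversal `σ` through the
minimising history `U₀`, LOCALLY in the carrier (w5 g14 WORD 2), a window `W`, a density `Jd`, a radius `ρ`, with the tubular Haar chart identity for
`pivotAct ∘ (e, σ)` and the slice rows for the common sheet set `Sst` (px21 g9∕g10's ✓`…S2BetaTubularChartDockTransversal.exists_tubularHaarChart_pivotAct_transversal`,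
RG-K's stabiliser rows) — PLUS the OFF-PIVOT QUADRATIC TRANSVERSALITY row (T2) of that theorem VERBATIM (GAP♯-free; the growth of the action along `σ` is then
GAP♯ ∘ ✓`…S2BetaFibreGrowth.growth_of_offPivot_orbitDist_le` (px11 g10), derived in `cornerLimit_of_rows`), and the (C2) row «the action through the chart and the
transversal is `C²` at `0`» (w5-20520 g14's (C2-d) `contDiffAt_wilsonAction4_windowChart_of_histGood`), which ✓`…S2BetaLaplacePeano.hessianRows_of_contDiffAt_of_growth`
turns (with the growth) into the door's Hessian rows. [cite: Helgason2000, Ch. I §1 Thm 1.14 p.96; Balaban1985Variational, Thm 1 (8)-(10) p.279 and (142) p.299; Breitung1994, Thm 41 p.56] -/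
def ChartPackage (c : Summit.QuantumFields.YangMills.Theorems.FluctuationComparisonRegPrIntLWregGlue.WindowChart F hJK (histGood F ℰp (θBal F.L γ b₀ p₀) K J) {V : GaugeField (F.P J) 0 (Matrix.specialUnitaryGroup (Fin 2) ℂ) | PlaqSmall (θBal F.L γ b₀ p₀ J) V}) (dZ dV : ℕ) (Sst : Set (↥(Summit.QuantumFields.YangMills.Theorems.FluctuationComparisonRegPrIntLS2BetaResidualSubgroup.residualSubgroup F hJK) × (PBond (F.P K) (K - J) → (Matrix.specialUnitaryGroup (Fin 2) ℂ)))) (V : GaugeField (F.P J) 0 (Matrix.specialUnitaryGroup (Fin 2) ℂ)) (U₀ : GaugeField (F.P K) 0 (Matrix.specialUnitaryGroup (Fin 2) ℂ)) : Prop :=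
  ∃ (e : EuclideanSpace ℝ (Fin dZ) → (↥(Summit.QuantumFields.YangMills.Theorems.FluctuationComparisonRegPrIntLS2BetaResidualSubgroup.residualSubgroup F hJK) × (PBond (F.P K) (K - J) → (Matrix.specialUnitaryGroup (Fin 2) ℂ)))) (σ : EuclideanSpace ℝ (Fin dV) → GaugeField (F.P K) 0 (Matrix.specialUnitaryGroup (Fin 2) ℂ)) (W : Set (EuclideanSpace ℝ (Fin dZ) × EuclideanSpace ℝ (Fin dV))) (Jd : EuclideanSpace ℝ (Fin dZ) × EuclideanSpace ℝ (Fin dV) → ℝ) (ρ : ℝ),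
    Continuous e ∧ e 0 = 1 ∧ 𝓝 (1 : (↥(Summit.QuantumFields.YangMills.Theorems.FluctuationComparisonRegPrIntLS2BetaResidualSubgroup.residualSubgroup F hJK) × (PBond (F.P K) (K - J) → (Matrix.specialUnitaryGroup (Fin 2) ℂ)))) ≤ map e (𝓝 0) ∧
    Continuous σ ∧ σ 0 = U₀ ∧ (∀ᶠ y in 𝓝 (0 : EuclideanSpace ℝ (Fin dV)), σ y ∈ {z : GaugeField (F.P K) 0 (Matrix.specialUnitaryGroup (Fin 2) ℂ) | c.jac (V, z) ≠ 0}) ∧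
    (∃ c₁ : ℝ, 0 < c₁ ∧ ∀ᶠ y in 𝓝 (0 : EuclideanSpace ℝ (Fin dV)),
      c₁ * ‖y‖ ^ 2 ≤ ⨅ w : {w : Site (F.P K) 0 → (Matrix.specialUnitaryGroup (Fin 2) ℂ) |
            ∀ U : GaugeField (F.P K) 0 (Matrix.specialUnitaryGroup (Fin 2) ℂ), descendTo F ℰp J K hJK (GaugeField.gaugeAct w U) = descendTo F ℰp J K hJK U},
          ∑ ℓ ∈ Finset.univ.filter (fun ℓ : PBond (F.P K) 0 => ∀ c', Summit.QuantumFields.YangMills.Theorems.FluctuationComparisonRegPrIntLWregChain.iterCentralBond (P := F.P K) (K - J) c' ≠ ℓ),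
            dist1 (σ y ℓ * ((GaugeField.gaugeAct (w : Site (F.P K) 0 → (Matrix.specialUnitaryGroup (Fin 2) ℂ)) U₀) ℓ)⁻¹) ^ 2) ∧
    𝓝 (σ 0) ≤ map (fun p : EuclideanSpace ℝ (Fin dZ) × EuclideanSpace ℝ (Fin dV) => Summit.QuantumFields.YangMills.Theorems.FluctuationComparisonRegPrIntLS2BetaResidualSubgroup.pivotAct F hJK (Summit.QuantumFields.YangMills.Theorems.FluctuationComparisonRegPrIntLWregChain.iterCentralBond (P := F.P K) (K - J)) (e p.1) (σ p.2)) (𝓝 0) ∧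
    IsOpen W ∧ InjOn (fun p : EuclideanSpace ℝ (Fin dZ) × EuclideanSpace ℝ (Fin dV) => Summit.QuantumFields.YangMills.Theorems.FluctuationComparisonRegPrIntLS2BetaResidualSubgroup.pivotAct F hJK (Summit.QuantumFields.YangMills.Theorems.FluctuationComparisonRegPrIntLWregChain.iterCentralBond (P := F.P K) (K - J)) (e p.1) (σ p.2)) W ∧
    ContinuousOn Jd W ∧ (∀ w ∈ W, 0 ≤ Jd w) ∧
    (fieldMeasure (F.P K) 0 (Matrix.specialUnitaryGroup (Fin 2) ℂ)).restrict ((fun p : EuclideanSpace ℝ (Fin dZ) × EuclideanSpace ℝ (Fin dV) => Summit.QuantumFields.YangMills.Theorems.FluctuationComparisonRegPrIntLS2BetaResidualSubgroup.pivotAct F hJK (Summit.QuantumFields.YangMills.Theorems.FluctuationComparisonRegPrIntLWregChain.iterCentralBond (P := F.P K) (K - J)) (e p.1) (σ p.2)) '' W) =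
      ((((volume : Measure (EuclideanSpace ℝ (Fin dZ))).prod (volume : Measure (EuclideanSpace ℝ (Fin dV)))).restrict W).withDensity fun w => ENNReal.ofReal (Jd w)).map
        (fun p : EuclideanSpace ℝ (Fin dZ) × EuclideanSpace ℝ (Fin dV) => Summit.QuantumFields.YangMills.Theorems.FluctuationComparisonRegPrIntLS2BetaResidualSubgroup.pivotAct F hJK (Summit.QuantumFields.YangMills.Theorems.FluctuationComparisonRegPrIntLWregChain.iterCentralBond (P := F.P K) (K - J)) (e p.1) (σ p.2)) ∧
    0 < ρ ∧ Metric.closedBall (0 : EuclideanSpace ℝ (Fin dZ)) ρ ×ˢ {(0 : EuclideanSpace ℝ (Fin dV))} ⊆ W ∧ 0 < ∫ z in Metric.ball (0 : EuclideanSpace ℝ (Fin dZ)) ρ, Jd (z, 0) ∧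
    (∀ k, Summit.QuantumFields.YangMills.Theorems.FluctuationComparisonRegPrIntLS2BetaResidualSubgroup.pivotAct F hJK (Summit.QuantumFields.YangMills.Theorems.FluctuationComparisonRegPrIntLWregChain.iterCentralBond (P := F.P K) (K - J)) k (σ 0) = σ 0 → k ∈ Sst) ∧ (∀ s ∈ Sst, ∀ y, Summit.QuantumFields.YangMills.Theorems.FluctuationComparisonRegPrIntLS2BetaResidualSubgroup.pivotAct F hJK (Summit.QuantumFields.YangMills.Theorems.FluctuationComparisonRegPrIntLWregChain.iterCentralBond (P := F.P K) (K - J)) s (σ y) = σ y) ∧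
    ContDiffAt ℝ 2 (fun y => wilsonAction4 (c.Φ (V, σ y))) 0

/-- **CHART-SMOOTH** (v8 docking stub): for every block size, profile and coupling (GAP♯'s prefix) and every `J ≤ K`: COMMON dimensions `dZ dV` (the
exponent of (T) is `dV∕2` at every corner) and sheet set `Sst`, ONE window chart `c` on `histGood` over the `θ_J`-window with `ChartRows`, and for every window
datum `V` and every minimising small-field history `U₀ ∈ argminHist V` the `ChartPackage`.  Suppliers: CHART∞ (w3-20520 g14 V-c3∕V-e1: `ChartRows` by
`…ChartContLaplaceRows.exists_laplaceRows`), (C3β″)+(T2) (px21 g9∕g10: `e σ W Jd ρ` and the transversality row, by `exists_tubularHaarChart_pivotAct_transversal`),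
RG-K (px11 g9: `Sst`, stabiliser rows), (C2) (w5-20520 g14 (C2-a,c,d) ∕ px11 g10 (C2-b): the `C²` row).  Why it might fail: the action through the window chart
of record is only continuous, not `C²`, along the transversal at some minimiser (CHART∞ (a)∕(C2)). The stub ∃-quantifies ITS chart: the `C²` row is a property
of that chart. [cite: Balaban1985Averaging, §E Prop 6 p.26-27; Balaban1985Variational, Thm 1 (8)-(10) p.279; Helgason2000, Ch. I §1 Thm 1.14 p.96] -/
def ChartSmooth : Prop :=
  ∀ (L : ℕ), ∃ pS : ℝ, ∀ (b₀ p₀ : ℝ), 0 < b₀ → pS ≤ p₀ → 0 < p₀ → ∃ ε₁ : ℝ, 0 < ε₁ ∧ ∀ (ε₀ : ℝ), 0 < ε₀ → ε₀ ≤ ε₁ →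
    ∃ γ₁ : ℝ, 0 < γ₁ ∧ ∀ (F : T3Family) (γ : ℝ), F.L = L → 0 < γ → γ ≤ γ₁ →
      ∀ (J K : ℕ) (hJK : J ≤ K),
        ∃ (dZ dV : ℕ) (Sst : Set (↥(Summit.QuantumFields.YangMills.Theorems.FluctuationComparisonRegPrIntLS2BetaResidualSubgroup.residualSubgroup F hJK) × (PBond (F.P K) (K - J) → (Matrix.specialUnitaryGroup (Fin 2) ℂ)))) (c : Summit.QuantumFields.YangMills.Theorems.FluctuationComparisonRegPrIntLWregGlue.WindowChart F hJK (histGood F ℰp (θBal F.L γ b₀ p₀) K J) {V : GaugeField (F.P J) 0 (Matrix.specialUnitaryGroup (Fin 2) ℂ) | PlaqSmall (θBal F.L γ b₀ p₀ J) V}),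
          ChartRows F γ b₀ p₀ hJK c ∧
          ∀ (V : GaugeField (F.P J) 0 (Matrix.specialUnitaryGroup (Fin 2) ℂ)), PlaqSmall (θBal F.L γ b₀ p₀ J) V → ∀ U₀ ∈ argminHist F γ b₀ p₀ ε₀ hJK V,
            ChartPackage F γ b₀ p₀ hJK c dZ dV Sst V U₀

/-- **FOUR-POINT DECAY∘ · THE CHART-FREE CLUSTERING OF THE SEMICLASSICAL CONSTANTS, INTERIOR QUADRILATERALS** (v8 docking stub; v11.4: the four corner guards at
`θBal F.L γ (cw * b₀) p₀ J` under the shared `∀ L, ∃ c₀, …, ∀ cw ≤ c₀` prefix, history profile `b₀` unchanged; a THEOREM by `fourPtDecay_of_detRep`).  For every block size, profile, coupling (GAP♯'s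
prefix) there is `κ > 0` and a depth-uniform `φ₁`, `J·φ₁ J → 0`, such that at every window quadrilateral `U V W Z` (corners differing on the bonds `b, b'`)
and every exponent `d`: IF the scaled Laplace limits `λ^{d∕2}·(heightDensityCan(γ∕λ) x · e^{λβ_K·minActionRegPr x}) → ℓ x > 0` EXIST at the four corners
(they do, by CHART-SMOOTH ∘ LIMIT; limits are unique, so the stub speaks of the chart-INDEPENDENT limit values), THEN
`|(log ℓ U − log ℓ V) − (log ℓ W − log ℓ Z)| ≤ φ₁ J · e^{−κ·tdist(b.src, b'.src)}`.  Proof route of record: ✓(D2) `…S2BetaDecayDoor.abs_fourPt_log_oneLoopConst_le`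
∘ ✓(D3) `…S2BetaDecayLogDet.abs_fourPt_log_oneLoopConst_le_of_rectangle` ∘ px7 g9's ✓`Literature.Analysis.Matrix.abs_fourPt_log_det_le_of_expLocalised` ∘
✓`coercive_combes_thomas_real`, given the S2β localisation rows (common-slice Hessian rectangle, profiles, uniform gap, mixed response, amplitude 4-point).
Why it might fail: a long-range term in the one-loop constant (the `k`-step averaging kernels' tails are only power-law controlled at a single step).
[cite: Balaban1985Variational, Thm 1 (8)-(10) p.279; Balaban1984PropagatorsII, (1.33); GlimmJaffe1987, §18.2] -/
def FourPtDecay : Prop :=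
  ∀ (L : ℕ), ∃ c₀ : ℝ, 0 < c₀ ∧ c₀ ≤ 1 ∧ ∀ (cw : ℝ), 0 < cw → cw ≤ c₀ → ∃ pS : ℝ, ∀ (b₀ p₀ : ℝ), 0 < b₀ → pS ≤ p₀ → 0 < p₀ → ∃ ε₁ : ℝ, 0 < ε₁ ∧ ∀ (ε₀ : ℝ), 0 < ε₀ → ε₀ ≤ ε₁ →
    ∃ γ₁ : ℝ, 0 < γ₁ ∧ ∃ κ : ℝ, 0 < κ ∧ ∀ (F : T3Family) (γ : ℝ), F.L = L → 0 < γ → γ ≤ γ₁ →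
      ∃ φ₁ : ℕ → ℝ, (∀ J, 0 ≤ φ₁ J) ∧ Tendsto (fun J : ℕ => (J : ℝ) * φ₁ J) atTop (𝓝 0) ∧
        ∀ (J K : ℕ) (hJK : J ≤ K) (d : ℝ) (b b' : PBond (F.P J) 0) (U V W Z : GaugeField (F.P J) 0 (Matrix.specialUnitaryGroup (Fin 2) ℂ)) (ℓ : GaugeField (F.P J) 0 (Matrix.specialUnitaryGroup (Fin 2) ℂ) → ℝ),
          PlaqSmall (θBal F.L γ (cw * b₀) p₀ J) U → PlaqSmall (θBal F.L γ (cw * b₀) p₀ J) V →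
          PlaqSmall (θBal F.L γ (cw * b₀) p₀ J) W → PlaqSmall (θBal F.L γ (cw * b₀) p₀ J) Z →
          (∀ e, e ≠ b → U e = V e) → (∀ e, e ≠ b' → U e = W e) → (∀ e, e ≠ b' → V e = Z e) → (∀ e, e ≠ b → W e = Z e) →
          (∀ x, x = U ∨ x = V ∨ x = W ∨ x = Z →
            0 < ℓ x ∧ Tendsto (fun lam : ℝ => lam ^ (d / 2) *
              (heightDensityCan F (γ / lam) hJK (histGood F ℰp (θBal F.L γ b₀ p₀) K J) x * Real.exp (lam * (F.scheme ℰp γ).β K * minActionRegPr F J K hJK ε₀ x))) atTop (𝓝 (ℓ x))) →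
          |(Real.log (ℓ U) - Real.log (ℓ V)) - (Real.log (ℓ W) - Real.log (ℓ Z))| ≤ φ₁ J * Real.exp (-(κ * (b.src.tdist b'.src : ℝ)))

end LaplaceDocking

/-! ## §4c DET-REP (v11 docking, LINE-OWNER RULING (W3) (2)): DET-REP-A BY NAME ⊕ DET-REP-B DISPLAYED for the operators OF RECORD -/

section DetRep

open scoped Pointwise Matrix.Norms.L2Operator

variable (F : T3Family) (γ b₀ p₀ ε₀ : ℝ) {J K : ℕ} (hJK : J ≤ K)

/-- **THE SLICE-HESSIAN MATRIX IN THE STANDARD BASIS** (w5-20520 g14's letters, ✓`…S2BetaDetRepAEdge.detRepA_edge`): for `f : ℝ × ℝ^{dV} → ℝ` and a path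
`y : ℝ → ℝ^{dV}`, `M(s)ᵢⱼ := ((D[q ↦ Df(q) ∘ inr](s, y s)) ∘ inr) eᵢ eⱼ`. [cite: Dieudonne1960, Ch. X §2 (10.2.1)-(10.2.3); Balaban1985Variational, Thm 1 (9)-(10) p.279] -/
def hessStd {dV : ℕ} (f : ℝ × EuclideanSpace ℝ (Fin dV) → ℝ) (y : ℝ → EuclideanSpace ℝ (Fin dV)) (s : ℝ) : Matrix (Fin dV) (Fin dV) ℝ :=
  Matrix.of fun i j => ((fderiv ℝ (fun q : ℝ × EuclideanSpace ℝ (Fin dV) =>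
      (fderiv ℝ f q).comp (ContinuousLinearMap.inr ℝ ℝ (EuclideanSpace ℝ (Fin dV)))) (s, y s)).comp
    (ContinuousLinearMap.inr ℝ ℝ (EuclideanSpace ℝ (Fin dV))))
    ((EuclideanSpace.basisFun (Fin dV) ℝ) i) ((EuclideanSpace.basisFun (Fin dV) ℝ) j)

/-- The entrywise `s`-derivative of `hessStd f y`. [cite: Balaban1985Variational, Thm 1 (10) p.279] -/
def hessStd' {dV : ℕ} (f : ℝ × EuclideanSpace ℝ (Fin dV) → ℝ) (y : ℝ → EuclideanSpace ℝ (Fin dV)) (s : ℝ) : Matrix (Fin dV) (Fin dV) ℝ :=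
  Matrix.of fun i j => deriv (fun s' => hessStd f y s' i j) s

/-- **TUBE ROWS** — the rows of px21 g11's docked tubular Haar chart, LOCAL∕FACTORISED edition (✓`…S2BetaTubularChartDockLocal.exists_tubularHaarChart_pivotAct_local`,
E3″ (F1)(F2)(F3)), that ✓`detRepA_edge` consumes: group chart `e` at `1` of `residualSubgroup × SU(2)^{pivots}`, continuous transversal `σ` with `C^∞` matrix field (v11.2), product window
`UZ ×ˢ UV ∋ (0, ·)`, injectivity and openness-at-every-point of the tube map `Θ (z, y) := pivotAct (e z) (σ y)`, product density `jZ ⊗ jV` with the Haar chart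
identity, radius `ρ` with `closedBall 0 ρ ⊆ UZ` and `0 < ∫_{ball ρ} jZ`; and (v11.1) **(T2-ALL)** — OFF-PIVOT QUADRATIC TRANSVERSALITY of the tube to the residual orbit at
EVERY point of the transversal window (px21 g11's ✓`…S2BetaTransversalShift.offPivot_transversal_shift` (p748520) on the window shrunk to `‖(eV y)_b‖ < 1∕2`; frame-free as
displayed), from which GAP♯ gives the transversal growth of the action at every path point (✓`…S2BetaGrowthShift.growth_at_tubePoint`, p750179).
[cite: Helgason2000, Ch. I §1 Thm 1.14 p.96; Balaban1985Variational, Thm 1 (8)-(10) p.279 and (142) p.299] -/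
def TubeRows (dZ dV : ℕ)
    (e : EuclideanSpace ℝ (Fin dZ) → ↥(Summit.QuantumFields.YangMills.Theorems.FluctuationComparisonRegPrIntLS2BetaResidualSubgroup.residualSubgroup F hJK) × (PBond (F.P K) (K - J) → Matrix.specialUnitaryGroup (Fin 2) ℂ))
    (σ : EuclideanSpace ℝ (Fin dV) → GaugeField (F.P K) 0 (Matrix.specialUnitaryGroup (Fin 2) ℂ))
    (UZ : Set (EuclideanSpace ℝ (Fin dZ))) (UV : Set (EuclideanSpace ℝ (Fin dV)))
    (jZ : EuclideanSpace ℝ (Fin dZ) → ℝ) (jV : EuclideanSpace ℝ (Fin dV) → ℝ) (ρ : ℝ) : Prop :=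
  Continuous e ∧ e 0 = 1 ∧
  𝓝 (1 : ↥(Summit.QuantumFields.YangMills.Theorems.FluctuationComparisonRegPrIntLS2BetaResidualSubgroup.residualSubgroup F hJK) × (PBond (F.P K) (K - J) → Matrix.specialUnitaryGroup (Fin 2) ℂ)) ≤ map e (𝓝 0) ∧
  Continuous σ ∧
  ContDiff ℝ ⊤ (fun y : EuclideanSpace ℝ (Fin dV) => fun b : PBond (F.P K) 0 => ((σ y b : Matrix.specialUnitaryGroup (Fin 2) ℂ) : Matrix (Fin 2) (Fin 2) ℂ)) ∧
  IsOpen UZ ∧ IsOpen UV ∧ (0 : EuclideanSpace ℝ (Fin dZ)) ∈ UZ ∧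
  (∀ y₁ ∈ UV, ∃ c : ℝ, 0 < c ∧ ∀ᶠ v in 𝓝 (0 : EuclideanSpace ℝ (Fin dV)),
    c * ‖v‖ ^ 2 ≤ ⨅ w : {w : Site (F.P K) 0 → Matrix.specialUnitaryGroup (Fin 2) ℂ |
          ∀ U : GaugeField (F.P K) 0 (Matrix.specialUnitaryGroup (Fin 2) ℂ),
            descendTo F ℰp J K hJK (GaugeField.gaugeAct w U) = descendTo F ℰp J K hJK U},
        ∑ ℓ ∈ Finset.univ.filter (fun ℓ : PBond (F.P K) 0 =>
            ∀ c', Summit.QuantumFields.YangMills.Theorems.FluctuationComparisonRegPrIntLWregChain.iterCentralBond (P := F.P K) (K - J) c' ≠ ℓ),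
          dist1 (σ (y₁ + v) ℓ * ((GaugeField.gaugeAct (w : Site (F.P K) 0 → Matrix.specialUnitaryGroup (Fin 2) ℂ) (σ y₁)) ℓ)⁻¹) ^ 2) ∧
  InjOn (fun p : EuclideanSpace ℝ (Fin dZ) × EuclideanSpace ℝ (Fin dV) =>
    Summit.QuantumFields.YangMills.Theorems.FluctuationComparisonRegPrIntLS2BetaResidualSubgroup.pivotAct F hJK (Summit.QuantumFields.YangMills.Theorems.FluctuationComparisonRegPrIntLWregChain.iterCentralBond (P := F.P K) (K - J)) (e p.1) (σ p.2)) (UZ ×ˢ UV) ∧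
  (∀ p ∈ UZ ×ˢ UV, ∀ s ∈ 𝓝 p, (fun p : EuclideanSpace ℝ (Fin dZ) × EuclideanSpace ℝ (Fin dV) =>
    Summit.QuantumFields.YangMills.Theorems.FluctuationComparisonRegPrIntLS2BetaResidualSubgroup.pivotAct F hJK (Summit.QuantumFields.YangMills.Theorems.FluctuationComparisonRegPrIntLWregChain.iterCentralBond (P := F.P K) (K - J)) (e p.1) (σ p.2)) '' s ∈
    𝓝 ((fun p : EuclideanSpace ℝ (Fin dZ) × EuclideanSpace ℝ (Fin dV) =>
    Summit.QuantumFields.YangMills.Theorems.FluctuationComparisonRegPrIntLS2BetaResidualSubgroup.pivotAct F hJK (Summit.QuantumFields.YangMills.Theorems.FluctuationComparisonRegPrIntLWregChain.iterCentralBond (P := F.P K) (K - J)) (e p.1) (σ p.2)) p)) ∧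
  ContinuousOn jZ UZ ∧ ContinuousOn jV UV ∧ (∀ z ∈ UZ, 0 ≤ jZ z) ∧ (∀ y ∈ UV, 0 ≤ jV y) ∧
  (fieldMeasure (F.P K) 0 (Matrix.specialUnitaryGroup (Fin 2) ℂ)).restrict
      ((fun p : EuclideanSpace ℝ (Fin dZ) × EuclideanSpace ℝ (Fin dV) =>
        Summit.QuantumFields.YangMills.Theorems.FluctuationComparisonRegPrIntLS2BetaResidualSubgroup.pivotAct F hJK (Summit.QuantumFields.YangMills.Theorems.FluctuationComparisonRegPrIntLWregChain.iterCentralBond (P := F.P K) (K - J)) (e p.1) (σ p.2)) '' (UZ ×ˢ UV)) =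
    ((((volume : Measure (EuclideanSpace ℝ (Fin dZ))).prod (volume : Measure (EuclideanSpace ℝ (Fin dV)))).restrict (UZ ×ˢ UV)).withDensity
        fun w => ENNReal.ofReal (jZ w.1 * jV w.2)).map
      (fun p : EuclideanSpace ℝ (Fin dZ) × EuclideanSpace ℝ (Fin dV) =>
        Summit.QuantumFields.YangMills.Theorems.FluctuationComparisonRegPrIntLS2BetaResidualSubgroup.pivotAct F hJK (Summit.QuantumFields.YangMills.Theorems.FluctuationComparisonRegPrIntLWregChain.iterCentralBond (P := F.P K) (K - J)) (e p.1) (σ p.2)) ∧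
  0 < ρ ∧ Metric.closedBall (0 : EuclideanSpace ℝ (Fin dZ)) ρ ⊆ UZ ∧ 0 < ∫ z in Metric.ball (0 : EuclideanSpace ℝ (Fin dZ)) ρ, jZ z

/-- **EDGE ROWS** (v11.4: the path's window clause on the `cw`-INTERIOR window `PlaqSmall (θBal F.L γ (cw * b₀) p₀ J) (x s)`, extra parameter `cw`) — ONE EDGE of a window quadrilateral read in the common tube (the PATH∕CLOSENESS rows of DET-REP-B; print's background response
[Balaban1985Variational] Thm 1 (9)-(10) in qualitative form): a path `x` of WINDOW data from `A` (`s = 0`) to `B` (`s = 1`) varying only the bond `bnd`, and transversal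
coordinates `y s ∈ UV` of the minimising small-field history over `x s` — continuity and `C^∞` matrix smoothness of the path (v11.2), the JOINT local carrier along the edge
`∀ᶠ q in 𝓝 (s, y s), c.jac (x q.1, σ q.2) ≠ 0` (v11.2: the edge-local form of the ONE chart fact not in the tree — joint openness of the tube graph, LEAD w3-20520 g16
23:26:45Z), CHARTED-EXW (`c.Φ (x s, σ (y s))` is a minimising `histGood`-history over `x s`), continuity of `y`, `0 < jV (y s)` (v11.1: the transversal GROWTH row of v11
is gone — GAP♯ ∘ (T2-ALL) ∘ ✓`growth_at_tubePoint`; v11.2: the joint-`C³` row of v11 is gone — w5-20520 g14's ✓(C2″-WITHIN) `…PeanoSmoothParam.contDiffAt_wilsonAction4_windowChart_param_within`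
over w3-20520 g16's joint chart continuity ✓`…ChartContLaplaceRowsJoint.exists_laplaceRows₂`, both derived in `edge_rep_det`; the smooth one-bond path inside the exact window exists by
px21 g11's ✓`…S2BetaOneBondGeodesic.exists_oneBondPath`, p749974) —
exactly the displayed path binders of ✓`…S2BetaDetRepAEdge.detRepA_edge` that are NOT consequences of GAP♯ ∕ CHART∞ ∕ RG-K.  The path lives in the EXACT `θBal`-window
(the domain of the chart of record and the window of GAP♯ ∕ CHARTED-EXW): the one-bond minimal geodesic from `A b` to `B b` stays there by the geodesic convexity of
`dist1`-balls of angle-radius `< π∕2` in `SU(2) ≅ S³` (px21 g11 LOCATE WIN-PATH (d), untyped — part of the organ's burden; the cheap `exp`-path only lives in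
`PlaqSmall (6θ)`). [cite: Balaban1985Variational, Thm 1 (8)-(10) p.279 and (142) p.299] -/
def EdgeRows (c : Summit.QuantumFields.YangMills.Theorems.FluctuationComparisonRegPrIntLWregGlue.WindowChart F hJK (histGood F ℰp (θBal F.L γ b₀ p₀) K J) {V : GaugeField (F.P J) 0 (Matrix.specialUnitaryGroup (Fin 2) ℂ) | PlaqSmall (θBal F.L γ b₀ p₀ J) V})
    {dV : ℕ} (σ : EuclideanSpace ℝ (Fin dV) → GaugeField (F.P K) 0 (Matrix.specialUnitaryGroup (Fin 2) ℂ))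
    (UV : Set (EuclideanSpace ℝ (Fin dV))) (jV : EuclideanSpace ℝ (Fin dV) → ℝ) (cw : ℝ) (I : Set ℝ)
    (bnd : PBond (F.P J) 0) (A B : GaugeField (F.P J) 0 (Matrix.specialUnitaryGroup (Fin 2) ℂ))
    (x : ℝ → GaugeField (F.P J) 0 (Matrix.specialUnitaryGroup (Fin 2) ℂ)) (y : ℝ → EuclideanSpace ℝ (Fin dV)) : Prop :=
  x 0 = A ∧ x 1 = B ∧
  ∀ s ∈ I,
    PlaqSmall (θBal F.L γ (cw * b₀) p₀ J) (x s) ∧ (∀ e', e' ≠ bnd → x s e' = A e') ∧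
    ContinuousAt x s ∧
    ContDiffAt ℝ ⊤ (fun s' : ℝ => fun b : PBond (F.P J) 0 => ((x s' b : Matrix.specialUnitaryGroup (Fin 2) ℂ) : Matrix (Fin 2) (Fin 2) ℂ)) s ∧
    y s ∈ UV ∧ 0 < jV (y s) ∧
    (∀ᶠ q in 𝓝 ((s : ℝ), y s), c.jac (x q.1, σ q.2) ≠ 0) ∧
    c.Φ (x s, σ (y s)) ∈ histGood F ℰp (θBal F.L γ b₀ p₀) K J ∧
    wilsonAction4 (c.Φ (x s, σ (y s))) = minActionRegPr F J K hJK ε₀ (x s) ∧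
    ContinuousAt y s

/-- **THE JOINT CHART ROWS** (v11.2; text = three clauses of w3-20520 g16's CHART∞ export ✓`…ChartContLaplaceRowsJoint.exists_laplaceRows₂`: the chart and its Jacobian are
PIVOT-BLIND, and the chart is JOINTLY continuous in (datum, field) WITHIN the live graph `{q | c.jac q ≠ 0}`) — what ✓(C2″-WITHIN) reads beyond `ChartRows`.
[cite: Balaban1985Averaging, §E Prop 6 p.26-27; Balaban1987RG1, (0.4) p.253 and (2.10) p.267] -/
def ChartRowsJ (c : Summit.QuantumFields.YangMills.Theorems.FluctuationComparisonRegPrIntLWregGlue.WindowChart F hJK (histGood F ℰp (θBal F.L γ b₀ p₀) K J) {V : GaugeField (F.P J) 0 (Matrix.specialUnitaryGroup (Fin 2) ℂ) | PlaqSmall (θBal F.L γ b₀ p₀ J) V}) : Prop :=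
  (∀ V z (g : PBond (F.P K) (K - J) → Matrix.specialUnitaryGroup (Fin 2) ℂ), c.jac (V, z) ≠ 0 →
    c.Φ (V, Function.extend (Summit.QuantumFields.YangMills.Theorems.FluctuationComparisonRegPrIntLWregChain.iterCentralBond (P := F.P K) (K - J)) g z) = c.Φ (V, z)) ∧
  (∀ V z (g : PBond (F.P K) (K - J) → Matrix.specialUnitaryGroup (Fin 2) ℂ),
    c.jac (V, Function.extend (Summit.QuantumFields.YangMills.Theorems.FluctuationComparisonRegPrIntLWregChain.iterCentralBond (P := F.P K) (K - J)) g z) = c.jac (V, z)) ∧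
  ContinuousOn (fun q => c.Φ q) {q : GaugeField (F.P J) 0 (Matrix.specialUnitaryGroup (Fin 2) ℂ) × GaugeField (F.P K) 0 (Matrix.specialUnitaryGroup (Fin 2) ℂ) | c.jac q ≠ 0}

/-- **PRODUCT ROWS** — px19 g10's card-free `Δ² log det` rectangle letters in PRODUCT FORM for two `C¹` edge families `M₀, M₁` of matrices with entrywise
derivatives `M₀′, M₁′` (the hypotheses `hD hE hsep hA hB0 hSd hSdi hR hprod hmix` of ✓`Literature.Analysis.Matrix.abs_fourPt_log_det_le_of_productRows_of_subset`
VERBATIM on `s ∈ [0,1]`, with `M s 1 := M₁ s`, `M s 0 := M₀ s`): summed profiles `d, d′` to the two bonds, Combes–Thomas row `α e^{−θ·dist}`, bound `β₀` on the inverse,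
local sums `S_d, S_dist`, ℓ¹ mixed response `η`, separation `R ≤ d a + dist a b + d′ b`, product constraint `α·ε·β₀·δ·S_d·S_dist ≤ B`, `β₀·η ≤ B·e^{−(θ−θ₂)R}`.
[cite: Balaban1985Variational, Thm 1 (9)-(10) p.279; Balaban1984PropagatorsII, (1.33); GlimmJaffe1987, §18.2] -/
def ProductRows {n : Type*} [Fintype n] [DecidableEq n] (M₀ M₁ M₀' M₁' : ℝ → Matrix n n ℝ) (dist : n → n → ℕ) (d d' : n → ℕ) (R : ℕ)
    (α ε δ β₀ η θ θ₂ Sd Sdist B : ℝ) : Prop :=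
  0 ≤ α ∧ 0 ≤ ε ∧ 0 ≤ δ ∧ 0 ≤ β₀ ∧ 0 ≤ Sdist ∧
  (∀ s ∈ Icc (0 : ℝ) 1, ∀ a, ∑ x, |M₁' s x a| ≤ δ * Real.exp (-(θ * d a))) ∧
  (∀ s ∈ Icc (0 : ℝ) 1, ∀ b, ∑ c, |(M₁ s - M₀ s) b c| ≤ ε * Real.exp (-(θ * d' b))) ∧
  (∀ a b, R ≤ d a + dist a b + d' b) ∧
  (∀ s ∈ Icc (0 : ℝ) 1, ∀ a b, |(M₁ s)⁻¹ a b| ≤ α * Real.exp (-(θ * dist a b))) ∧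
  (∀ s ∈ Icc (0 : ℝ) 1, ∀ a b, |(M₀ s)⁻¹ a b| ≤ β₀) ∧
  (∑ a, Real.exp (-(θ₂ * d a)) ≤ Sd) ∧ (∀ a, ∑ b, Real.exp (-(θ₂ * dist a b)) ≤ Sdist) ∧
  (∀ s ∈ Icc (0 : ℝ) 1, ∑ a, ∑ b, |(M₁' s - M₀' s) a b| ≤ η) ∧
  α * ε * β₀ * δ * Sd * Sdist ≤ B ∧ β₀ * η ≤ B * Real.exp (-((θ - θ₂) * R))

/-- **v11.3 (DET-REP-B‴ — ★★OWNER WORD 74 (c) ∕ WORD 77 (c); w5-20520 g15 FINDINGs #50∕#57): the (LOC) conjunct `ProductRows (…)` with its eleven free letters and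
the old (JAC) row are REPLACED by TWO 4-point VALUE rows along the INTRINSIC seam of REP's exponent `E = log c.jac + (log jV − ½·log det M_y) = log c.jac − ½·log det
M^{normal}`: **DETN-ROW** `|Δ²_{quad} [log det hessStd (A ∘ c.Φ(x_t ·, σ ·)) y_t − 2·log jV∘y_t]| ≤ 2·Cst·θBal_J²·e^{−(θ−θ₂)·tdist}` (the INTRINSIC one-loop
determinant: at a critical point `log det M_y − 2·log jV(y) = log det M^{normal}`, Hessian congruence `M_y = Dᵀ M^{normal} D`, `|det D(y)| = jV(y) = Π_b (sin|y_b|∕|y_b|)²`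
for the product-of-exponential-charts transversal; print: the background dependence of the fluctuation determinant decays, [Balaban1985UV3] (36)–(37),
[Balaban1985BackgroundPropagators]; tool for the hand: ✓`…S2BetaLogDetTraceDiffDoor` on `M^{normal}`) and **JACW-ROW** `|Δ²_{quad} log c.jac(x_t ·, σ∘y_t)| ≤
Cst·θBal_J²·e^{−(θ−θ₂)·tdist}` (the WINDOW-CHART Jacobian alone: pivot-local, one O(1) factor per coarse bond; chart calculus on ✓E3″).  WHY: every split of `E` along the
CHART seam is EXTENSIVE in the depth — the entrywise letters bound the UV-linear tadpole∕bubble halves separately (FINDING #50, kernel part ✓`…S2BetaProductRowsTightness`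
p754335) and `log jV(y) = −⅓Σ_b |y_b|² + …` over `≍ L^{3(K−J)}` tube coordinates with `|y_b| ≍ L^{−(K−J)}θ_J` is extensive on its own (FINDING-2, evidence #57); the
intrinsic seam puts `log jV` with the determinant, where it cancels identically.  Composition: `|Δ²E| ≤ JACW + ½·DETN` (triangle; neither row alone gives
FOUR-POINT-DECAY).  Monotonicity vs v11.2a is moot (its (LOC)∕(JAC) letters are uninhabitable depth-uniformly by the two findings; no hand had sunk work into them).
Everything else below is v11.2a's text VERBATIM (its paragraph still describes the letters it replaced; `def ProductRows`, `hessStd′` stay in the file, unused by `DetRepB`).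
**DET-REP-B · THE LOCALISATION ORGAN OF FOUR-POINT-DECAY, FOR THE OPERATORS OF RECORD** (v11; LINE-OWNER RULING (W3) (2) — the displayed organ stub
that replaces FOUR-POINT-DECAY's `sorry`).  For every block size, profile and coupling (GAP♯'s prefix) there are UNIFORM `C ≥ 0` and rates `0 ≤ θ₂ < θ` such that
for every run, height, window chart `c` carrying the CHART∞ rows `ChartRows` and (v11.2) the joint rows `ChartRowsJ`, and every window quadrilateral `U V W Z` (corners differing on the bonds `b, b′`) there
are: ONE tube ⟨`e σ UZ UV jZ jV ρ`⟩ with `TubeRows` (px21's E3″ chart at a minimiser of the corner — the organ's choice), an open `I ⊇ [0,1]`, the two EDGES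
`x₀ : U → V`, `x₁ : W → Z` (both vary bond `b`) with minimiser coordinates `y₀, y₁` carrying `EdgeRows` (BRD in qualitative form: the minimiser over every
interpolated datum stays in the tube, continuously), and px19's product letters such that **(LOC)** `ProductRows` hold for THE NAMED
matrices `M_t := hessStd (A ∘ c.Φ(x_t ·, σ ·)) y_t` (the slice Hessians of the action through the chart along the edges — the matrices whose determinants
✓`detRepA_edge`'s (REP) row exhibits in the Laplace constants) with `B := C·θBal_J²`, `R := tdist_J(b.src, b′.src)`, and **(JAC)** the amplitude 4-point of THE NAMED
`jl_t s := log jV (y_t s) + log c.jac (x_t s, σ (y_t s))` is `≤ C·θBal_J²·e^{−(θ−θ₂)·R}`.  CONTENT = print's background-response decay [Balaban1985Variational] Thm 1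
(9)-(10) for the `(K−J)`-fold constrained minimiser + the coarse-unit decay of the inverse fluctuation operator [Balaban1984PropagatorsII] (1.33) + the locality of the
Haar∕chart Jacobians — NOT in the tree.  REGRESSION (RULING W3): no operator, index type or amplitude is a binder — `M_t`, `jl_t`, `Fin dV` are TERMS of the chart, the
tube and the paths; px19 g10's degenerate witness `ι := Unit, M := 1, jl := log ℓ` of v10's DET-REP cannot be written.  Why it might fail: a long-range term in
the minimiser's response at depth (the single-step averaging kernels are only power-law localised) — then `hE`∕`hD` fail at the stated rate; cheapest falsifier: the
response profile of the depth-1, `L = 2` minimiser to a one-bond change of the datum (linear algebra on the linearisation at `U ≡ 1`).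
[cite: Balaban1985Variational, Thm 1 (8)-(10) p.279 and (142) p.299; Balaban1984PropagatorsII, (1.33); GlimmJaffe1987, §18.2] -/
def DetRepB : Prop :=
  ∀ (L : ℕ), ∃ c₀ : ℝ, 0 < c₀ ∧ c₀ ≤ 1 ∧ ∀ (cw : ℝ), 0 < cw → cw ≤ c₀ → ∃ pS : ℝ, ∀ (b₀ p₀ : ℝ), 0 < b₀ → pS ≤ p₀ → 0 < p₀ → ∃ ε₁ : ℝ, 0 < ε₁ ∧ ∀ (ε₀ : ℝ), 0 < ε₀ → ε₀ ≤ ε₁ →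
    ∃ γ₁ : ℝ, 0 < γ₁ ∧ ∃ Cst θ θ₂ : ℝ, 0 ≤ Cst ∧ 0 ≤ θ₂ ∧ θ₂ < θ ∧ ∀ (F : T3Family) (γ : ℝ), F.L = L → 0 < γ → γ ≤ γ₁ →
      ∀ (J K : ℕ) (hJK : J ≤ K)
        (c : Summit.QuantumFields.YangMills.Theorems.FluctuationComparisonRegPrIntLWregGlue.WindowChart F hJK (histGood F ℰp (θBal F.L γ b₀ p₀) K J) {V : GaugeField (F.P J) 0 (Matrix.specialUnitaryGroup (Fin 2) ℂ) | PlaqSmall (θBal F.L γ b₀ p₀ J) V}),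
        ChartRows F γ b₀ p₀ hJK c → ChartRowsJ F γ b₀ p₀ hJK c →
        ∀ (b b' : PBond (F.P J) 0) (U V W Z : GaugeField (F.P J) 0 (Matrix.specialUnitaryGroup (Fin 2) ℂ)),
          PlaqSmall (θBal F.L γ (cw * b₀) p₀ J) U → PlaqSmall (θBal F.L γ (cw * b₀) p₀ J) V →
          PlaqSmall (θBal F.L γ (cw * b₀) p₀ J) W → PlaqSmall (θBal F.L γ (cw * b₀) p₀ J) Z →
          (∀ e, e ≠ b → U e = V e) → (∀ e, e ≠ b' → U e = W e) → (∀ e, e ≠ b' → V e = Z e) → (∀ e, e ≠ b → W e = Z e) →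
          ∃ (dZ dV : ℕ)
            (e : EuclideanSpace ℝ (Fin dZ) → ↥(Summit.QuantumFields.YangMills.Theorems.FluctuationComparisonRegPrIntLS2BetaResidualSubgroup.residualSubgroup F hJK) × (PBond (F.P K) (K - J) → Matrix.specialUnitaryGroup (Fin 2) ℂ))
            (σ : EuclideanSpace ℝ (Fin dV) → GaugeField (F.P K) 0 (Matrix.specialUnitaryGroup (Fin 2) ℂ))
            (UZ : Set (EuclideanSpace ℝ (Fin dZ))) (UV : Set (EuclideanSpace ℝ (Fin dV)))
            (jZ : EuclideanSpace ℝ (Fin dZ) → ℝ) (jV : EuclideanSpace ℝ (Fin dV) → ℝ) (ρ : ℝ)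
            (I : Set ℝ) (x₀ x₁ : ℝ → GaugeField (F.P J) 0 (Matrix.specialUnitaryGroup (Fin 2) ℂ)) (y₀ y₁ : ℝ → EuclideanSpace ℝ (Fin dV)),
            TubeRows F hJK dZ dV e σ UZ UV jZ jV ρ ∧ IsOpen I ∧ ((0 : ℝ) ∈ I ∧ (1 : ℝ) ∈ I) ∧
            EdgeRows F γ b₀ p₀ ε₀ hJK c σ UV jV cw I b U V x₀ y₀ ∧
            EdgeRows F γ b₀ p₀ ε₀ hJK c σ UV jV cw I b W Z x₁ y₁ ∧
            |(Real.log (hessStd (fun q : ℝ × EuclideanSpace ℝ (Fin dV) => wilsonAction4 (c.Φ (x₀ q.1, σ q.2))) y₀ 0).det - 2 * Real.log (jV (y₀ 0)))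
                - (Real.log (hessStd (fun q : ℝ × EuclideanSpace ℝ (Fin dV) => wilsonAction4 (c.Φ (x₀ q.1, σ q.2))) y₀ 1).det - 2 * Real.log (jV (y₀ 1)))
                - ((Real.log (hessStd (fun q : ℝ × EuclideanSpace ℝ (Fin dV) => wilsonAction4 (c.Φ (x₁ q.1, σ q.2))) y₁ 0).det - 2 * Real.log (jV (y₁ 0)))
                  - (Real.log (hessStd (fun q : ℝ × EuclideanSpace ℝ (Fin dV) => wilsonAction4 (c.Φ (x₁ q.1, σ q.2))) y₁ 1).det - 2 * Real.log (jV (y₁ 1))))|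
              ≤ 2 * Cst * θBal F.L γ b₀ p₀ J ^ 2 * Real.exp (-((θ - θ₂) * (b.src.tdist b'.src : ℝ))) ∧
            |Real.log (c.jac (x₀ 0, σ (y₀ 0))) - Real.log (c.jac (x₀ 1, σ (y₀ 1)))
                - (Real.log (c.jac (x₁ 0, σ (y₁ 0))) - Real.log (c.jac (x₁ 1, σ (y₁ 1))))|
              ≤ Cst * θBal F.L γ b₀ p₀ J ^ 2 * Real.exp (-((θ - θ₂) * (b.src.tdist b'.src : ℝ)))

/-- **FOUR LIMITS, TWO EXPONENTS ⇒ EQUAL 4-POINTS OF THE LOGS**: if at four corners `λ^{d∕2}·G_x → ℓ_x > 0` and `λ^{d′∕2}·G_x → e^{E_x}` then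
`Δ² log ℓ = Δ² E` — `λ^{(d−d′)∕2} → ℓ_x ∕ e^{E_x}` at every corner (✓`…S2BetaDecayRates.tendsto_rpow_sub_of_two_limits`), limits are unique, so `log ℓ_x − E_x` is
corner-independent (this kills FOUR-POINT-DECAY's free exponent `d` and free `ℓ`). [cite: Balaban1985Variational, Thm 1 (8)-(10) p.279] -/
theorem fourPt_log_eq_of_limits₄ {GU GV GW GZ : ℝ → ℝ} {d d' ℓU ℓV ℓW ℓZ EU EV EW EZ : ℝ}
    (hU : 0 < ℓU) (hV : 0 < ℓV) (hW : 0 < ℓW) (hZ : 0 < ℓZ)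
    (tU : Tendsto (fun lam : ℝ => lam ^ (d / 2) * GU lam) atTop (𝓝 ℓU)) (rU : Tendsto (fun lam : ℝ => lam ^ (d' / 2) * GU lam) atTop (𝓝 (Real.exp EU)))
    (tV : Tendsto (fun lam : ℝ => lam ^ (d / 2) * GV lam) atTop (𝓝 ℓV)) (rV : Tendsto (fun lam : ℝ => lam ^ (d' / 2) * GV lam) atTop (𝓝 (Real.exp EV)))
    (tW : Tendsto (fun lam : ℝ => lam ^ (d / 2) * GW lam) atTop (𝓝 ℓW)) (rW : Tendsto (fun lam : ℝ => lam ^ (d' / 2) * GW lam) atTop (𝓝 (Real.exp EW)))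
    (tZ : Tendsto (fun lam : ℝ => lam ^ (d / 2) * GZ lam) atTop (𝓝 ℓZ)) (rZ : Tendsto (fun lam : ℝ => lam ^ (d' / 2) * GZ lam) atTop (𝓝 (Real.exp EZ))) :
    (Real.log ℓU - Real.log ℓV) - (Real.log ℓW - Real.log ℓZ) = (EU - EV) - (EW - EZ) := by
  have q : ∀ {G : ℝ → ℝ} {ℓ E : ℝ}, Tendsto (fun lam : ℝ => lam ^ (d / 2) * G lam) atTop (𝓝 ℓ) →
      Tendsto (fun lam : ℝ => lam ^ (d' / 2) * G lam) atTop (𝓝 (Real.exp E)) →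
      Tendsto (fun lam : ℝ => lam ^ ((d - d') / 2)) atTop (𝓝 (ℓ / Real.exp E)) := fun t r =>
    Summit.QuantumFields.YangMills.Theorems.FluctuationComparisonRegPrIntLS2BetaDecayRates.tendsto_rpow_sub_of_two_limits t r (Real.exp_pos _)
  have lg : ∀ {ℓ E ℓ' E' : ℝ}, 0 < ℓ → 0 < ℓ' → ℓ / Real.exp E = ℓ' / Real.exp E' → Real.log ℓ - E = Real.log ℓ' - E' := by
    intro ℓ E ℓ' E' hℓ hℓ' h
    have h' := congrArg Real.log h
    rw [Real.log_div hℓ.ne' (Real.exp_pos _).ne', Real.log_div hℓ'.ne' (Real.exp_pos _).ne', Real.log_exp, Real.log_exp] at h'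
    exact h'
  have eUV := lg hU hV (tendsto_nhds_unique (q tU rU) (q tV rV))
  have eUW := lg hU hW (tendsto_nhds_unique (q tU rU) (q tW rW))
  have eUZ := lg hU hZ (tendsto_nhds_unique (q tU rU) (q tZ rZ))
  linarith

/-- **DET-REP-A FOR ONE EDGE, DOCKED (PROVED; v11.2)**: GAP♯ at the level (orbit-distance growth at every window datum) + the CHART∞ rows `ChartRows` and the joint rows
`ChartRowsJ` of the window chart + the chain regime of (C2′)∕(C2″) + `TubeRows` + `EdgeRows` ⟹ w5-20520 g14's per-point edition ✓`…S2BetaDetRepAEdgePointwise.detRepA_edge'`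
applies along the edge, with ALL its undisplayed binders discharged BY NAME: the residual group of record (`residualSubgroup`, `pivotAct`, Haar), the nine chart rows at every
`x s`, the sheet set `Sst :=` central sheets × `{1}` (✓`…S2BetaPivotStabiliser.pivotAct_eq_self_iff_central`), the positivity of `ν((e''ball ρ)·Sst)⁻¹`, the openness of
the tube at `(0, y s)` ((F3)), the fibrewise local carrier and `0 < c.jac` (from the joint carrier row), GAP♯'s strictness off the orbit of `σ (y s)`
(✓`…S2BetaFibreTransportCharted.limitInst_gap_rows_of_windowChart_charted`), the transversal GROWTH at `y s` (GAP♯ ∘ (T2-ALL) ∘ ✓`…S2BetaGrowthShift.growth_at_tubePoint`),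
and the joint `C³`-smoothness of `(s, y) ↦ A(c.Φ(x s, σ y))` at `(s, y s)` (w5's ✓(C2″-WITHIN) `…PeanoSmoothParam.contDiffAt_wilsonAction4_windowChart_param_within` over the
path's smoothness, the tube's `C^∞` matrix field, the pivot-blind clauses and w3-20520 g16's joint continuity within the live graph).  Output: an EDGE constant `c₀` with
**(REP)** for THE NAMED `M := hessStd (A∘c.Φ(x ·, σ ·)) y`, `jl s := log jV (y s) + log c.jac (x s, σ (y s))`, and **(DET)** `M`'s entries `C¹` on `I` with `0 < det M`.
[cite: Balaban1985Variational, Thm 1 (8)-(10) p.279 and (142) p.299; Breitung1994, Thm 41 p.56; Dieudonne1960, Ch. X §2 (10.2.1)-(10.2.3); Balaban1987RG1, (0.4) p.253] -/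
theorem edge_rep_det (F : T3Family) {γ : ℝ} (hγ : 0 < γ) (b₀ p₀ ε₀ : ℝ) {J K : ℕ} (hJK : J ≤ K) {μ : ℝ} (hμ : 0 < μ) {cw : ℝ} (hcw1 : cw ≤ 1)
    (hG : ∀ (V : GaugeField (F.P J) 0 (Matrix.specialUnitaryGroup (Fin 2) ℂ)), PlaqSmall (θBal F.L γ (cw * b₀) p₀ J) V →
        ∀ U₀ ∈ argminHist F γ b₀ p₀ ε₀ hJK V, ∀ U ∈ fibre F ℰp J K hJK V, U ∈ histGood F ℰp (θBal F.L γ b₀ p₀) K J →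
          μ * ((F.L : ℝ)⁻¹) ^ (2 * (K - J)) *
              (⨅ w : ResidualGauge F hJK, ∑ ℓ : PBond (F.P K) 0,
                dist1 (U ℓ * ((GaugeField.gaugeAct (w : GaugeTransf (F.P K) 0 (Matrix.specialUnitaryGroup (Fin 2) ℂ)) U₀) ℓ)⁻¹) ^ 2)
            ≤ wilsonAction4 U - minActionRegPr F J K hJK ε₀ V)
    {α : ℝ} (hα24 : α ≤ 1 / 24) (hαδ : α < Literature.MathematicalPhysics.QuantumFieldTheory.Balaban1983to89.ExpMeanLog.deltaSU (Fin 2)) (hαL : 157 * α < ((((F.P K).L : ℕ) : ℝ) ^ ((F.P K).d - 1))⁻¹)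
    (hθ0 : ∀ i, 0 ≤ θBal F.L γ b₀ p₀ i) (hθα : ∀ i, ((((F.P K).d + 2) * (F.P K).L : ℕ) : ℝ) ^ 2 / 4 * θBal F.L γ b₀ p₀ i ≤ α)
    {c : Summit.QuantumFields.YangMills.Theorems.FluctuationComparisonRegPrIntLWregGlue.WindowChart F hJK (histGood F ℰp (θBal F.L γ b₀ p₀) K J)
      {V : GaugeField (F.P J) 0 (Matrix.specialUnitaryGroup (Fin 2) ℂ) | PlaqSmall (θBal F.L γ b₀ p₀ J) V}}
    (hCR : ChartRows F γ b₀ p₀ hJK c) (hCJ : ChartRowsJ F γ b₀ p₀ hJK c)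
    {dZ dV : ℕ}
    {e : EuclideanSpace ℝ (Fin dZ) → ↥(Summit.QuantumFields.YangMills.Theorems.FluctuationComparisonRegPrIntLS2BetaResidualSubgroup.residualSubgroup F hJK) × (PBond (F.P K) (K - J) → Matrix.specialUnitaryGroup (Fin 2) ℂ)}
    {σ : EuclideanSpace ℝ (Fin dV) → GaugeField (F.P K) 0 (Matrix.specialUnitaryGroup (Fin 2) ℂ)}
    {UZ : Set (EuclideanSpace ℝ (Fin dZ))} {UV : Set (EuclideanSpace ℝ (Fin dV))}
    {jZ : EuclideanSpace ℝ (Fin dZ) → ℝ} {jV : EuclideanSpace ℝ (Fin dV) → ℝ} {ρ : ℝ}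
    (hT : TubeRows F hJK dZ dV e σ UZ UV jZ jV ρ)
    {I : Set ℝ} (hIo : IsOpen I) {bnd : PBond (F.P J) 0} {A B : GaugeField (F.P J) 0 (Matrix.specialUnitaryGroup (Fin 2) ℂ)}
    {x : ℝ → GaugeField (F.P J) 0 (Matrix.specialUnitaryGroup (Fin 2) ℂ)} {y : ℝ → EuclideanSpace ℝ (Fin dV)}
    (hE : EdgeRows F γ b₀ p₀ ε₀ hJK c σ UV jV cw I bnd A B x y) :
    ∃ c₀ : ℝ,
      (∀ s ∈ I, Tendsto (fun lam : ℝ => lam ^ ((dV : ℝ) / 2) *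
          (heightDensityCan F (γ / lam) hJK (histGood F ℰp (θBal F.L γ b₀ p₀) K J) (x s) *
            Real.exp (lam * (F.scheme ℰp γ).β K * minActionRegPr F J K hJK ε₀ (x s)))) atTop
        (𝓝 (Real.exp (c₀ + (Real.log (jV (y s)) + Real.log (c.jac (x s, σ (y s)) : ℝ)) -
          (1 / 2) * Real.log (hessStd (fun q : ℝ × EuclideanSpace ℝ (Fin dV) => wilsonAction4 (c.Φ (x q.1, σ q.2))) y s).det)))) ∧
      (∀ s ∈ I, ∀ i j, HasDerivAt (fun s' => hessStd (fun q : ℝ × EuclideanSpace ℝ (Fin dV) => wilsonAction4 (c.Φ (x q.1, σ q.2))) y s' i j)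
        (hessStd' (fun q : ℝ × EuclideanSpace ℝ (Fin dV) => wilsonAction4 (c.Φ (x q.1, σ q.2))) y s i j) s) ∧
      (∀ i j, ContinuousOn (fun s' => hessStd' (fun q : ℝ × EuclideanSpace ℝ (Fin dV) => wilsonAction4 (c.Φ (x q.1, σ q.2))) y s' i j) I) ∧
      (∀ s ∈ I, 0 < (hessStd (fun q : ℝ × EuclideanSpace ℝ (Fin dV) => wilsonAction4 (c.Φ (x q.1, σ q.2))) y s).det) := by
  classical
  obtain ⟨he, he1, he𝓝, hσ, hσs, hUZo, hUVo, h0Z, hT2all, hinj, hF3, hjZc, hjVc, hjZ0, hjV0, hchart, hρ, hρUZ, hjZint⟩ := hT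
  obtain ⟨-, -, hrows⟩ := hE
  obtain ⟨hΦbl, hjbl, hjoint⟩ := hCJ
  have hk : K - J ≤ (F.P K).m + (F.P K).K := by
    show K - J ≤ F.m + K
    omega
  have hLpos : (0 : ℝ) < F.L := Nat.cast_pos.2 (by have := F.hL.2; omega)
  have hμ' : 0 < μ * ((F.L : ℝ)⁻¹) ^ (2 * (K - J)) := mul_pos hμ (pow_pos (inv_pos.2 hLpos) _)
  haveI := Summit.QuantumFields.YangMills.Theorems.FluctuationComparisonRegPrIntLS2BetaResidualSubgroup.compactSpace_residualSubgroup F hJK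
  haveI hGc : CompactSpace (↥(Summit.QuantumFields.YangMills.Theorems.FluctuationComparisonRegPrIntLS2BetaResidualSubgroup.residualSubgroup F hJK) ×
      (PBond (F.P K) (K - J) → Matrix.specialUnitaryGroup (Fin 2) ℂ)) :=
    Summit.QuantumFields.YangMills.Theorems.FluctuationComparisonRegPrIntLS2BetaResidualSubgroup.compactSpace_residualSubgroup_prod F hJK
  -- the sheet set of record: central sheets × {1}
  set Sst : Set (↥(Summit.QuantumFields.YangMills.Theorems.FluctuationComparisonRegPrIntLS2BetaResidualSubgroup.residualSubgroup F hJK) ×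
      (PBond (F.P K) (K - J) → Matrix.specialUnitaryGroup (Fin 2) ℂ)) :=
    {k | k.2 = 1 ∧ ∃ c₀ : Matrix.specialUnitaryGroup (Fin 2) ℂ, (∀ g : Matrix.specialUnitaryGroup (Fin 2) ℂ, c₀ * g = g * c₀) ∧
      (k.1 : Site (F.P K) 0 → Matrix.specialUnitaryGroup (Fin 2) ℂ) = fun _ => c₀} with hSst
  have hfix : ∀ s' ∈ Sst, ∀ y', Summit.QuantumFields.YangMills.Theorems.FluctuationComparisonRegPrIntLS2BetaResidualSubgroup.pivotAct F hJK
      (Summit.QuantumFields.YangMills.Theorems.FluctuationComparisonRegPrIntLWregChain.iterCentralBond (P := F.P K) (K - J)) s' (σ y') = σ y' :=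
    fun s' hs' y' => (Summit.QuantumFields.YangMills.Theorems.FluctuationComparisonRegPrIntLS2BetaPivotStabiliser.pivotAct_eq_self_iff_central F hJK hk s' (σ y')).2 hs'
  -- positivity of the orbit-sheet Haar volume: the set is a neighbourhood of `1` in a compact group
  have h1S : (1 : ↥(Summit.QuantumFields.YangMills.Theorems.FluctuationComparisonRegPrIntLS2BetaResidualSubgroup.residualSubgroup F hJK) ×
      (PBond (F.P K) (K - J) → Matrix.specialUnitaryGroup (Fin 2) ℂ)) ∈ Sst :=
    ⟨rfl, 1, fun g => by rw [one_mul, mul_one], rfl⟩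
  have hνS : 0 < ((MeasureTheory.Measure.haar :
      Measure (↥(Summit.QuantumFields.YangMills.Theorems.FluctuationComparisonRegPrIntLS2BetaResidualSubgroup.residualSubgroup F hJK) ×
        (PBond (F.P K) (K - J) → Matrix.specialUnitaryGroup (Fin 2) ℂ)))
      (((e '' Metric.ball (0 : EuclideanSpace ℝ (Fin dZ)) ρ) * Sst)⁻¹)).toReal := by
    have hn : e '' Metric.ball (0 : EuclideanSpace ℝ (Fin dZ)) ρ ∈
        𝓝 (1 : ↥(Summit.QuantumFields.YangMills.Theorems.FluctuationComparisonRegPrIntLS2BetaResidualSubgroup.residualSubgroup F hJK) ×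
          (PBond (F.P K) (K - J) → Matrix.specialUnitaryGroup (Fin 2) ℂ)) :=
      he𝓝 (image_mem_map (Metric.ball_mem_nhds _ hρ))
    have hsub : e '' Metric.ball (0 : EuclideanSpace ℝ (Fin dZ)) ρ ⊆ (e '' Metric.ball (0 : EuclideanSpace ℝ (Fin dZ)) ρ) * Sst :=
      fun k hk' => Set.mem_mul.2 ⟨k, hk', 1, h1S, mul_one k⟩
    have hn' := inv_mem_nhds_one (hS := Filter.mem_of_superset hn hsub)
    exact ENNReal.toReal_pos (MeasureTheory.Measure.measure_pos_of_mem_nhds _ hn').ne' (measure_ne_top _ _)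
  have key := fun s (hs : s ∈ I) => hrows s hs
  -- the fibrewise local carrier at `y s` from the joint carrier row
  have hσX : ∀ s ∈ I, ∀ᶠ v in 𝓝 (y s), σ v ∈ {z : GaugeField (F.P K) 0 (Matrix.specialUnitaryGroup (Fin 2) ℂ) | c.jac (x s, z) ≠ 0} := by
    intro s hs
    have h := (key s hs).2.2.2.2.2.2.1
    rw [nhds_prod_eq] at h
    exact h.curry.self_of_nhds
  -- the chart value of the tube point is the minimiser over the moved datum: self-charted, live
  have hU₁ : ∀ s ∈ I, c.jac (x s, c.Φ (x s, σ (y s))) ≠ 0 ∧ c.Φ (x s, c.Φ (x s, σ (y s))) = c.Φ (x s, σ (y s)) := fun s hs =>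
    ((hCR (x s)).2.2.2.2.2.2.2.2.2.2.2.2 _ ((hCR (x s)).2.2.2.2.2.2.2.2.2.2.2.1 _ (hσX s hs).self_of_nhds) (key s hs).2.2.2.2.2.2.2.1).1
  -- the growth function rows at every path point (GAP♯ at the moved datum, read at the shifted tube point)
  have G7 := fun s (hs : s ∈ I) =>
    Summit.QuantumFields.YangMills.Theorems.FluctuationComparisonRegPrIntLS2BetaFibreTransportCharted.limitInst_gap_rows_of_windowChart_charted F hJK c hμ'
      (hCR (x s)).2.2.2.2.2.2.2.2.2.2.1 (hCR (x s)).2.2.2.2.2.2.2.2.2.2.2.1 (hCR (x s)).2.2.2.2.2.1 (hσX s hs).self_of_nhds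
      (key s hs).2.2.2.2.2.2.2.1 (key s hs).2.2.2.2.2.2.2.2.1
      (fun U hU hUS => hG (x s) (key s hs).1 _ ⟨(hCR (x s)).2.2.2.2.2.2.2.2.2.2.2.1 _ (hσX s hs).self_of_nhds, (key s hs).2.2.2.2.2.2.2.1,
        (key s hs).2.2.2.2.2.2.2.2.1⟩ U hU hUS)
  -- the transversal growth at every path point: GAP♯ ∘ (T2-ALL) ∘ ✓`growth_at_tubePoint`
  have hgrowT : ∀ s ∈ I, ∃ c₁ : ℝ, 0 < c₁ ∧ ∀ᶠ v in 𝓝 (0 : EuclideanSpace ℝ (Fin dV)),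
      c₁ * ‖v‖ ^ 2 ≤ wilsonAction4 (c.Φ (x s, σ (y s + v))) - wilsonAction4 (c.Φ (x s, σ (y s))) := by
    intro s hs
    obtain ⟨c₂, hc₂, hT2⟩ := hT2all (y s) (key s hs).2.2.2.2.1
    exact ⟨μ * ((F.L : ℝ)⁻¹) ^ (2 * (K - J)) * c₂, mul_pos hμ' hc₂,
      Summit.QuantumFields.YangMills.Theorems.FluctuationComparisonRegPrIntLS2BetaGrowthShift.growth_at_tubePoint F hJK c.Φ hμ'
        (hCR (x s)).2.2.2.2.2.2.2.2.2.2.1 (hCR (x s)).2.2.2.2.2.2.2.2.2.2.2.1 (hCR (x s)).2.2.2.2.2.2.2.2.1 hσ (hσX s hs)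
        (key s hs).2.2.2.2.2.2.2.1 (key s hs).2.2.2.2.2.2.2.2.1
        (fun U hU hUS => hG (x s) (key s hs).1 _ ⟨(hCR (x s)).2.2.2.2.2.2.2.2.2.2.2.1 _ (hσX s hs).self_of_nhds, (key s hs).2.2.2.2.2.2.2.1,
          (key s hs).2.2.2.2.2.2.2.2.1⟩ U hU hUS) hT2⟩
  -- the joint C³-smoothness at every path point: ✓(C2″-WITHIN) over the path, the tube, the pivot-blind clauses and joint continuity within the live graph
  have hf3 : ∀ s ∈ I, ContDiffAt ℝ 3 (fun q : ℝ × EuclideanSpace ℝ (Fin dV) => wilsonAction4 (c.Φ (x q.1, σ q.2))) (s, y s) := fun s hs =>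
    Summit.QuantumFields.YangMills.Theorems.FluctuationComparisonRegPrIntLS2BetaPeanoSmoothParam.contDiffAt_wilsonAction4_windowChart_param_within F hJK hk hα24 hαδ hαL
      hθ0 hθα c x s (key s hs).2.2.1 (key s hs).2.2.2.1 σ hσ hσs (y s)
      (fun V z hz => (hCR V).2.2.2.2.2.2.2.2.2.2.2.1 z hz) (fun V z hz => (hCR V).2.2.2.2.2.2.2.2.2.2.1 z hz) hΦbl hjbl
      rfl (key s hs).2.2.2.2.2.2.2.1 (hU₁ s hs).2 (key s hs).2.2.2.2.2.2.1.self_of_nhds (key s hs).2.2.2.2.2.2.1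
      (hjoint _ (hU₁ s hs).1) 3
  have H := Summit.QuantumFields.YangMills.Theorems.FluctuationComparisonRegPrIntLS2BetaDetRepAEdgePointwise.detRepA_edge' F hγ hJK
    (measurableSet_histGood F ℰp measurableE_ℰp _ K J)
    (Summit.QuantumFields.YangMills.Theorems.FluctuationComparisonRegPrIntLWregAssembly.isOpen_setOf_plaqSmall₂ (F.P J) 0 _) c
    (minActionRegPr F J K hJK ε₀)
    (Summit.QuantumFields.YangMills.Theorems.FluctuationComparisonRegPrIntLS2BetaResidualSubgroup.residualSubgroup F hJK)
    (Summit.QuantumFields.YangMills.Theorems.FluctuationComparisonRegPrIntLS2BetaResidualSubgroup.compactSpace_residualSubgroup F hJK) MeasureTheory.Measure.haar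
    (Summit.QuantumFields.YangMills.Theorems.FluctuationComparisonRegPrIntLS2BetaResidualSubgroup.pivotAct F hJK (Summit.QuantumFields.YangMills.Theorems.FluctuationComparisonRegPrIntLWregChain.iterCentralBond (P := F.P K) (K - J)))
    (Summit.QuantumFields.YangMills.Theorems.FluctuationComparisonRegPrIntLS2BetaResidualSubgroup.continuous_pivotAct F hJK _)
    (Summit.QuantumFields.YangMills.Theorems.FluctuationComparisonRegPrIntLS2BetaResidualSubgroup.pivotAct_mul F hJK _ (Summit.QuantumFields.YangMills.Theorems.FluctuationComparisonRegPrIntLWregChain.iterCentralBond_injective (P := F.P K) hk))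
    (Summit.QuantumFields.YangMills.Theorems.FluctuationComparisonRegPrIntLS2BetaResidualSubgroup.pivotAct_one F hJK _)
    (Summit.QuantumFields.YangMills.Theorems.FluctuationComparisonRegPrIntLS2BetaResidualSubgroup.measurePreserving_pivotAct F hJK _)
    hIo x (fun s hs => T3PrintedMinimiserExistence.plaqSmall_of_le
      (by rw [T3InteriorExcision.θBal_mul]; exact mul_le_of_le_one_left (hθ0 J) hcw1) (key s hs).1)
    (fun s => {z : GaugeField (F.P K) 0 (Matrix.specialUnitaryGroup (Fin 2) ℂ) | c.jac (x s, z) ≠ 0})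
    (fun s _ => (hCR (x s)).1) (fun s _ => (hCR (x s)).2.1) (fun s _ => (hCR (x s)).2.2.1) (fun s _ => (hCR (x s)).2.2.2.1)
    (fun s _ => (hCR (x s)).2.2.2.2.1) (fun s _ => (hCR (x s)).2.2.2.2.2.2.1) (fun s _ => (hCR (x s)).2.2.2.2.2.2.2.1)
    (fun s _ => (hCR (x s)).2.2.2.2.2.2.2.2.1) (fun s _ => (hCR (x s)).2.2.2.2.2.2.2.2.2.1)
    e σ he he1 he𝓝 hσ hUZo hUVo hinj hjZc hjVc hjZ0 hjV0 hchart hρ hρUZ hjZint hfix hνS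
    y (fun s hs => (key s hs).2.2.2.2.1) (fun s hs => (key s hs).2.2.2.2.2.1)
    (fun s hs => by
      -- (F3) at `(0, y s)`: the tube map is open there and reads `σ (y s)`
      have h1 : (fun p : EuclideanSpace ℝ (Fin dZ) × EuclideanSpace ℝ (Fin dV) =>
          Summit.QuantumFields.YangMills.Theorems.FluctuationComparisonRegPrIntLS2BetaResidualSubgroup.pivotAct F hJK
            (Summit.QuantumFields.YangMills.Theorems.FluctuationComparisonRegPrIntLWregChain.iterCentralBond (P := F.P K) (K - J)) (e p.1) (σ p.2)) (0, y s) = σ (y s) := by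
        simp only [he1]
        exact Summit.QuantumFields.YangMills.Theorems.FluctuationComparisonRegPrIntLS2BetaResidualSubgroup.pivotAct_one F hJK _ _
      rw [← h1]
      exact Filter.le_map fun s' hs' => hF3 (0, y s) ⟨h0Z, (key s hs).2.2.2.2.1⟩ s' hs')
    hσX
    (fun s _ k hk' => (Summit.QuantumFields.YangMills.Theorems.FluctuationComparisonRegPrIntLS2BetaPivotStabiliser.pivotAct_eq_self_iff_central F hJK hk k (σ (y s))).1 hk')
    (fun s hs => (key s hs).2.2.2.2.2.2.2.1) (fun s hs => (key s hs).2.2.2.2.2.2.2.2.1)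
    (fun s hs => NNReal.coe_pos.2 (pos_iff_ne_zero.2 (hσX s hs).self_of_nhds))
    (fun s z => μ * ((F.L : ℝ)⁻¹) ^ (2 * (K - J)) *
      ⨅ w : {w : Site (F.P K) 0 → Matrix.specialUnitaryGroup (Fin 2) ℂ |
          ∀ U : GaugeField (F.P K) 0 (Matrix.specialUnitaryGroup (Fin 2) ℂ), descendTo F ℰp J K hJK (GaugeField.gaugeAct w U) = descendTo F ℰp J K hJK U},
        ∑ ℓ : PBond (F.P K) 0, dist1 (c.Φ (x s, z) ℓ * ((GaugeField.gaugeAct (w : Site (F.P K) 0 → Matrix.specialUnitaryGroup (Fin 2) ℂ) (c.Φ (x s, σ (y s)))) ℓ)⁻¹) ^ 2)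
    (fun s hs => (G7 s hs).2.2.2.1) (fun s hs => (G7 s hs).2.2.2.2.1) (fun s hs => (G7 s hs).2.2.2.2.2.1) (fun s hs => (G7 s hs).2.2.2.2.2.2)
    hgrowT (fun s hs => (key s hs).2.2.2.2.2.2.2.2.2) hf3
  obtain ⟨hREP, -, hDer, hDerC, -, hdet⟩ := H
  refine ⟨_, fun s hs => hREP s hs, fun s hs i j => hDer s hs i j, fun i j => hDerC i j, fun s hs => hdet s hs⟩

/-- **FOUR-POINT-DECAY FROM GAP♯ AND DET-REP-B (PROVED, v11; v11.2: the window chart of record is taken from CHART∞ ✓`exists_laplaceRows₂` directly, with its joint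
rows, so CHART-SMOOTH is no longer a hypothesis)** — LINE-OWNER RULING (W3) (2): per window quadrilateral, the window chart `c` (its `ChartRows` + `ChartRowsJ`), DET-REP-B's tube, edges and letters; ✓`edge_rep_det` (= w5-20520 g14's ✓`detRepA_edge` with every undisplayed binder
discharged by name, GAP♯ consumed at every interpolated datum) on both edges gives the four corner limits in the form `exp (c₀ᵗ + jl − ½ log det M)` with ONE
constant per edge; ✓`fourPt_log_eq_of_limits₄` identifies FOUR-POINT-DECAY's free limit values `ℓ` (any exponent `d`) with them, the edge constants cancel inside
`Δ²`, and `|Δ² log ℓ| ≤ |Δ² jl| + ½·|Δ² log det M| ≤ C·θ_J²·e^{−(θ−θ₂)R} + ½·2·C·θ_J²·e^{−(θ−θ₂)R}` by (JAC) and ✓`Literature.Analysis.Matrix.abs_fourPt_log_det_le_of_productRows_of_subset`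
(px19 g10 ∕ px7 g9's rectangle) on (LOC) with the (DET) rows; `κ := θ − θ₂`, `φ₁ J := 2·C·θBal_J²`, `J·φ₁ J → 0` by ✓`…S2BetaDecayRates.tendsto_mul_θBal_sq`.
[cite: Balaban1985Variational, Thm 1 (8)-(10) p.279; Balaban1984PropagatorsII, (1.33); GlimmJaffe1987, §18.2] -/
theorem fourPtDecay_of_detRep (hG : UniformFibreGapOrbit) (hB : DetRepB) : FourPtDecay := by
  intro L
  obtain ⟨cG, hcG, hcG1, HG⟩ := hG L
  obtain ⟨cB, hcB, -, HB⟩ := hB L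
  refine ⟨min cG cB, lt_min hcG hcB, (min_le_left _ _).trans hcG1, fun cw hcw hcwle => ?_⟩
  have hcw1 : cw ≤ 1 := hcwle.trans ((min_le_left _ _).trans hcG1)
  obtain ⟨pG, HG⟩ := HG cw hcw (hcwle.trans (min_le_left _ _))
  obtain ⟨pB, HB⟩ := HB cw hcw (hcwle.trans (min_le_right _ _))
  refine ⟨max pG pB, fun b₀ p₀ hb hp hp0 => ?_⟩
  obtain ⟨εG, hεG, HG1⟩ := HG b₀ p₀ hb ((le_max_left _ _).trans hp) hp0
  obtain ⟨εB, hεB, HB1⟩ := HB b₀ p₀ hb ((le_max_right _ _).trans hp) hp0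
  -- the window chart of record with its joint rows (CHART∞, w3-20520) and the chain regime of (C2′)∕(C2″) (w5-20520)
  obtain ⟨γC, hγC, HLR⟩ :=
    Summit.QuantumFields.YangMills.Theorems.FluctuationComparisonRegPrIntLS2BetaChartContLaplaceRowsJoint.exists_laplaceRows₂ L b₀ p₀ hb hp0
  obtain ⟨α, γR, _, hα24, hαδ, hγR, hreg⟩ :=
    Summit.QuantumFields.YangMills.Theorems.FluctuationComparisonRegPrIntLS2BetaPeanoSmooth.exists_gamma_chainRegime L b₀ p₀ hb hp0
  refine ⟨min εG εB, lt_min hεG hεB, fun ε₀ hε₀ hε₀le => ?_⟩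
  obtain ⟨γG, hγG, μ, hμ, HG2⟩ := HG1 ε₀ hε₀ (hε₀le.trans (min_le_left _ _))
  obtain ⟨γB, hγB, Cst, θ, θ₂, hCst, hθ₂, hθ₂θ, HB2⟩ := HB1 ε₀ hε₀ (hε₀le.trans (min_le_right _ _))
  refine ⟨min (min γG γC) (min (min γB γR) 1), lt_min (lt_min hγG hγC) (lt_min (lt_min hγB hγR) one_pos), θ - θ₂, sub_pos.2 hθ₂θ,
    fun F γ hFL hγ hγle => ?_⟩
  have hγG' : γ ≤ γG := hγle.trans ((min_le_left _ _).trans (min_le_left _ _))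
  have hγC' : γ ≤ γC := hγle.trans ((min_le_left _ _).trans (min_le_right _ _))
  have hγB' : γ ≤ γB := hγle.trans ((min_le_right _ _).trans ((min_le_left _ _).trans (min_le_left _ _)))
  have hγR' : γ ≤ γR := hγle.trans ((min_le_right _ _).trans ((min_le_left _ _).trans (min_le_right _ _)))
  have hγ1 : γ ≤ 1 := hγle.trans ((min_le_right _ _).trans (min_le_right _ _))
  refine ⟨fun J => 2 * Cst * θBal F.L γ b₀ p₀ J ^ 2, fun J => by positivity,
    Summit.QuantumFields.YangMills.Theorems.FluctuationComparisonRegPrIntLS2BetaDecayRates.tendsto_mul_θBal_sq F hγ hγ1 hb hp0 (2 * Cst),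
    fun J K hJK d b b' U V W Z ℓ hU hV hW hZ h1 h2 h3 h4 hℓ => ?_⟩
  -- the chart of record with `ChartRows` + `ChartRowsJ` (projection as in ✓`…S2BetaChartSmooth.chartSmooth`), the regime, and DET-REP-B's package
  obtain ⟨c, T, w, hfib, hne, hcontOn, -, hjbl, hΦbl, hself, hcharted, -, -, hnhds, -, hjoint, hrows⟩ := HLR F γ hFL hγ hγC' J K hJK
  have hoffc : ∀ V z, c.jac (V, z) ≠ 0 → ∀ bb, (∀ c', Summit.QuantumFields.YangMills.Theorems.FluctuationComparisonRegPrIntLWregChain.iterCentralBond (P := F.P K) (K - J) c' ≠ bb) →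
      c.Φ (V, z) bb = z bb := fun V z hz => (hcharted V z ((hne V z).1 hz).1).1
  have hCR : ChartRows F γ b₀ p₀ hJK c := by
    intro V
    obtain ⟨hXc, hXinv, hvan, hA, ha, hAinv, hainv, hOrel, hOinv⟩ := hrows V
    exact ⟨hXc, hXinv, hvan, hA, ha, (hcontOn V).1, hAinv, hainv, hOrel, hOinv, fun z hz => hoffc V z hz, fun z hz => hfib V z hz,
      fun U hUV hU => ⟨hself V U hUV (subset_closure hU), hnhds V U hUV hU⟩⟩
  have hCJ : ChartRowsJ F γ b₀ p₀ hJK c := ⟨hΦbl, hjbl, hjoint.1⟩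
  obtain ⟨hαL, hθ0, hθα⟩ := hreg F γ hFL hγ hγR' K
  obtain ⟨dZ, dV, e, σ, UZ, UV, jZ, jV, ρ, I, x₀, x₁, y₀, y₁,
      hT, hIo, hIcc, hE₀, hE₁, hDETN, hJACW⟩ :=
    HB2 F γ hFL hγ hγB' J K hJK c hCR hCJ b b' U V W Z hU hV hW hZ h1 h2 h3 h4
  have hGd := HG2 F γ hFL hγ hγG' J K hJK
  -- DET-REP-A on both edges
  obtain ⟨c₀₀, hR₀, -, -, -⟩ := edge_rep_det F hγ b₀ p₀ ε₀ hJK hμ hcw1 hGd hα24 hαδ hαL hθ0 hθα hCR hCJ hT hIo hE₀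
  obtain ⟨c₀₁, hR₁, -, -, -⟩ := edge_rep_det F hγ b₀ p₀ ε₀ hJK hμ hcw1 hGd hα24 hαδ hαL hθ0 hθα hCR hCJ hT hIo hE₁
  have h0I : (0 : ℝ) ∈ I := hIcc.1
  have h1I : (1 : ℝ) ∈ I := hIcc.2
  obtain ⟨hx₀0, hx₀1, -⟩ := hE₀
  obtain ⟨hx₁0, hx₁1, -⟩ := hE₁
  -- the four corner readings (exponent `dV`)
  have rU := hR₀ 0 h0I
  have rV := hR₀ 1 h1I
  have rW := hR₁ 0 h0I
  have rZ := hR₁ 1 h1I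
  rw [hx₀0] at rU
  rw [hx₀1] at rV
  rw [hx₁0] at rW
  rw [hx₁1] at rZ
  -- identify FOUR-POINT-DECAY's limit values with them
  have key := fourPt_log_eq_of_limits₄ (hℓ U (Or.inl rfl)).1 (hℓ V (Or.inr (Or.inl rfl))).1 (hℓ W (Or.inr (Or.inr (Or.inl rfl)))).1
    (hℓ Z (Or.inr (Or.inr (Or.inr rfl)))).1
    (hℓ U (Or.inl rfl)).2 rU (hℓ V (Or.inr (Or.inl rfl))).2 rV (hℓ W (Or.inr (Or.inr (Or.inl rfl)))).2 rW
    (hℓ Z (Or.inr (Or.inr (Or.inr rfl)))).2 rZ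
  show _ ≤ 2 * Cst * θBal F.L γ b₀ p₀ J ^ 2 * Real.exp (-((θ - θ₂) * (b.src.tdist b'.src : ℝ)))
  rw [key]
  -- assemble: edge constants cancel; split `E` along the INTRINSIC seam: JACW + ½·DETN (DET-REP-B‴, ★★OWNER WORD 77 (c))
  have hsplit : ∀ (a₀ a₁ j00 j01 j10 j11 l00 l01 l10 l11 : ℝ),
      (a₀ + j00 - (1 / 2) * l00 - (a₀ + j01 - (1 / 2) * l01)) - ((a₁ + j10 - (1 / 2) * l10) - (a₁ + j11 - (1 / 2) * l11)) =
        ((j00 - j01) - (j10 - j11)) - (1 / 2) * (l00 - l01 - (l10 - l11)) := fun _ _ _ _ _ _ _ _ _ _ => by ring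
  rw [hsplit]
  have hsplit2 : ∀ (jv00 ja00 jv01 ja01 jv10 ja10 jv11 ja11 l00 l01 l10 l11 : ℝ),
      ((jv00 + ja00) - (jv01 + ja01) - ((jv10 + ja10) - (jv11 + ja11))) - (1 / 2) * (l00 - l01 - (l10 - l11)) =
        (ja00 - ja01 - (ja10 - ja11)) - (1 / 2) * ((l00 - 2 * jv00) - (l01 - 2 * jv01) - ((l10 - 2 * jv10) - (l11 - 2 * jv11))) :=
    fun _ _ _ _ _ _ _ _ _ _ _ _ => by ring
  rw [hsplit2]
  rw [hx₀0, hx₀1, hx₁0, hx₁1] at hJACW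
  calc |_| ≤ |Real.log (c.jac (U, σ (y₀ 0))) - Real.log (c.jac (V, σ (y₀ 1)))
                - (Real.log (c.jac (W, σ (y₁ 0))) - Real.log (c.jac (Z, σ (y₁ 1))))|
            + |(1 / 2) * ((Real.log (hessStd (fun q : ℝ × EuclideanSpace ℝ (Fin dV) => wilsonAction4 (c.Φ (x₀ q.1, σ q.2))) y₀ 0).det - 2 * Real.log (jV (y₀ 0)))
                - (Real.log (hessStd (fun q : ℝ × EuclideanSpace ℝ (Fin dV) => wilsonAction4 (c.Φ (x₀ q.1, σ q.2))) y₀ 1).det - 2 * Real.log (jV (y₀ 1)))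
                - ((Real.log (hessStd (fun q : ℝ × EuclideanSpace ℝ (Fin dV) => wilsonAction4 (c.Φ (x₁ q.1, σ q.2))) y₁ 0).det - 2 * Real.log (jV (y₁ 0)))
                  - (Real.log (hessStd (fun q : ℝ × EuclideanSpace ℝ (Fin dV) => wilsonAction4 (c.Φ (x₁ q.1, σ q.2))) y₁ 1).det - 2 * Real.log (jV (y₁ 1)))))| := abs_sub _ _
    _ ≤ Cst * θBal F.L γ b₀ p₀ J ^ 2 * Real.exp (-((θ - θ₂) * (b.src.tdist b'.src : ℝ)))
          + (1 / 2) * (2 * Cst * θBal F.L γ b₀ p₀ J ^ 2 * Real.exp (-((θ - θ₂) * (b.src.tdist b'.src : ℝ)))) := by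
        refine add_le_add hJACW ?_
        rw [abs_mul, abs_of_pos (by norm_num : (0 : ℝ) < 1 / 2)]
        exact mul_le_mul_of_nonneg_left hDETN (by norm_num)
    _ = 2 * Cst * θBal F.L γ b₀ p₀ J ^ 2 * Real.exp (-((θ - θ₂) * (b.src.tdist b'.src : ℝ))) := by ring

end DetRep

/-! ## §5 Stubs and the S2β this file delivers -/

/-- EXW stub — organ G-K1aR-2 (LEAD's T8 + tube lemma), keyed there. [cite: Balaban1985Variational, Thm 1 (8) p.279] -/
theorem stub_windowExactness : WindowExactness := by
  sorry

/-- GAP♯ stub (v6; replaces the v5 GAP stub by LINE OWNER WORD 6 on the ORBIT flag of w4-20520 g15) — organ «uniform two-grid fibre stiffness, ORBIT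
form» (19200 / FibreConvexityTail / CoarseStiffnessTail for the transverse gap + the uniqueness half of CMP 102 Thm 1), keyed there; GAP stays a def.
[cite: Balaban1985Variational, Thm 1 (8)-(10) p.279 and (142) p.299] -/
theorem stub_uniformFibreGapOrbit : UniformFibreGapOrbit := by
  sorry

/-- WREG stub — NEW organ «window regularity of the small-field fibre density» (this seat; table = LINE g18-2 `Lines/wreg_chart.lean` — **CLOSED BY NAME** (F6 ✓p734433 `Summit.QuantumFields.YangMills.Theorems.FluctuationComparisonRegPrIntLWreg.windowRegularity`, the Theorems-side port
of `Lines/wreg_chart.lean` v20 @7e8eb395e5b4 `windowRegularity_of_stubs`; `Iff.rfl`-identical `WindowRegularity`)).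
[cite: Balaban1985Averaging, (10) p.19; Balaban1987RG1, (2.10) p.267] -/
theorem stub_windowRegularity : WindowRegularity := Summit.QuantumFields.YangMills.Theorems.FluctuationComparisonRegPrIntLWreg.windowRegularity

/-- **CHART-SMOOTH — CLOSED BY NAME (v9.1; v9 proved it in-file; was the v8 docking stub)** on w5-20520 g14's Theorems-side supplier
✓`Summit.QuantumFields.YangMills.Theorems.FluctuationComparisonRegPrIntLS2BetaChartSmooth.chartSmooth` (statement = this file's `ChartSmooth` body with `ChartRows`,
`ChartPackage`, `argminHist` inlined by script; δ-unfolding suffices — no `by`, no `unfold`), itself a one-screen projection from the landed suppliers CHART∞ V-c3∕V-e1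
(w3-20520 g14 `exists_laplaceRows`), (C3β″)+(T2) (px21 g9∕g10 `exists_tubularHaarChart_pivotAct_transversal`), RG-K (px11 g9 stabiliser rows; `Sst :=` central sheets
× `{1}`), (C2) (w5-20520 g14 `contDiffAt_wilsonAction4_windowChart_of_histGood` + `exists_gamma_chainRegime`, over px11 g10's (C2-b)) — all GAP♯-free.
[cite: Balaban1985Averaging, §E Prop 6 p.26-27; Balaban1985Variational, Thm 1 (8)-(10) p.279; Helgason2000, Ch. I §1 Thm 1.14 p.96] -/
theorem stub_chartSmooth : ChartSmooth :=
  Summit.QuantumFields.YangMills.Theorems.FluctuationComparisonRegPrIntLS2BetaChartSmooth.chartSmooth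

/-- DET-REP-B stub (v11 docking; the S2β residue of DECAY for the operators OF RECORD: tube + edges + px19's product letters for the bound slice Hessians and
the chart∕Haar Jacobians — print's background-response decay and coarse-unit propagator decay, NOT in the tree).
[cite: Balaban1985Variational, Thm 1 (8)-(10) p.279; Balaban1984PropagatorsII, (1.33)] -/
theorem stub_detRepB : DetRepB := by
  sorry

/-- **FOUR-POINT-DECAY — A THEOREM (v11; v11.2: from GAP♯ and DET-REP-B alone)** by `fourPtDecay_of_detRep` (DET-REP-A = w5-20520 g14's ✓`detRepA_edge'`, CHART∞ =
w3-20520's ✓`exists_laplaceRows₂`, (C2″) = w5's ✓`…windowChart_param_within`, all consumed by name inside).  Was the v8–v10.1 docking stub. [cite: Balaban1985Variational, Thm 1 (8)-(10) p.279; Balaban1984PropagatorsII, (1.33)] -/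
theorem stub_fourPtDecay : FourPtDecay :=
  fourPtDecay_of_detRep stub_uniformFibreGapOrbit stub_detRepB

/-- **THE PER-CORNER SCALED LAPLACE LIMIT (PROVED, v8)**: at a window datum `x`, from EXW (a minimising small-field history `U₀` exists: clause 2), GAP♯ at
`(x, U₀)` (orbit-distance growth, through px11 g10's seam (e) `…S2BetaFibreTransport.limitInst_exw_gap_rows_of_chartRows`; quadratic growth along the
transversal = GAP♯ ∘ ✓`…S2BetaFibreGrowth.growth_of_offPivot_orbitDist_le` ∘ the package's (T2) row, on the event `c.Φ (x,·) ∈ histGood`, which holds along `σ`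
near `0` by the relative openness row), the chart rows and the chart package at `(x, U₀)` ((C2) row + growth → Hessian rows by
✓`…S2BetaLaplacePeano.hessianRows_of_contDiffAt_of_growth`), the LIMIT door
✓`…S2BetaLaplaceInstLocal.laplaceLimit_of_charts_local` (w5-20520 g13∕g14) yields `∃ ℓ > 0, λ^{dV∕2}·(heightDensityCan(γ∕λ) x · e^{λ β_K m(x)}) → ℓ`.
[cite: Balaban1985Variational, Thm 1 (8)-(10) p.279; Breitung1994, Thm 41 p.56] -/
theorem cornerLimit_of_rows (F : T3Family) {γ : ℝ} (hγ : 0 < γ) (b₀ p₀ ε₀ : ℝ) {J K : ℕ} (hJK : J ≤ K) {μ : ℝ} (hμ : 0 < μ) {cw : ℝ}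
    (hE : ∀ (V : GaugeField (F.P J) 0 (Matrix.specialUnitaryGroup (Fin 2) ℂ)), PlaqSmall (θBal F.L γ (cw * b₀) p₀ J) V →
        (∀ U ∈ fibre F ℰp J K hJK V, U ∈ histGood F ℰp (θBal F.L γ b₀ p₀) K J →
            minActionRegPr F J K hJK ε₀ V ≤ wilsonAction4 U) ∧
        (∃ U₀ ∈ regFibrePr F J K hJK ε₀ V, U₀ ∈ histGood F ℰp (θBal F.L γ b₀ p₀) K J ∧
            wilsonAction4 U₀ = minActionRegPr F J K hJK ε₀ V))
    (hG : ∀ (V : GaugeField (F.P J) 0 (Matrix.specialUnitaryGroup (Fin 2) ℂ)), PlaqSmall (θBal F.L γ (cw * b₀) p₀ J) V →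
        ∀ U₀ ∈ argminHist F γ b₀ p₀ ε₀ hJK V, ∀ U ∈ fibre F ℰp J K hJK V, U ∈ histGood F ℰp (θBal F.L γ b₀ p₀) K J →
          μ * ((F.L : ℝ)⁻¹) ^ (2 * (K - J)) *
              (⨅ w : ResidualGauge F hJK, ∑ ℓ : PBond (F.P K) 0,
                dist1 (U ℓ * ((GaugeField.gaugeAct (w : GaugeTransf (F.P K) 0 (Matrix.specialUnitaryGroup (Fin 2) ℂ)) U₀) ℓ)⁻¹) ^ 2)
            ≤ wilsonAction4 U - minActionRegPr F J K hJK ε₀ V)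
    {dZ dV : ℕ} {Sst : Set (↥(Summit.QuantumFields.YangMills.Theorems.FluctuationComparisonRegPrIntLS2BetaResidualSubgroup.residualSubgroup F hJK) × (PBond (F.P K) (K - J) → (Matrix.specialUnitaryGroup (Fin 2) ℂ)))}
    {c : Summit.QuantumFields.YangMills.Theorems.FluctuationComparisonRegPrIntLWregGlue.WindowChart F hJK (histGood F ℰp (θBal F.L γ b₀ p₀) K J)
      {V : GaugeField (F.P J) 0 (Matrix.specialUnitaryGroup (Fin 2) ℂ) | PlaqSmall (θBal F.L γ b₀ p₀ J) V}}
    (hCR : ChartRows F γ b₀ p₀ hJK c)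
    (hPK : ∀ (V : GaugeField (F.P J) 0 (Matrix.specialUnitaryGroup (Fin 2) ℂ)), PlaqSmall (θBal F.L γ b₀ p₀ J) V →
      ∀ U₀ ∈ argminHist F γ b₀ p₀ ε₀ hJK V, ChartPackage F γ b₀ p₀ hJK c dZ dV Sst V U₀)
    (x : GaugeField (F.P J) 0 (Matrix.specialUnitaryGroup (Fin 2) ℂ)) (hxI : PlaqSmall (θBal F.L γ (cw * b₀) p₀ J) x) (hx : PlaqSmall (θBal F.L γ b₀ p₀ J) x) :
    ∃ ℓ : ℝ, 0 < ℓ ∧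
      Tendsto (fun lam : ℝ => lam ^ ((dV : ℝ) / 2) *
        (heightDensityCan F (γ / lam) hJK (histGood F ℰp (θBal F.L γ b₀ p₀) K J) x *
          Real.exp (lam * (F.scheme ℰp γ).β K * minActionRegPr F J K hJK ε₀ x))) atTop (𝓝 ℓ) := by
  classical
  obtain ⟨-, U₀, hU₀reg, hU₀good, hU₀min⟩ := hE x hxI
  have hU₀fib : U₀ ∈ fibre F ℰp J K hJK x := ((mem_regFibrePr_iff F).1 hU₀reg).1
  have hU₀arg : U₀ ∈ argminHist F γ b₀ p₀ ε₀ hJK x := ⟨hU₀fib, hU₀good, hU₀min⟩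
  obtain ⟨e, σ, Wn, Jd, ρ, he, he1, he𝓝, hσ, hσ0, hσX, ⟨c₂, hc₂, hT2⟩, hΘ'𝓝, hWo, hinj, hJc, hJ0, hchart, hρ, hρW, hJ00, hstab, hfix, hC2⟩ :=
    hPK x hx U₀ hU₀arg
  obtain ⟨hXc, hXinv, hvan, hA, ha, hΦc, hAinv, hainv, hOrel, hOinv, hoff, hfib, hrec⟩ := hCR x
  obtain ⟨hself, -⟩ := hrec U₀ hU₀fib hU₀good
  have hLpos : (0 : ℝ) < F.L := Nat.cast_pos.2 (by have := F.hL.2; omega)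
  have hμ' : 0 < μ * ((F.L : ℝ)⁻¹) ^ (2 * (K - J)) := mul_pos hμ (pow_pos (inv_pos.2 hLpos) _)
  have hgap := fun U hU hUS => hG x hxI U₀ hU₀arg U hU hUS
  obtain ⟨hO0, hmin, ha0, hg, hg0, hgpos, hgrow⟩ :=
    Summit.QuantumFields.YangMills.Theorems.FluctuationComparisonRegPrIntLS2BetaFibreTransport.limitInst_exw_gap_rows_of_chartRows F hJK c.Φ c.jac
      hμ' hU₀good hU₀min hself hgap hoff hfib hΦc
  -- the event `c.Φ (x, ·) ∈ histGood` is relatively open in the carrier (hOrel), so it holds along the transversal near `0`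
  obtain ⟨O', hO'open, hO'eq⟩ := isOpen_induced_iff.1 hOrel
  have hO'iff : ∀ z (hz : z ∈ {z : GaugeField (F.P K) 0 (Matrix.specialUnitaryGroup (Fin 2) ℂ) | c.jac (x, z) ≠ 0}), z ∈ O' ↔ c.Φ (x, z) ∈ (histGood F ℰp (θBal F.L γ b₀ p₀) K J) := fun z hz => by
    have h := congrArg (fun s : Set {z : GaugeField (F.P K) 0 (Matrix.specialUnitaryGroup (Fin 2) ℂ) | c.jac (x, z) ≠ 0} => (⟨z, hz⟩ : {z : GaugeField (F.P K) 0 (Matrix.specialUnitaryGroup (Fin 2) ℂ) | c.jac (x, z) ≠ 0}) ∈ s) hO'eq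
    exact Iff.of_eq h
  have hU₀O' : U₀ ∈ O' := (hO'iff U₀ hself.1).2 (by rw [hself.2]; exact hU₀good)
  have hσO' : ∀ᶠ y in 𝓝 (0 : EuclideanSpace ℝ (Fin dV)), σ y ∈ O' :=
    (hσ.tendsto' 0 U₀ hσ0).eventually (hO'open.mem_nhds hU₀O')
  -- growth along the transversal: GAP♯ ∘ (H2-red) ∘ (T2)
  have hgrowth : ∀ᶠ y in 𝓝 (0 : EuclideanSpace ℝ (Fin dV)),
      (μ * ((F.L : ℝ)⁻¹) ^ (2 * (K - J)) * c₂) * ‖y‖ ^ 2 ≤ wilsonAction4 (c.Φ (x, σ y)) - wilsonAction4 (c.Φ (x, σ 0)) := by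
    filter_upwards [hσX, hT2, hσO'] with y hyX hyT hyO
    have hyG : c.Φ (x, σ y) ∈ (histGood F ℰp (θBal F.L γ b₀ p₀) K J) := (hO'iff (σ y) hyX).1 hyO
    have h := Summit.QuantumFields.YangMills.Theorems.FluctuationComparisonRegPrIntLS2BetaFibreGrowth.growth_of_offPivot_orbitDist_le F hJK c.Φ hμ'
      hgap hoff hfib hyX hyG (t := c₂ * ‖y‖ ^ 2) hyT
    have h0 : wilsonAction4 (c.Φ (x, σ 0)) = minActionRegPr F J K hJK ε₀ x := by rw [hσ0, hself.2]; exact hU₀min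
    rw [h0]
    nlinarith [h, hc₂, hμ', norm_nonneg y]
  obtain ⟨Ah, hAs, hpos, hS2⟩ :=
    Summit.QuantumFields.YangMills.Theorems.FluctuationComparisonRegPrIntLS2BetaLaplacePeano.hessianRows_of_contDiffAt_of_growth hC2 (mul_pos hμ' hc₂) hgrowth
  haveI := Summit.QuantumFields.YangMills.Theorems.FluctuationComparisonRegPrIntLS2BetaResidualSubgroup.compactSpace_residualSubgroup F hJK
  have hk : K - J ≤ (F.P K).m + (F.P K).K := by
    show K - J ≤ F.m + K
    omega
  subst hσ0
  exact Summit.QuantumFields.YangMills.Theorems.FluctuationComparisonRegPrIntLS2BetaLaplaceInstLocal.laplaceLimit_of_charts_local F hγ hJK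
    (measurableSet_histGood F ℰp measurableE_ℰp _ K J)
    (Summit.QuantumFields.YangMills.Theorems.FluctuationComparisonRegPrIntLWregAssembly.isOpen_setOf_plaqSmall₂ (F.P J) 0 _) c hx
    (minActionRegPr F J K hJK ε₀ x) (Summit.QuantumFields.YangMills.Theorems.FluctuationComparisonRegPrIntLS2BetaResidualSubgroup.residualSubgroup F hJK) (Summit.QuantumFields.YangMills.Theorems.FluctuationComparisonRegPrIntLS2BetaResidualSubgroup.compactSpace_residualSubgroup F hJK) MeasureTheory.Measure.haar
    (Summit.QuantumFields.YangMills.Theorems.FluctuationComparisonRegPrIntLS2BetaResidualSubgroup.pivotAct F hJK (Summit.QuantumFields.YangMills.Theorems.FluctuationComparisonRegPrIntLWregChain.iterCentralBond (P := F.P K) (K - J)))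
    (Summit.QuantumFields.YangMills.Theorems.FluctuationComparisonRegPrIntLS2BetaResidualSubgroup.continuous_pivotAct F hJK _)
    (Summit.QuantumFields.YangMills.Theorems.FluctuationComparisonRegPrIntLS2BetaResidualSubgroup.pivotAct_mul F hJK _ (Summit.QuantumFields.YangMills.Theorems.FluctuationComparisonRegPrIntLWregChain.iterCentralBond_injective (P := F.P K) hk))
    (Summit.QuantumFields.YangMills.Theorems.FluctuationComparisonRegPrIntLS2BetaResidualSubgroup.pivotAct_one F hJK _)
    (Summit.QuantumFields.YangMills.Theorems.FluctuationComparisonRegPrIntLS2BetaResidualSubgroup.measurePreserving_pivotAct F hJK _)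
    hXc hXinv hvan hA ha hAinv hainv hOrel hOinv e σ he he1 he𝓝 hσ hσX hΘ'𝓝 hWo hinj hJc hJ0 hchart hρ hρW hJ00 hstab hfix hO0 hmin ha0
    hg hg0 hgpos hgrow hAs hpos hS2

/-- **LAPLACE · NOW A THEOREM (v8 docking, LINE OWNER WORD 12 (1); v11.4: ∘-edition)**: EXW∘ → GAP♯∘ → WREG → 1L4ᶜ∘ from CHART-SMOOTH (closed by name, full window) and
FOUR-POINT-DECAY∘; the common fraction `c₀ := min`, and the ONE new move «a `cw`-interior datum is a window datum» (`θBal_mul_le` + `plaqSmall_of_le`) wherever the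
chart of record, WREG or a proved supplier keyed to the full window at profile `b₀` meets an interior datum.
(R) ∧ (P) at the couplings `γ∕λ` by WREG (`oneLoopRP_of_windowRegularity`); (T) per quadrilateral: the four per-corner scaled Laplace limits
(`cornerLimit_of_rows`: EXW clause 2 → GAP♯ → seam (e) → PEANO → LIMIT), knitted by ✓`…S2BetaLaplaceKnit.tendsto_fourPt_fluct_of_laplaceLimits` (the
`(dV∕2)·log λ` terms are datum-independent and cancel in the 4-point), the canonical one-loop 4-point identified by `oneLoopFourPtCan_eq_of_tendsto`, and
bounded by FOUR-POINT-DECAY at the (unique) limit values. [cite: Balaban1985Variational, Thm 1 (8)-(10) p.279; Dimock2013BalabanII, (282)-(284)] -/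
theorem oneLoopLaplace_of_docking (hCS : ChartSmooth) (hFD : FourPtDecay) :
    WindowExactness → UniformFibreGapOrbit → WindowRegularity → OneLoopClusteredIntCan := by
  intro hE hG hW L
  obtain ⟨cE, hcE, hcE1, HE⟩ := hE L
  obtain ⟨cG, hcG, -, HG⟩ := hG L
  obtain ⟨pC, HC⟩ := hCS L
  obtain ⟨cD, hcD, -, HD⟩ := hFD L
  refine ⟨min cE (min cG cD), lt_min hcE (lt_min hcG hcD), (min_le_left _ _).trans hcE1, fun cw hcw hcwle => ?_⟩
  have hcw1 : cw ≤ 1 := hcwle.trans ((min_le_left _ _).trans hcE1)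
  obtain ⟨pE, HE⟩ := HE cw hcw (hcwle.trans (min_le_left _ _))
  obtain ⟨pG, HG⟩ := HG cw hcw (hcwle.trans ((min_le_right _ _).trans (min_le_left _ _)))
  obtain ⟨pD, HD⟩ := HD cw hcw (hcwle.trans ((min_le_right _ _).trans (min_le_right _ _)))
  refine ⟨max (max pE pG) (max pC pD), fun b₀ p₀ hb hp hp0 => ?_⟩
  obtain ⟨εE, hεE, HE1⟩ := HE b₀ p₀ hb ((le_max_left _ _).trans ((le_max_left _ _).trans hp)) hp0
  obtain ⟨εG, hεG, HG1⟩ := HG b₀ p₀ hb ((le_max_right _ _).trans ((le_max_left _ _).trans hp)) hp0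
  obtain ⟨εC, hεC, HC1⟩ := HC b₀ p₀ hb ((le_max_left _ _).trans ((le_max_right _ _).trans hp)) hp0
  obtain ⟨εD, hεD, HD1⟩ := HD b₀ p₀ hb ((le_max_right _ _).trans ((le_max_right _ _).trans hp)) hp0
  refine ⟨min (min εE εG) (min εC εD), lt_min (lt_min hεE hεG) (lt_min hεC hεD), fun ε₀ hε₀ hε₀le => ?_⟩
  obtain ⟨γE, hγE, HE2⟩ := HE1 ε₀ hε₀ (hε₀le.trans ((min_le_left _ _).trans (min_le_left _ _)))
  obtain ⟨γG, hγG, μ, hμ, HG2⟩ := HG1 ε₀ hε₀ (hε₀le.trans ((min_le_left _ _).trans (min_le_right _ _)))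
  obtain ⟨γC, hγC, HC2⟩ := HC1 ε₀ hε₀ (hε₀le.trans ((min_le_right _ _).trans (min_le_left _ _)))
  obtain ⟨γD, hγD, κ, hκ, HD2⟩ := HD1 ε₀ hε₀ (hε₀le.trans ((min_le_right _ _).trans (min_le_right _ _)))
  obtain ⟨γW, hγW, HW⟩ := oneLoopRP_of_windowRegularity hW L b₀ p₀ hb hp0
  refine ⟨min (min γE γG) (min (min γC γD) (min γW 1)), lt_min (lt_min hγE hγG) (lt_min (lt_min hγC hγD) (lt_min hγW one_pos)), κ, hκ,
    fun F γ hFL hγ hγle => ?_⟩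
  have hγE' : γ ≤ γE := hγle.trans ((min_le_left _ _).trans (min_le_left _ _))
  have hγG' : γ ≤ γG := hγle.trans ((min_le_left _ _).trans (min_le_right _ _))
  have hγC' : γ ≤ γC := hγle.trans ((min_le_right _ _).trans ((min_le_left _ _).trans (min_le_left _ _)))
  have hγD' : γ ≤ γD := hγle.trans ((min_le_right _ _).trans ((min_le_left _ _).trans (min_le_right _ _)))
  have hγW' : γ ≤ γW := hγle.trans ((min_le_right _ _).trans ((min_le_right _ _).trans (min_le_left _ _)))
  have hγ1 : γ ≤ 1 := hγle.trans ((min_le_right _ _).trans ((min_le_right _ _).trans (min_le_right _ _)))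
  -- the `cw`-interior of the window lies in the window (the chart, WREG and the proved suppliers are keyed to the FULL window at profile `b₀`)
  have hFL1 : 1 ≤ F.L := le_of_lt F.hL.2
  have mono : ∀ (J : ℕ) {X : GaugeField (F.P J) 0 (Matrix.specialUnitaryGroup (Fin 2) ℂ)},
      PlaqSmall (θBal F.L γ (cw * b₀) p₀ J) X → PlaqSmall (θBal F.L γ b₀ p₀ J) X := fun J X hX =>
    T3PrintedMinimiserExistence.plaqSmall_of_le (T3InteriorExcision.θBal_mul_le hFL1 hγ hγ1 hb hcw1 p₀ J) hX
  obtain ⟨φ₁, hφ0, hφlim, HD3⟩ := HD2 F γ hFL hγ hγD'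
  refine ⟨φ₁, hφ0, hφlim, fun J K hJK => ⟨fun lam hlam => ?_, fun lam hlam U hU => (HW F γ hFL hγ hγW' J K hJK).2 lam hlam U (mono J hU),
    fun b b' U V W Z hU hV hW' hZ h1 h2 h3 h4 => ?_⟩⟩
  · exact fun U hU => (HW F γ hFL hγ hγW' J K hJK).1 lam hlam (mono J hU)
  obtain ⟨dZ, dV, Sst, c, hCR, hPK⟩ := HC2 F γ hFL hγ hγC' J K hJK
  have corner := fun (x : GaugeField (F.P J) 0 (Matrix.specialUnitaryGroup (Fin 2) ℂ)) (hxI : PlaqSmall (θBal F.L γ (cw * b₀) p₀ J) x) =>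
    cornerLimit_of_rows F hγ b₀ p₀ ε₀ hJK hμ (HE2 F γ hFL hγ hγE' J K hJK) (HG2 F γ hFL hγ hγG' J K hJK) hCR hPK x hxI (mono J hxI)
  set ℓ : GaugeField (F.P J) 0 (Matrix.specialUnitaryGroup (Fin 2) ℂ) → ℝ := fun x =>
    limUnder atTop (fun lam : ℝ => lam ^ ((dV : ℝ) / 2) *
      (heightDensityCan F (γ / lam) hJK (histGood F ℰp (θBal F.L γ b₀ p₀) K J) x *
        Real.exp (lam * (F.scheme ℰp γ).β K * minActionRegPr F J K hJK ε₀ x))) with hℓ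
  have key : ∀ x, PlaqSmall (θBal F.L γ (cw * b₀) p₀ J) x → 0 < ℓ x ∧
      Tendsto (fun lam : ℝ => lam ^ ((dV : ℝ) / 2) *
        (heightDensityCan F (γ / lam) hJK (histGood F ℰp (θBal F.L γ b₀ p₀) K J) x *
          Real.exp (lam * (F.scheme ℰp γ).β K * minActionRegPr F J K hJK ε₀ x))) atTop (𝓝 (ℓ x)) := by
    intro x hx
    obtain ⟨l, hl, t⟩ := corner x hx
    have hlx : ℓ x = l := t.limUnder_eq
    rw [hlx]
    exact ⟨hl, t⟩
  have tend : Tendsto (fun lam : ℝ => fourPt (fluctAtCan F γ b₀ p₀ ε₀ hJK lam) U V W Z) atTop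
      (𝓝 ((Real.log (ℓ U) - Real.log (ℓ V)) - (Real.log (ℓ W) - Real.log (ℓ Z)))) := by
    unfold fourPt fluctAtCan heightDensityCan
    exact Summit.QuantumFields.YangMills.Theorems.FluctuationComparisonRegPrIntLS2BetaLaplaceKnit.tendsto_fourPt_fluct_of_laplaceLimits F γ hJK
      (histGood F ℰp (θBal F.L γ b₀ p₀) K J) (minActionRegPr F J K hJK ε₀)
      (key U hU).2 (key V hV).2 (key W hW').2 (key Z hZ).2 (key U hU).1 (key V hV).1 (key W hW').1 (key Z hZ).1
  have heq := oneLoopFourPtCan_eq_of_tendsto F γ b₀ p₀ ε₀ hJK U V W Z tend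
  rw [heq]
  exact ⟨tend, HD3 J K hJK (dV : ℝ) b b' U V W Z ℓ hU hV hW' hZ h1 h2 h3 h4
    (fun x hx' => by rcases hx' with rfl | rfl | rfl | rfl <;> exact key _ ‹_›)⟩

/-- **LAPLACE**: EXW → GAP♯ → WREG → 1L4ᶜ — a THEOREM since v8 (from `stub_chartSmooth` and `stub_fourPtDecay` by `oneLoopLaplace_of_docking`; was the
LAPLACE stub of v4–v7). [cite: Balaban1985Variational, Thm 1 (8)-(10) p.279; Dimock2013BalabanII, (282)-(284)] -/
theorem stub_oneLoopLaplace : WindowExactness → UniformFibreGapOrbit → WindowRegularity → OneLoopClusteredIntCan :=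
  oneLoopLaplace_of_docking stub_chartSmooth stub_fourPtDecay

/-- **1L4ᶜ∘ FROM THE THREE ORGANS AND THE LAPLACE ROW** (v4; v6: GAP♯; v11.4: ∘). [cite: Balaban1985Variational, Thm 1 (8) p.279] -/
theorem oneLoopClusteredIntCan_of_organs : OneLoopClusteredIntCan :=
  stub_oneLoopLaplace stub_windowExactness stub_uniformFibreGapOrbit stub_windowRegularity

/-- H4ᶜ∘ stub (row 2 on the interior window: the quantum corrections, over the canonical version; text = `Lines/interior_table.lean` v1's). [cite: Balaban1985UV3, (45)-(47) p.267] -/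
theorem stub_beyondOneLoopSmallIntCan : BeyondOneLoopSmallIntCan := by
  sorry

/-- LFR♯ᶜ∘ stub (row 3 on the interior window: the large-field 4-point remainder; text = `Lines/interior_table.lean` v1's). [cite: Balaban1988Convergent, §2 (2.18)-(2.27)] -/
theorem stub_largeFieldFourPtIntCan : LargeFieldFourPtIntCan := by
  sorry

/-- **S2β FROM THE INTERIOR TABLE** (v11.4, ★★OWNER WORD 87 (2)): the package's registered input `FluctuationPartSmall` (v15 text, unchanged), from the five stubs by the
proved ∘-composition `fluctuationPartSmall_of_interiorTable` (common fraction, `b₀ ∕ c` instantiation) over the canonical version. [cite: Balaban1985UV3, (41) p.266] -/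
theorem fluctuationPartSmall_of_stubs : FluctuationPartSmall :=
  fluctuationPartSmall_of_interiorTable oneLoopClusteredIntCan_of_organs stub_beyondOneLoopSmallIntCan stub_largeFieldFourPtIntCan

end Summit.QuantumFields.YangMills.Cruxes.FluctuationComparisonRegPrIntL.RunPairOrgan.OneLoop

end
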